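import Literature.NumberTheory.EllipticCurves.DescendedFrobeniusNineIntegers
import Literature.NumberTheory.EllipticCurves.DescendedFrobeniusFormalGroupToolkit
import HarnessLib

/-!
# The descended crystalline Frobenius matrix at `3` over `ℚ₃(ζ₉)` (Katz 1981, Berthelot–Ogus 1983), 4/5 — integral coordinates, the Katz rank, `η`-integrality, independence of `[ω], [η]`, good-model uniqueness, the `ω`-column, one model (re-homed proofs)

**The named fact `WeierstrassCurve.isDescendedFrobeniusMatrix_exists` (`DescendedFrobeniusMatrix.lean`: for `W/ℚ` with a good model over `𝓞_L`,
`L = ℚ₃(ζ₉)`, of supersingular special fibre, a descended crystalline Frobenius matrix `M ∈ M₂(ℚ₃)` exists and `tr M = a`) HOLDS — EXACT name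
`WeierstrassCurve.isDescendedFrobeniusMatrix_exists_holds`** ([Katz1981CrystallineDieudonne] N. Katz, *Crystalline cohomology, Dieudonné modules, and Jacobi sums*,
Thm. 5.1.4, 5.3.3, (5.5.7), 5.7.2, (6.1.1); [BerthelotOgus1983] (2.4), (3.14); Honda's theory of formal groups and the Katz–Messing point-count relation
`φ² − aφ + 3 = 0`).  Contents: (1, definitions file) `μ`, `λ`, the reduction mod `p` and the `p`-free part of a power series over `ℤ_p`;
(2–4) the ring `𝓞_L = ℤ₃[ζ₉]` (`ONine`: integers, residue map, local structure, integral coordinates), transfer of the descended Frobenius along good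
models (semantics, basis, good-model transport and its calculus), the formal endomorphism algebra and its `p`-adic digits, Katz's Frobenius modulo `ϖ` and
the Frobenius relation, bounded formal logarithms `⇔` divisibility, the `p`-adic rank-two assembly, coefficient computations in the formal group of a
Weierstrass curve (`formalW`, `formalΩ`, `formalLog`), the formal `η`-coboundary and residue, Honda estimates and congruences, unbounded `log`, `η`-integrality,
independence of the classes `[ω], [η]`, the second-kind logarithm, the Katz rank of a `p`-adic rank, the supersingular Katz rank, the `p`-adic digit limit;
(5) Galois descent from `L` to `ℚ₃`, the named fact from the Katz rank, the rank-two reduction, and the discharge.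
RE-HOMED into `Literature/` by the Hodge foundations lane (`lit-hodgefound`, seat p20, generation 40): verbatim DECLARATION-LEVEL ports (the 331 declarations needed, in
dependency order; each Part is a slice of one Summits module) of 45 theorem modules `Summits/BirchSwinnertonDyer/BirchSwinnertonDyer/Theorems/CyclotomicUntwist*.lean`
(+ three formal-group coefficient files and `Rank1Residual/{X1/MuLambdaAlgebra,O5/…}`); the namespace `Summit.BirchSwinnertonDyer.BirchSwinnertonDyer.Theorems` is re-rooted at
`Literature.NumberTheory.EllipticCurves.DescendedFrobenius` (module sub-namespaces kept; the coefficient lemmas gathered in `….FormalGroupCoefficients`, the two `3`-adic norm lemmas in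
`….PadicNormAux`, `μ`/`λ` in `Literature.NumberTheory.EllipticCurves.MuLambda`).  No new named fact (D-0026); imports Mathlib/Literature only; every declaration carries the citation of the
printed statement it formalises or serves.  The Summits originals stay in place (transitional duplication).  WHAT THIS IS NOT: nothing here bears on BSD; it is the
crystalline / formal-group computation of the Frobenius matrix at `3` for curves acquiring good reduction over `ℚ₃(ζ₉)`.  (This is file 4 of 5.)
-/

noncomputable section

/-!
## Part 1 — port of `Summits/BirchSwinnertonDyer/BirchSwinnertonDyer/Theorems/CyclotomicUntwistFormalEtaCoboundary.lean` (8 declarations kept)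

# The class of `η = x·ω` is of the second kind — the coboundary of `formalEtaIntegral` under the chord–tangent law in closed form (the formal `ζ`-addition law), hence integral

Declarations of this Part (verbatim port; each keeps its own docstring and citation): `pderiv_coboundary`, `subst_sq_mul_q`, `subst_formalXMulSq_mul_formalW`, `X_ne_zero'`, `formalChordZ_ne_zero`, `pderiv_cobDefect`, `constantCoeff_cobDefect`, `formalEtaIntegral_coboundary_eq`.

Reference keys (see `references.bib` and the declarations' citations): [SilvermanAEC2009], [Katz1981CrystallineDieudonne].
-/

section Part1

open _root_.PowerSeries Literature.NumberTheory.EllipticCurves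
open Literature.AlgebraicGeometry.Resolution (MvPowerSeries.pderiv MvPowerSeries.coeff_pderiv
  MvPowerSeries.pderiv_X MvPowerSeries.pderiv_C MvPowerSeries.pderiv_powerSeries_subst
  MvPowerSeries.pderiv_powerSeries_subst_X MvPowerSeries.coeff_eq_zero_of_pderiv_eq_zero)

namespace Literature.NumberTheory.EllipticCurves.DescendedFrobenius.FormalEtaCoboundary

/-! ## §3 The closed form: `∂L_η = a₁ − (a₁ + a₃λ + a₄ν + 2a₆λν)(1 − a₃ν − a₆ν²)⁻¹ + a₃ z₃² B(z₃)` -/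

section Main

variable {A : Type*} [CommRing A] [IsDomain A] [Algebra ℚ A] (V : WeierstrassCurve A)

omit [IsDomain A] in
/-- `∂ᵢ (L_η(F) − L_η(z₁) − L_η(z₂)) = L_η′(F)·∂ᵢF − L_η′(zᵢ)` (chain rule). [cite: SilvermanAEC2009, III.5.1] -/
theorem pderiv_coboundary (i : Fin 2) :
    MvPowerSeries.pderiv i (V.formalEtaIntegral.subst V.formalGroupLaw -
        V.formalEtaIntegral.subst (MvPowerSeries.X 0 : MvPowerSeries (Fin 2) A) -
        V.formalEtaIntegral.subst (MvPowerSeries.X 1 : MvPowerSeries (Fin 2) A)) =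
      (d⁄dX A V.formalEtaIntegral).subst V.formalGroupLaw * MvPowerSeries.pderiv i V.formalGroupLaw -
        (d⁄dX A V.formalEtaIntegral).subst (MvPowerSeries.X i : MvPowerSeries (Fin 2) A) := by
  classical
  rw [map_sub, map_sub, MvPowerSeries.pderiv_powerSeries_subst V.constantCoeff_formalGroupLaw,
    MvPowerSeries.pderiv_powerSeries_subst_X, MvPowerSeries.pderiv_powerSeries_subst_X]
  fin_cases i <;> simp

omit [IsDomain A] in
/-- Substituted form of `z²·(η·L_η′) = z²x − η`: `g² · (η L_η′)(g) = (z²x)(g) − η(g)`. [cite: SilvermanAEC2009, III.5.1] -/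
theorem subst_sq_mul_q {g : MvPowerSeries (Fin 2) A} (hg : PowerSeries.HasSubst g) :
    g ^ 2 * (V.formalEta * d⁄dX A V.formalEtaIntegral).subst g = V.formalXMulSq.subst g - V.formalEta.subst g := by
  have h := congrArg (PowerSeries.subst g) (X_sq_mul_formalEta_mul_derivative_formalEtaIntegral V)
  rw [PowerSeries.subst_mul hg, PowerSeries.subst_pow hg, PowerSeries.subst_X hg, PowerSeries.subst_sub hg] at h
  exact h

/-- Substituted form of `(z²x)·w = z³`: `(z²x)(g) · w(g) = g³`. [cite: SilvermanAEC2009, III.5.1] -/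
theorem subst_formalXMulSq_mul_formalW {R : Type*} [CommRing R] (W : WeierstrassCurve R)
    {g : MvPowerSeries (Fin 2) R} (hg : PowerSeries.HasSubst g) :
    W.formalXMulSq.subst g * W.formalW.subst g = g ^ 3 := by
  rw [← PowerSeries.subst_mul hg, W.formalXMulSq_mul_formalW, PowerSeries.subst_pow hg, PowerSeries.subst_X hg]

omit [IsDomain A] [Algebra ℚ A] in
/-- `zᵢ ≠ 0` in `A⟦z₁, z₂⟧`. [cite: SilvermanAEC2009, III.5.1] -/
theorem X_ne_zero' [Nontrivial A] (i : Fin 2) : (MvPowerSeries.X i : MvPowerSeries (Fin 2) A) ≠ 0 := by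
  classical
  intro h
  have := congrArg (MvPowerSeries.coeff (Finsupp.single i 1)) h
  rw [MvPowerSeries.coeff_index_single_X, if_pos rfl, map_zero] at this
  exact one_ne_zero this

omit [IsDomain A] [Algebra ℚ A] in
/-- `z₃ ≠ 0` (its `z₁`-coefficient is `−1`). [cite: SilvermanAEC2009, III.5.1] -/
theorem formalChordZ_ne_zero [Nontrivial A] : V.formalChordZ ≠ 0 := by
  intro h
  have := V.coeff_single_formalChordZ 0
  rw [h, map_zero] at this
  norm_num at this

/-- **The heart: `∂ᵢ(∂L_η − Φ) = 0`** for the closed form `Φ`. With `δ = ∂ᵢ`, `ηᵢ = η(zᵢ)`: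
`ηᵢ·δ(∂L_η) = q(F) − q(zᵢ)` (`q = η·L_η′`, invariance `ηᵢ δF = η(F)`); differentiating the bridge
`Fνz₁z₂·Φ = ν(z₁z₂ − F(z₁+z₂)) − λFz₁z₂` and using `ηᵢδλ = D(zᵢ − z₃)`, `δν = −zⱼδλ` expresses
`(Fνz₁z₂)²ηᵢ·δΦ`; the two agree by `x(F) − xᵢ = ν(z₃ − zᵢ)/(wᵢw₃)` (`q·z² = z²x − η`, `(z²x)·w = z³`,
`F·u = −z₃`, `w(F)·u = −w₃`) and Vieta `D w₁w₂w₃ = ν³`. [cite: SilvermanAEC2009, III.5.1] -/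
theorem pderiv_cobDefect (i : Fin 2) :
    MvPowerSeries.pderiv i (V.formalEtaIntegral.subst V.formalGroupLaw -
        V.formalEtaIntegral.subst (MvPowerSeries.X 0 : MvPowerSeries (Fin 2) A) -
        V.formalEtaIntegral.subst (MvPowerSeries.X 1 : MvPowerSeries (Fin 2) A) -
      (MvPowerSeries.C V.a₁ - (MvPowerSeries.C V.a₁ + MvPowerSeries.C V.a₃ * V.formalSlope +
            MvPowerSeries.C V.a₄ * V.formalIntercept + 2 * MvPowerSeries.C V.a₆ * V.formalSlope * V.formalIntercept) *
          MvPowerSeries.invOfUnit (1 - MvPowerSeries.C V.a₃ * V.formalIntercept -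
            MvPowerSeries.C V.a₆ * V.formalIntercept ^ 2) 1 +
          MvPowerSeries.C V.a₃ * (V.formalChordZ ^ 2 * V.formalWDivCube.subst V.formalChordZ))) = 0 := by
  classical
  -- opaque names
  obtain ⟨Φ, hΦ⟩ : ∃ Φ : MvPowerSeries (Fin 2) A, Φ = MvPowerSeries.C V.a₁ - (MvPowerSeries.C V.a₁ +
      MvPowerSeries.C V.a₃ * V.formalSlope + MvPowerSeries.C V.a₄ * V.formalIntercept +
      2 * MvPowerSeries.C V.a₆ * V.formalSlope * V.formalIntercept) *
        MvPowerSeries.invOfUnit (1 - MvPowerSeries.C V.a₃ * V.formalIntercept -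
          MvPowerSeries.C V.a₆ * V.formalIntercept ^ 2) 1 +
        MvPowerSeries.C V.a₃ * (V.formalChordZ ^ 2 * V.formalWDivCube.subst V.formalChordZ) := ⟨_, rfl⟩
  obtain ⟨Ψ, hΨ⟩ : ∃ Ψ : MvPowerSeries (Fin 2) A, Ψ = V.formalEtaIntegral.subst V.formalGroupLaw -
      V.formalEtaIntegral.subst (MvPowerSeries.X 0 : MvPowerSeries (Fin 2) A) -
      V.formalEtaIntegral.subst (MvPowerSeries.X 1 : MvPowerSeries (Fin 2) A) := ⟨_, rfl⟩
  rw [← hΦ, ← hΨ]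
  set δ := MvPowerSeries.pderiv (R := A) i with hδ
  set zi := (MvPowerSeries.X i : MvPowerSeries (Fin 2) A) with hzi
  set zj := (MvPowerSeries.X 0 : MvPowerSeries (Fin 2) A) + MvPowerSeries.X 1 - MvPowerSeries.X i with hzj
  have hF := V.hasSubst_formalGroupLaw
  have hXi : PowerSeries.HasSubst zi := PowerSeries.HasSubst.X i
  have hz₃ := V.hasSubst_formalChordZ
  -- the variables
  have hδzi : δ zi = 1 := by rw [hzi, hδ, MvPowerSeries.pderiv_X, if_pos rfl]
  have hδzj : δ zj = 0 := by
    rw [hzj, hδ, map_sub, map_add, MvPowerSeries.pderiv_X, MvPowerSeries.pderiv_X, MvPowerSeries.pderiv_X,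
      if_pos rfl]
    fin_cases i <;> simp
  have hmul : zi * zj = (MvPowerSeries.X 0 : MvPowerSeries (Fin 2) A) * MvPowerSeries.X 1 := X_mul_other i
  have hadd : zi + zj = (MvPowerSeries.X 0 : MvPowerSeries (Fin 2) A) + MvPowerSeries.X 1 := by rw [hzj]; ring
  -- δΨ and the invariance
  have hδΨ : δ Ψ = (d⁄dX A V.formalEtaIntegral).subst V.formalGroupLaw * δ V.formalGroupLaw -
      (d⁄dX A V.formalEtaIntegral).subst zi := by rw [hΨ]; exact pderiv_coboundary V i
  have hηdF : V.formalEta.subst zi * δ V.formalGroupLaw = V.formalEta.subst V.formalGroupLaw :=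
    V.formalEta_subst_X_mul_pderiv_formalGroupLaw i
  -- `q = η · L_η′` at `F` and at `zᵢ`
  have hqF' : (V.formalEta * d⁄dX A V.formalEtaIntegral).subst V.formalGroupLaw =
      V.formalEta.subst V.formalGroupLaw * (d⁄dX A V.formalEtaIntegral).subst V.formalGroupLaw :=
    PowerSeries.subst_mul hF _ _
  have hqi' : (V.formalEta * d⁄dX A V.formalEtaIntegral).subst zi =
      V.formalEta.subst zi * (d⁄dX A V.formalEtaIntegral).subst zi := PowerSeries.subst_mul hXi _ _
  have hqF := subst_sq_mul_q V hF
  have hqi := subst_sq_mul_q V hXi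
  have hTF := subst_formalXMulSq_mul_formalW V hF
  have hTi := subst_formalXMulSq_mul_formalW V hXi
  have hT₃ := subst_formalXMulSq_mul_formalW V hz₃
  -- the chord: `wᵢ = λzᵢ + ν`, `w(z₃) = λz₃ + ν`, `F u = −z₃`, `w(F) u = −w₃`, Vieta
  have hwi := formalSlope_mul_X_add_formalIntercept V i
  have hw₃ := V.formalW_subst_formalChordZ
  have hFu := V.formalGroupLaw_mul_formalNegDenom
  have hwFu := V.formalW_subst_formalGroupLaw_mul_formalNegDenom
  have hV3 : V.formalChordDenom * (V.formalSlope ^ 2 * (zi * zj) + V.formalSlope * V.formalIntercept * (zi + zj) +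
      V.formalIntercept ^ 2) * (V.formalSlope * V.formalChordZ + V.formalIntercept) = V.formalIntercept ^ 3 := by
    rw [hmul, hadd]; linear_combination formalChordDenom_mul_prod_w V
  -- the differentiated incidences
  obtain ⟨hdL, hdV⟩ := formalEta_mul_pderiv_formalSlope V i
  rw [← hδ] at hdL hdV
  have hdV' : V.formalEta.subst zi * δ V.formalIntercept =
      -zj * (V.formalChordDenom * (zi - V.formalChordZ)) := by
    rw [hdV]; linear_combination (-zj) * hdL
  -- the bridge, in the variables `zᵢ, zⱼ`, and its derivative
  have hB : V.formalGroupLaw * V.formalIntercept * (zi * zj) * Φ =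
      V.formalIntercept * (zi * zj - V.formalGroupLaw * (zi + zj)) -
        V.formalSlope * V.formalGroupLaw * (zi * zj) := by
    have hb := bridge V
    rw [← hΦ] at hb
    linear_combination hb + (V.formalGroupLaw * V.formalIntercept * Φ - V.formalIntercept +
      V.formalSlope * V.formalGroupLaw) * hmul + (V.formalIntercept * V.formalGroupLaw) * hadd
  have E1 := congrArg δ hB
  simp only [map_sub, map_add, Derivation.leibniz, smul_eq_mul, hδzi, hδzj, mul_one, mul_zero,
    add_zero, zero_add] at E1
  -- non-vanishing of the factors to be cancelled
  have hzi0 : zi ≠ 0 := X_ne_zero' i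
  have hz₃0 : V.formalChordZ ≠ 0 := formalChordZ_ne_zero V
  have hu : IsUnit (1 - MvPowerSeries.C V.a₁ * V.formalChordZ -
      MvPowerSeries.C V.a₃ * (V.formalSlope * V.formalChordZ + V.formalIntercept)) :=
    V.isUnit_formalNegDenom_formalChordZ
  have hF0 : V.formalGroupLaw ≠ 0 := by
    intro h; rw [h, zero_mul, zero_add] at hFu; exact hz₃0 hFu
  have hwi0 : V.formalW.subst zi ≠ 0 := by
    intro h; rw [h, mul_zero] at hTi; exact pow_ne_zero 3 hzi0 hTi.symm
  have hwF0 : V.formalW.subst V.formalGroupLaw ≠ 0 := by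
    intro h; rw [h, mul_zero] at hTF; exact pow_ne_zero 3 hF0 hTF.symm
  have hw₃0 : V.formalSlope * V.formalChordZ + V.formalIntercept ≠ 0 := by
    intro h; rw [← hw₃] at h; rw [h, mul_zero] at hT₃; exact pow_ne_zero 3 hz₃0 hT₃.symm
  have hzj0 : zj ≠ 0 := by
    rw [hzj]; fin_cases i
    · simpa using X_ne_zero' (A := A) 1
    · simpa using X_ne_zero' (A := A) 0
  have hwj0 : V.formalSlope * zj + V.formalIntercept ≠ 0 := by
    have : V.formalSlope * zj + V.formalIntercept = V.formalW.subst zj := by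
      rw [hzj]; fin_cases i
      · simpa using V.formalSlope_mul_X_one_add_formalIntercept
      · simpa using V.formalSlope_mul_X_zero_add_formalIntercept
    rw [this]
    have hzj' : PowerSeries.HasSubst zj := PowerSeries.HasSubst.of_constantCoeff_zero (by rw [hzj]; simp)
    have hT := subst_formalXMulSq_mul_formalW V hzj'
    intro h; rw [h, mul_zero] at hT; exact pow_ne_zero 3 hzj0 hT.symm
  have hV0 : V.formalIntercept ≠ 0 := by
    intro h
    have h3 : V.formalChordDenom * V.formalSlope ^ 3 * V.formalChordZ * (zi * zj) = 0 := by
      have h3 := hV3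
      rw [h] at h3
      linear_combination h3
    rcases mul_eq_zero.mp h3 with h4 | h4
    · rcases mul_eq_zero.mp h4 with h5 | h5
      · rcases mul_eq_zero.mp h5 with h6 | h6
        · exact V.formalChordDenom_ne_zero h6
        · -- `λ = 0` would force `wᵢ = ν = 0`
          have hL0 : V.formalSlope = 0 := (pow_eq_zero_iff three_ne_zero).mp h6
          have : V.formalW.subst zi = 0 := by rw [← hwi, h, hL0]; ring
          exact hwi0 this
      · exact hz₃0 h5
    · exact mul_ne_zero hzi0 hzj0 h4
  have hηi : IsUnit (V.formalEta.subst zi) := by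
    rw [MvPowerSeries.isUnit_iff_constantCoeff, V.formalEta_subst hXi]
    simp [hzi, constantCoeff_powerSeries_subst_eq_zero (MvPowerSeries.constantCoeff_X i) V.constantCoeff_formalW]
  -- ABBREVIATIONS
  set F := V.formalGroupLaw with hFdef
  set L := V.formalSlope
  set N := V.formalIntercept
  set D := V.formalChordDenom
  set z₃ := V.formalChordZ
  set wi := V.formalW.subst zi
  set wF := V.formalW.subst F
  set TF := V.formalXMulSq.subst F
  set Ti := V.formalXMulSq.subst zi
  set ηi := V.formalEta.subst zi
  set ηF := V.formalEta.subst F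
  set eF := (d⁄dX A V.formalEtaIntegral).subst F
  set ei := (d⁄dX A V.formalEtaIntegral).subst zi
  set qF := (V.formalEta * d⁄dX A V.formalEtaIntegral).subst F
  set qi := (V.formalEta * d⁄dX A V.formalEtaIntegral).subst zi
  set u := 1 - MvPowerSeries.C V.a₁ * z₃ - MvPowerSeries.C V.a₃ * (L * z₃ + N)
  set dF := δ F
  set dL := δ L
  set dN := δ N
  set dΦ := δ Φ
  -- (A) `ηᵢ δΨ = q(F) − q(zᵢ)` and the x-difference
  have hA : ηi * δ Ψ = qF - qi := by
    rw [hδΨ]; linear_combination eF * hηdF - hqF' + hqi'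
  have hX : (qF - qi) * F ^ 2 * zi ^ 2 * wi * wF =
      zi ^ 2 * wi * F ^ 3 - zi ^ 2 * wi * wF * ηF - F ^ 2 * wF * zi ^ 3 + F ^ 2 * wi * wF * ηi := by
    linear_combination (zi ^ 2 * wi * wF) * hqF - (F ^ 2 * wi * wF) * hqi + (zi ^ 2 * wi) * hTF -
      (F ^ 2 * wF) * hTi
  -- (B) `(Fνzᵢzⱼ)² ηᵢ δΦ` from the differentiated bridge
  have E2 : (F * N * (zi * zj)) ^ 2 * (ηi * dΦ) =
      F * N * (zi * zj) * ((-zj * (D * (zi - z₃))) * (zi * zj - F * (zi + zj)) +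
          N * (ηi * zj - ηF * (zi + zj) - ηi * F) -
          (D * (zi - z₃) * F * (zi * zj) + L * ηF * (zi * zj) + ηi * L * F * zj)) -
        (ηF * N * (zi * zj) - zj * (D * (zi - z₃)) * F * (zi * zj) + ηi * F * N * zj) *
          (N * (zi * zj - F * (zi + zj)) - L * F * (zi * zj)) := by
    linear_combination (ηi * F * N * (zi * zj)) * E1 -
      (ηi * dF * N * (zi * zj) + F * (ηi * dN) * (zi * zj) + ηi * F * N * zj) * hB +
      (F * N * (zi * zj) * (-N * (zi + zj) - L * (zi * zj)) - N * (zi * zj) *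
        (N * (zi * zj - F * (zi + zj)) - L * F * (zi * zj))) * hηdF +
      (F * N * (zi * zj) * (zi * zj - F * (zi + zj)) - F * (zi * zj) *
        (N * (zi * zj - F * (zi + zj)) - L * F * (zi * zj))) * hdV' +
      (F * N * (zi * zj) * (-F * (zi * zj))) * hdL
  -- (C) the two sides agree after clearing denominators
  have K : (F * N * (zi * zj)) ^ 2 * (wi * wF * u) * (ηi * (δ Ψ - dΦ)) = 0 := by
    linear_combination ((F * N * (zi * zj)) ^ 2 * (wi * wF * u)) * hA - (wi * wF * u) * E2 +
      (N ^ 2 * zj ^ 2 * u) * hX + (zi ^ 2 * zj ^ 2 * F ^ 2 * (N ^ 2 * wi)) * hFu +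
      (zi ^ 2 * zj ^ 2 * F ^ 2 * (D * (zi - z₃) * wi * (L * zj + N) - N ^ 2 * zi)) * hwFu +
      (zi ^ 2 * zj ^ 2 * F ^ 2 * (N ^ 2 * z₃ + (zi - z₃) * D * (L * zj + N) * (L * z₃ + N))) * hwi -
      (zi ^ 2 * zj ^ 2 * F ^ 2 * (zi - z₃)) * hV3
  -- cancel the non-zero factors
  have hne : (F * N * (zi * zj)) ^ 2 * (wi * wF * u) ≠ 0 :=
    mul_ne_zero (pow_ne_zero 2 (mul_ne_zero (mul_ne_zero hF0 hV0) (mul_ne_zero hzi0 hzj0)))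
      (mul_ne_zero (mul_ne_zero hwi0 hwF0) hu.ne_zero)
  have h1 : ηi * (δ Ψ - dΦ) = 0 := (mul_eq_zero.mp K).resolve_left hne
  rw [map_sub]
  exact (hηi.mul_right_eq_zero).mp h1

omit [IsDomain A] in
/-- The defect `∂L_η − Φ` has zero constant term (`L_η(0) = 0`; `Φ(0) = a₁ − a₁·1 + 0`). [cite: SilvermanAEC2009, III.5.1] -/
theorem constantCoeff_cobDefect :
    MvPowerSeries.constantCoeff (V.formalEtaIntegral.subst V.formalGroupLaw -
        V.formalEtaIntegral.subst (MvPowerSeries.X 0 : MvPowerSeries (Fin 2) A) -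
        V.formalEtaIntegral.subst (MvPowerSeries.X 1 : MvPowerSeries (Fin 2) A) -
      (MvPowerSeries.C V.a₁ - (MvPowerSeries.C V.a₁ + MvPowerSeries.C V.a₃ * V.formalSlope +
            MvPowerSeries.C V.a₄ * V.formalIntercept + 2 * MvPowerSeries.C V.a₆ * V.formalSlope * V.formalIntercept) *
          MvPowerSeries.invOfUnit (1 - MvPowerSeries.C V.a₃ * V.formalIntercept -
            MvPowerSeries.C V.a₆ * V.formalIntercept ^ 2) 1 +
          MvPowerSeries.C V.a₃ * (V.formalChordZ ^ 2 * V.formalWDivCube.subst V.formalChordZ))) = 0 := by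
  have h0 : ∀ {g : MvPowerSeries (Fin 2) A}, MvPowerSeries.constantCoeff g = 0 →
      MvPowerSeries.constantCoeff (V.formalEtaIntegral.subst g) = 0 := fun hg =>
    constantCoeff_powerSeries_subst_eq_zero hg V.constantCoeff_formalEtaIntegral
  simp [h0 V.constantCoeff_formalGroupLaw, h0 (MvPowerSeries.constantCoeff_X 0), h0 (MvPowerSeries.constantCoeff_X 1),
    V.constantCoeff_formalSlope, V.constantCoeff_formalIntercept, V.constantCoeff_formalChordZ,
    MvPowerSeries.constantCoeff_invOfUnit]

/-- **The formal `ζ`-addition law (closed form of the coboundary of the `η`-integral).** For every Weierstrass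
curve over a `ℚ`-algebra domain, with `L_η = formalEtaIntegral = ∫(xω − dz/z²)`, `F` the chord–tangent formal
group law, `λ = formalSlope`, `ν = formalIntercept`, `z₃ = formalChordZ`, `B = w/z³ = formalWDivCube`:
`L_η(F(z₁,z₂)) − L_η(z₁) − L_η(z₂) = a₁ − (a₁ + a₃λ + a₄ν + 2a₆λν)·(1 − a₃ν − a₆ν²)⁻¹ + a₃·z₃²·B(z₃)`
— the `z`-expansion of `ζ(u+v) − ζ(u) − ζ(v) = ½(℘′(u) − ℘′(v))/(℘(u) − ℘(v))` with the poles `1/z` removed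
(`= 1/F − 1/z₁ − 1/z₂ − λ/ν`). In particular the coboundary has coefficients in `ℤ[a₁, …, a₆]`: the class
`[η]` is PRIMITIVE, i.e. an element of Katz's `D(Ê/R)`. [cite: Katz1981CrystallineDieudonne, §5.1 (p. 193), Lemma 5.1.2]
[cite: SilvermanAEC2009, III.5.1] -/
theorem formalEtaIntegral_coboundary_eq :
    V.formalEtaIntegral.subst V.formalGroupLaw -
        V.formalEtaIntegral.subst (MvPowerSeries.X 0 : MvPowerSeries (Fin 2) A) -
        V.formalEtaIntegral.subst (MvPowerSeries.X 1 : MvPowerSeries (Fin 2) A) =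
      MvPowerSeries.C V.a₁ - (MvPowerSeries.C V.a₁ + MvPowerSeries.C V.a₃ * V.formalSlope +
            MvPowerSeries.C V.a₄ * V.formalIntercept + 2 * MvPowerSeries.C V.a₆ * V.formalSlope * V.formalIntercept) *
          MvPowerSeries.invOfUnit (1 - MvPowerSeries.C V.a₃ * V.formalIntercept -
            MvPowerSeries.C V.a₆ * V.formalIntercept ^ 2) 1 +
        MvPowerSeries.C V.a₃ * (V.formalChordZ ^ 2 * V.formalWDivCube.subst V.formalChordZ) := by
  haveI : IsAddTorsionFree A := IsAddTorsionFree.of_module_rat (M := A)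
  rw [← sub_eq_zero]
  set H := V.formalEtaIntegral.subst V.formalGroupLaw -
        V.formalEtaIntegral.subst (MvPowerSeries.X 0 : MvPowerSeries (Fin 2) A) -
        V.formalEtaIntegral.subst (MvPowerSeries.X 1 : MvPowerSeries (Fin 2) A) -
      (MvPowerSeries.C V.a₁ - (MvPowerSeries.C V.a₁ + MvPowerSeries.C V.a₃ * V.formalSlope +
            MvPowerSeries.C V.a₄ * V.formalIntercept + 2 * MvPowerSeries.C V.a₆ * V.formalSlope * V.formalIntercept) *
          MvPowerSeries.invOfUnit (1 - MvPowerSeries.C V.a₃ * V.formalIntercept -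
            MvPowerSeries.C V.a₆ * V.formalIntercept ^ 2) 1 +
          MvPowerSeries.C V.a₃ * (V.formalChordZ ^ 2 * V.formalWDivCube.subst V.formalChordZ)) with hH
  ext d
  rw [map_zero]
  by_cases h0 : d 0 = 0
  · by_cases h1 : d 1 = 0
    · have hd : d = 0 := by
        ext j; fin_cases j
        · simpa using h0
        · simpa using h1
      rw [hd, MvPowerSeries.coeff_zero_eq_constantCoeff_apply, hH]
      exact constantCoeff_cobDefect V
    · exact MvPowerSeries.coeff_eq_zero_of_pderiv_eq_zero (pderiv_cobDefect V 1) h1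
  · exact MvPowerSeries.coeff_eq_zero_of_pderiv_eq_zero (pderiv_cobDefect V 0) h0

end Main

end Literature.NumberTheory.EllipticCurves.DescendedFrobenius.FormalEtaCoboundary

end Part1

/-!
## Part 2 — port of `Summits/BirchSwinnertonDyer/BirchSwinnertonDyer/Theorems/CyclotomicUntwistFormalEtaCoboundaryIntegral.lean` (3 declarations kept)

# The class of `η = x·ω` is of the second kind — Part III: base change and integrality of the coboundary of `formalEtaIntegral`; `[η_W] ∈ D(Ê/𝓞_{ℚ₃(ζ₉)})` for every good model

Declarations of this Part (verbatim port; each keeps its own docstring and citation): `map_closedForm`, `coboundary_eq_map`, `coboundary_classEta`.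

Reference keys (see `references.bib` and the declarations' citations): [Katz1981CrystallineDieudonne], [SilvermanAEC2009].
-/

section Part2

open _root_.PowerSeries Literature.NumberTheory.EllipticCurves
open Literature.AlgebraicGeometry.Resolution (MvPowerSeries.pderiv MvPowerSeries.coeff_pderiv
  MvPowerSeries.pderiv_X MvPowerSeries.pderiv_C MvPowerSeries.pderiv_powerSeries_subst
  MvPowerSeries.pderiv_powerSeries_subst_X MvPowerSeries.coeff_eq_zero_of_pderiv_eq_zero)

namespace Literature.NumberTheory.EllipticCurves.DescendedFrobenius.FormalEtaCoboundary

section BaseChange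

variable {R S : Type*} [CommRing R] [CommRing S] (W : WeierstrassCurve R) (φ : R →+* S)

/-- The closed form commutes with base change (all its ingredients have coefficients in `ℤ[a₁,…,a₆]`).
[cite: SilvermanAEC2009, IV.1.1] -/
theorem map_closedForm :
    MvPowerSeries.map φ (MvPowerSeries.C W.a₁ - (MvPowerSeries.C W.a₁ + MvPowerSeries.C W.a₃ * W.formalSlope +
            MvPowerSeries.C W.a₄ * W.formalIntercept + 2 * MvPowerSeries.C W.a₆ * W.formalSlope * W.formalIntercept) *
          MvPowerSeries.invOfUnit (1 - MvPowerSeries.C W.a₃ * W.formalIntercept -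
            MvPowerSeries.C W.a₆ * W.formalIntercept ^ 2) 1 +
        MvPowerSeries.C W.a₃ * (W.formalChordZ ^ 2 * W.formalWDivCube.subst W.formalChordZ)) =
      MvPowerSeries.C (W.map φ).a₁ - (MvPowerSeries.C (W.map φ).a₁ + MvPowerSeries.C (W.map φ).a₃ * (W.map φ).formalSlope +
            MvPowerSeries.C (W.map φ).a₄ * (W.map φ).formalIntercept +
            2 * MvPowerSeries.C (W.map φ).a₆ * (W.map φ).formalSlope * (W.map φ).formalIntercept) *
          MvPowerSeries.invOfUnit (1 - MvPowerSeries.C (W.map φ).a₃ * (W.map φ).formalIntercept -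
            MvPowerSeries.C (W.map φ).a₆ * (W.map φ).formalIntercept ^ 2) 1 +
        MvPowerSeries.C (W.map φ).a₃ * ((W.map φ).formalChordZ ^ 2 * (W.map φ).formalWDivCube.subst (W.map φ).formalChordZ) := by
  have hM : MvPowerSeries.constantCoeff (1 - MvPowerSeries.C W.a₃ * W.formalIntercept -
      MvPowerSeries.C W.a₆ * W.formalIntercept ^ 2) = 1 := by simp [W.constantCoeff_formalIntercept]
  simp only [map_sub, map_add, map_mul, map_pow, map_one, MvPowerSeries.map_C, map_ofNat,
    mvPowerSeries_map_invOfUnit_one φ _ hM, W.map_formalSlope φ, W.map_formalIntercept φ, W.map_formalChordZ φ,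
    PowerSeries.map_subst W.hasSubst_formalChordZ, W.map_formalWDivCube φ]
  rfl

/-- **Integrality of the coboundary.** For a Weierstrass equation with coefficients in `R` and a ring map
`φ : R → A` to a `ℚ`-algebra domain, the coboundary of `L_η` of `W ⊗ A` is the base change of a series over
`R` (the closed form): every coefficient lies in `φ(R)`. [cite: Katz1981CrystallineDieudonne, §5.1 (p. 193)] -/
theorem coboundary_eq_map {A : Type*} [CommRing A] [IsDomain A] [Algebra ℚ A] (φ : R →+* A) :
    (W.map φ).formalEtaIntegral.subst (W.map φ).formalGroupLaw -
        (W.map φ).formalEtaIntegral.subst (MvPowerSeries.X 0 : MvPowerSeries (Fin 2) A) -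
        (W.map φ).formalEtaIntegral.subst (MvPowerSeries.X 1 : MvPowerSeries (Fin 2) A) =
      MvPowerSeries.map φ (MvPowerSeries.C W.a₁ - (MvPowerSeries.C W.a₁ + MvPowerSeries.C W.a₃ * W.formalSlope +
            MvPowerSeries.C W.a₄ * W.formalIntercept + 2 * MvPowerSeries.C W.a₆ * W.formalSlope * W.formalIntercept) *
          MvPowerSeries.invOfUnit (1 - MvPowerSeries.C W.a₃ * W.formalIntercept -
            MvPowerSeries.C W.a₆ * W.formalIntercept ^ 2) 1 +
        MvPowerSeries.C W.a₃ * (W.formalChordZ ^ 2 * W.formalWDivCube.subst W.formalChordZ)) := by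
  rw [map_closedForm, formalEtaIntegral_coboundary_eq]

end BaseChange

section NineGoodModel

open Literature.NumberTheory.EllipticCurves.DescendedFrobenius

/-- **The coboundary of `classEta` of a good model** `𝓜` of `W/ℚ` over `𝓞_{ℚ₃(ζ₉)}` (`classEta = u·L_η(𝓜) +
ru⁻¹·log(𝓜)`, `log` additive): `∂ classEta = u · (the closed form of 𝓜.E, an 𝓞-integral series)`. So `[η_W]` lies in
Katz's `D(Ê/𝓞) ⊗ ℚ` with an EXPLICIT integral coboundary after the scalar `u`.
[cite: Katz1981CrystallineDieudonne, §5.1 (p. 193)] -/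
theorem coboundary_classEta {W : WeierstrassCurve ℚ} (𝓜 : W.NineGoodModel) :
    𝓜.classEta.subst 𝓜.curve.formalGroupLaw - 𝓜.classEta.subst (MvPowerSeries.X 0 : MvPowerSeries (Fin 2) KNine) -
        𝓜.classEta.subst (MvPowerSeries.X 1 : MvPowerSeries (Fin 2) KNine) =
      MvPowerSeries.C (𝓜.C.u : KNine) * MvPowerSeries.map (algebraMap ONine KNine)
        (MvPowerSeries.C 𝓜.E.a₁ - (MvPowerSeries.C 𝓜.E.a₁ + MvPowerSeries.C 𝓜.E.a₃ * 𝓜.E.formalSlope +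
            MvPowerSeries.C 𝓜.E.a₄ * 𝓜.E.formalIntercept + 2 * MvPowerSeries.C 𝓜.E.a₆ * 𝓜.E.formalSlope * 𝓜.E.formalIntercept) *
          MvPowerSeries.invOfUnit (1 - MvPowerSeries.C 𝓜.E.a₃ * 𝓜.E.formalIntercept -
            MvPowerSeries.C 𝓜.E.a₆ * 𝓜.E.formalIntercept ^ 2) 1 +
        MvPowerSeries.C 𝓜.E.a₃ * (𝓜.E.formalChordZ ^ 2 * 𝓜.E.formalWDivCube.subst 𝓜.E.formalChordZ)) := by
  have hF := 𝓜.curve.hasSubst_formalGroupLaw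
  have hX0 : PowerSeries.HasSubst (MvPowerSeries.X 0 : MvPowerSeries (Fin 2) KNine) := PowerSeries.HasSubst.X 0
  have hX1 : PowerSeries.HasSubst (MvPowerSeries.X 1 : MvPowerSeries (Fin 2) KNine) := PowerSeries.HasSubst.X 1
  have hlog := 𝓜.curve.formalLog_subst_formalGroupLaw
  have hη := coboundary_eq_map 𝓜.E (algebraMap ONine KNine)
  have hsub : ∀ {g : MvPowerSeries (Fin 2) KNine} (hg : PowerSeries.HasSubst g),
      𝓜.classEta.subst g = MvPowerSeries.C (𝓜.C.u : KNine) * 𝓜.curve.formalEtaIntegral.subst g +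
        MvPowerSeries.C (𝓜.C.r * ((𝓜.C.u⁻¹ : KNineˣ) : KNine)) * 𝓜.curve.formalLog.subst g := by
    intro g hg
    rw [WeierstrassCurve.NineGoodModel.classEta, PowerSeries.subst_add hg, PowerSeries.smul_eq_C_mul,
      PowerSeries.smul_eq_C_mul, PowerSeries.subst_mul hg, PowerSeries.subst_mul hg, PowerSeries.subst_C,
      PowerSeries.subst_C]
  rw [hsub hF, hsub hX0, hsub hX1]
  unfold WeierstrassCurve.NineGoodModel.curve at hlog ⊢
  rw [← hη]
  linear_combination (MvPowerSeries.C (𝓜.C.r * ((𝓜.C.u⁻¹ : KNineˣ) : KNine))) * hlog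

end NineGoodModel

end Literature.NumberTheory.EllipticCurves.DescendedFrobenius.FormalEtaCoboundary

end Part2

/-!
## Part 3 — port of `Summits/BirchSwinnertonDyer/BirchSwinnertonDyer/Theorems/CyclotomicUntwistNineLogUnbounded.lean` (9 declarations kept)

# The logarithm of a good model over `𝓞_{ℚ₃(ζ₉)}` has unbounded denominators: `[ω_W] ≠ 0` in Katz's module, eigenvalues on the `ω`-line are unique, and no `ℚ₃`-rational eigenvalue exists (supersingular fibre)

Declarations of this Part (verbatim port; each keeps its own docstring and citation): `subst_ne_zero`, `formalMul_three_map_ne_zero`, `varpi_ne_zero`, `exists_eq_C_varpi_mul_of_functional_eq`, `varpi_not_isUnit`, `not_hbd_formalLog`, `eq_zero_of_hbd_C_mul_classOmega`, `eigenvalue_unique`, `not_hbd_expand_sub_algebraMap_mul_classOmega`.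

Reference keys (see `references.bib` and the declarations' citations): [Katz1981CrystallineDieudonne], [SilvermanAEC2009], [Honda1970].
-/

section Part3

open scoped _root_.Classical
open _root_.PowerSeries _root_.IsCyclotomicExtension Literature.NumberTheory.EllipticCurves.DescendedFrobenius
  Literature.NumberTheory.EllipticCurves.DescendedFrobenius.NineIntegers
  Literature.NumberTheory.EllipticCurves.DescendedFrobenius.NineHondaEstimate
  Literature.NumberTheory.EllipticCurves.DescendedFrobenius.DescendedFrobeniusTransfer
  Literature.NumberTheory.EllipticCurves.DescendedFrobenius.NineHonda

namespace Literature.NumberTheory.EllipticCurves.DescendedFrobenius.NineLogUnbounded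

/-! ### §1 Substitution of a non-zero series is injective-like over a domain -/

/-- Over a domain, substituting a non-zero `w` with `w(0) = 0` into a non-zero `f` gives a non-zero series
(`f = Xⁿ·f₁` with `f₁(0) ≠ 0`, so `f(w) = wⁿ·f₁(w)` with `f₁(w)(0) = f₁(0) ≠ 0`). [cite: Katz1981CrystallineDieudonne, Thm. 5.3.3] -/
theorem subst_ne_zero {R : Type*} [CommRing R] [IsDomain R] {f w : R⟦X⟧} (hf : f ≠ 0) (hw : w ≠ 0)
    (hw0 : constantCoeff w = 0) : f.subst w ≠ 0 := by
  have hws : HasSubst w := HasSubst.of_constantCoeff_zero' hw0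
  obtain ⟨f₁, hf₁⟩ := X_pow_order_dvd (φ := f)
  set n := f.order.toNat with hn
  have hf₁0 : constantCoeff f₁ ≠ 0 := by
    intro h0
    have hc : coeff n f = 0 := by
      rw [hf₁, coeff_X_pow_mul', if_pos le_rfl, Nat.sub_self, coeff_zero_eq_constantCoeff_apply, h0]
    have hne : coeff n f ≠ 0 := by
      rw [hn]
      exact coeff_order hf
    exact hne hc
  rw [hf₁, subst_mul hws, subst_pow hws, subst_X hws]
  refine mul_ne_zero (pow_ne_zero _ hw) fun h0 => hf₁0 ?_
  rw [← WeierstrassCurve.constantCoeff_subst_eq_constantCoeff (f := f₁) hw0, h0, map_zero]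

/-! ### §2 `[3]_Ē ≠ 0` for the special fibre of a model over `𝓞` -/

/-- **Finite height of the special fibre**: for `E/𝓞` with elliptic special fibre `Ē = E ⊗_ρ 𝔽₃`, the reduction of
`[3]_E` is non-zero in `𝔽₃⟦z⟧` (tree `formalMul_prime_map_toZMod_ne_zero` applied to a `ℤ₃`-lift of `Ē`).
[cite: SilvermanAEC2009, IV.7 and V.3] -/
theorem formalMul_three_map_ne_zero (E : WeierstrassCurve ONine) (ρ : ONine →+* ZMod 3) [(E.map ρ).IsElliptic] :
    (E.formalMul 3).map ρ ≠ 0 := by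
  set Ē := E.map ρ with hĒ
  obtain ⟨V, hV⟩ : ∃ V : WeierstrassCurve ℤ_[3], V.map PadicInt.toZMod = Ē :=
    ⟨⟨(Ē.a₁.val : ℤ_[3]), (Ē.a₂.val : ℤ_[3]), (Ē.a₃.val : ℤ_[3]), (Ē.a₄.val : ℤ_[3]), (Ē.a₆.val : ℤ_[3])⟩, by
      ext <;> simp [WeierstrassCurve.map]⟩
  haveI hEt : (V.map PadicInt.toZMod).IsElliptic := by rw [hV]; infer_instance
  haveI hE : (V.map PadicInt.Coe.ringHom).IsElliptic := by
    refine ⟨?_⟩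
    rw [WeierstrassCurve.map_Δ, isUnit_iff_ne_zero]
    intro h0
    have h0' : ((V.Δ : ℤ_[3]) : ℚ_[3]) = 0 := h0
    have hΔ0 : V.Δ = 0 := PadicInt.coe_eq_zero.mp h0'
    have hu : IsUnit (V.map PadicInt.toZMod).Δ := hEt.isUnit
    rw [WeierstrassCurve.map_Δ, hΔ0, map_zero] at hu
    exact not_isUnit_zero hu
  have h := V.formalMul_prime_map_toZMod_ne_zero (by norm_num : (3 : ℕ) ≠ 2)
  rw [hV] at h
  rwa [WeierstrassCurve.map_formalMul]

/-! ### §3 `log_𝓔` has unbounded denominators -/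

/-- `1 − ζ₉ ≠ 0` in `𝓞` (`ζ₉ ≠ 1`). [cite: Katz1981CrystallineDieudonne, Thm. 5.3.3] -/
theorem varpi_ne_zero : (⟨1 - zeta 9 ℚ_[3] KNine, one_sub_zeta_mem⟩ : ONine) ≠ 0 := by
  intro h0
  have h1 : (1 : KNine) - zeta 9 ℚ_[3] KNine = 0 := congrArg Subtype.val h0
  exact zeta_spec.ne_one (by norm_num) (sub_eq_zero.mp h1).symm

/-- One descent step: an `𝓞`-series `L` with `L([3]_E z) = 3·L(z)` is divisible by `1 − ζ₉` (reduce mod `ρ`: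
`L̄([3]_Ē) = 0` with `[3]_Ē ≠ 0`, so `L̄ = 0`). [cite: Katz1981CrystallineDieudonne, §5.3] -/
theorem exists_eq_C_varpi_mul_of_functional_eq (E : WeierstrassCurve ONine) (ρ : ONine →+* ZMod 3)
    [(E.map ρ).IsElliptic] {L : ONine⟦X⟧} (hL : L.subst (E.formalMul 3) = 3 * L) :
    ∃ L₁ : ONine⟦X⟧, L = PowerSeries.C (⟨1 - zeta 9 ℚ_[3] KNine, one_sub_zeta_mem⟩ : ONine) * L₁ ∧
      L₁.subst (E.formalMul 3) = 3 * L₁ := by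
  set ϖ : ONine := ⟨1 - zeta 9 ℚ_[3] KNine, one_sub_zeta_mem⟩ with hϖ
  -- reduce the functional equation mod `ρ`
  have hred : (L.map ρ).subst ((E.formalMul 3).map ρ) = 0 := by
    have h := congrArg (PowerSeries.map ρ) hL
    rw [WeierstrassCurve.powerSeries_map_subst ρ (E.hasSubst_formalMul 3), map_mul,
      show (PowerSeries.map ρ) (3 : ONine⟦X⟧) = 0 by
        rw [show (3 : ONine⟦X⟧) = PowerSeries.C (3 : ONine) from (map_ofNat _ 3).symm, map_C, map_ofNat,
          show (3 : ZMod 3) = 0 from rfl, map_zero], zero_mul] at h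
    exact h
  have hL0 : L.map ρ = 0 := by
    by_contra hne
    exact subst_ne_zero hne (formalMul_three_map_ne_zero E ρ)
      (by rw [← coeff_zero_eq_constantCoeff, coeff_map, coeff_zero_eq_constantCoeff, E.constantCoeff_formalMul,
        map_zero]) hred
  obtain ⟨L₁, hL₁⟩ := exists_eq_C_varpi_mul_of_map_eq_zero ρ hL0
  refine ⟨L₁, hL₁, ?_⟩
  have hϖ0 : (PowerSeries.C ϖ : ONine⟦X⟧) ≠ 0 := by
    intro h0
    have hϖz : ϖ = 0 := by
      have := congrArg constantCoeff h0
      rwa [constantCoeff_C, map_zero] at this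
    exact varpi_ne_zero hϖz
  have hs : HasSubst (E.formalMul 3) := E.hasSubst_formalMul 3
  have e : (PowerSeries.C ϖ * L₁).subst (E.formalMul 3) = PowerSeries.C ϖ * L₁.subst (E.formalMul 3) := by
    rw [← coe_substAlgHom hs, map_mul, C_eq_algebraMap, AlgHom.commutes]
  have h := hL
  rw [hL₁, e, mul_left_comm] at h
  exact mul_left_cancel₀ hϖ0 h

/-- `1 − ζ₉ ≠ 0` in `𝓞` and it is not a unit (it lies in the kernel of every reduction map). [cite: Katz1981CrystallineDieudonne, Thm. 5.3.3] -/
theorem varpi_not_isUnit : ¬ IsUnit (⟨1 - zeta 9 ℚ_[3] KNine, one_sub_zeta_mem⟩ : ONine) := by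
  obtain ⟨ρ⟩ := nonempty_residueMap
  intro hu
  have h := hu.map ρ
  rw [residueMap_one_sub_zeta ρ] at h
  exact not_isUnit_zero h

/-- **`log_𝓔` has unbounded denominators** for a model `E/𝓞` whose special fibre `E ⊗_ρ 𝔽₃` is elliptic: there is
no `d` with `3ᵈ·[zⁿ]log_𝓔 ∈ 𝓞` for all `n`. [cite: Katz1981CrystallineDieudonne, Thm. 5.3.3] [cite: SilvermanAEC2009, IV.7] -/
theorem not_hbd_formalLog (E : WeierstrassCurve ONine) (ρ : ONine →+* ZMod 3) [(E.map ρ).IsElliptic] :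
    ¬ HasBoundedDenominators (E.map (algebraMap ONine KNine)).formalLog := by
  set ι := algebraMap ONine KNine with hι
  set 𝓔 := E.map ι with h𝓔
  set ϖ : ONine := ⟨1 - zeta 9 ℚ_[3] KNine, one_sub_zeta_mem⟩ with hϖ
  rintro ⟨d, hd⟩
  -- lift `3ᵈ log` to `𝓞⟦X⟧`
  set L : ONine⟦X⟧ := PowerSeries.mk fun n => (⟨(3 : KNine) ^ d * coeff n 𝓔.formalLog, hd n⟩ : ONine) with hLdef
  have hL : L.map ι = PowerSeries.C ((3 : KNine) ^ d) * 𝓔.formalLog := by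
    ext n
    rw [coeff_map, hLdef, coeff_mk, coeff_C_mul]
    rfl
  -- the functional equation `L([3]) = 3 L` in `𝓞⟦X⟧`
  have hinj : Function.Injective (PowerSeries.map ι) := PowerSeries.map_injective ι Subtype.val_injective
  have hFE : L.subst (E.formalMul 3) = 3 * L := by
    apply hinj
    have hs : HasSubst (𝓔.formalMul 3) := 𝓔.hasSubst_formalMul 3
    have hmap3 : (PowerSeries.map ι) (3 : ONine⟦X⟧) = 3 := by
      rw [show (3 : ONine⟦X⟧) = PowerSeries.C (3 : ONine) from (map_ofNat _ 3).symm, map_C, map_ofNat, map_ofNat]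
    rw [WeierstrassCurve.powerSeries_map_subst ι (E.hasSubst_formalMul 3), WeierstrassCurve.map_formalMul, ← h𝓔,
      map_mul (PowerSeries.map ι) 3 L, hmap3, hL, ← coe_substAlgHom hs, map_mul, C_eq_algebraMap, AlgHom.commutes,
      coe_substAlgHom, 𝓔.formalLog_subst_formalMul_rat 3, nsmul_eq_mul]
    push_cast
    ring
  -- iterate: `ϖᵏ ∣ L` for every `k`
  have hiter : ∀ k : ℕ, ∃ Lk : ONine⟦X⟧, L = PowerSeries.C ϖ ^ k * Lk ∧ Lk.subst (E.formalMul 3) = 3 * Lk := by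
    intro k
    induction k with
    | zero => exact ⟨L, by rw [pow_zero, one_mul], hFE⟩
    | succ k ih =>
      obtain ⟨Lk, hLk, hFk⟩ := ih
      obtain ⟨L₁, hL₁, hF₁⟩ := exists_eq_C_varpi_mul_of_functional_eq E ρ hFk
      exact ⟨L₁, by rw [hLk, hL₁, pow_succ, mul_assoc], hF₁⟩
  -- read the coefficient of `z`: `ϖ^(6d+1) ∣ 3ᵈ` in `𝓞`
  obtain ⟨Lk, hLk, -⟩ := hiter (6 * d + 1)
  have hc1 : coeff 1 L = (3 : ONine) ^ d := by
    have h1 : coeff 1 L = (⟨(3 : KNine) ^ d * coeff 1 𝓔.formalLog, hd 1⟩ : ONine) := by rw [hLdef, coeff_mk]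
    rw [h1]
    apply Subtype.ext
    push_cast
    simp [WeierstrassCurve.coeff_one_formalLog]
  have hdvd : ϖ ^ (6 * d + 1) ∣ (3 : ONine) ^ d := by
    refine ⟨coeff 1 Lk, ?_⟩
    rw [← hc1, hLk, ← map_pow, coeff_C_mul]
  -- `3ᵈ = ϖ^(6d) · unit`
  have h3 : (3 : ONine) = ϖ ^ 6 * (-⟨_, thetaInv_mem⟩) := by
    apply Subtype.ext
    push_cast
    rw [three_eq_neg_pow_six_mul_thetaInv zeta_spec]
    ring
  have hunit : IsUnit (-(⟨_, thetaInv_mem⟩ : ONine)) := by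
    refine (IsUnit.neg ?_)
    refine IsUnit.of_mul_eq_one ⟨_, theta_mem⟩ (Subtype.ext ?_)
    push_cast
    rw [mul_comm]
    exact theta_mul_thetaInv zeta_spec
  rw [h3, mul_pow, ← pow_mul, pow_succ] at hdvd
  -- cancel `ϖ^(6d)`: `ϖ ∣ unit`
  have hϖ0 : ϖ ^ (6 * d) ≠ 0 := pow_ne_zero _ varpi_ne_zero
  obtain ⟨c, hc⟩ := hdvd
  have hc' : ϖ ^ (6 * d) * (-⟨_, thetaInv_mem⟩) ^ d = ϖ ^ (6 * d) * (ϖ * c) := by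
    rw [hc]; ring
  have hcancel := mul_left_cancel₀ hϖ0 hc'
  have hϖunit : IsUnit ϖ := isUnit_of_mul_isUnit_left (hcancel ▸ hunit.pow d)
  exact varpi_not_isUnit hϖunit

/-- **`[ω_W] ≠ 0` in Katz's module**: for a good model `𝓜` of `W` (elliptic special fibre), `x·classOmega 𝓜` has
bounded denominators only for `x = 0` (`classOmega = u⁻¹·log_𝓔`). [cite: Katz1981CrystallineDieudonne, Thm. 5.3.3] -/
theorem eq_zero_of_hbd_C_mul_classOmega {W : WeierstrassCurve ℚ} (𝓜 : W.NineGoodModel) (ρ : ONine →+* ZMod 3)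
    {x : KNine} (hx : HasBoundedDenominators (PowerSeries.C x * 𝓜.classOmega)) : x = 0 := by
  by_contra hx0
  haveI := isElliptic_specialFibre 𝓜 ρ
  apply not_hbd_formalLog 𝓜.E ρ
  have hu : ((𝓜.C.u⁻¹ : KNineˣ) : KNine) ≠ 0 := Units.ne_zero _
  have h := hbd_C_mul (x * ((𝓜.C.u⁻¹ : KNineˣ) : KNine))⁻¹ hx
  have e : PowerSeries.C (x * ((𝓜.C.u⁻¹ : KNineˣ) : KNine))⁻¹ * (PowerSeries.C x * 𝓜.classOmega) =
      𝓜.curve.formalLog := by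
    rw [WeierstrassCurve.NineGoodModel.classOmega, smul_eq_C_mul, ← mul_assoc, ← mul_assoc, ← map_mul, ← map_mul,
      show (x * ((𝓜.C.u⁻¹ : KNineˣ) : KNine))⁻¹ * x * ((𝓜.C.u⁻¹ : KNineˣ) : KNine) = 1 by
        rw [mul_assoc, inv_mul_cancel₀ (mul_ne_zero hx0 hu)], map_one, one_mul]
  rw [e] at h
  exact h

/-- **Eigenvalues on the `ω`-line are unique**: `φ[ω] ≡ λ[ω]` and `φ[ω] ≡ μ[ω]` modulo bounded denominators force
`λ = μ`. [cite: Katz1981CrystallineDieudonne, Thm. 5.3.3] -/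
theorem eigenvalue_unique {W : WeierstrassCurve ℚ} (𝓜 : W.NineGoodModel) (ρ : ONine →+* ZMod 3) {lam mu : KNine}
    (h1 : HasBoundedDenominators (expand 3 (by norm_num) 𝓜.classOmega - PowerSeries.C lam * 𝓜.classOmega))
    (h2 : HasBoundedDenominators (expand 3 (by norm_num) 𝓜.classOmega - PowerSeries.C mu * 𝓜.classOmega)) :
    lam = mu := by
  have h := h2.sub h1
  have e : expand 3 (by norm_num) 𝓜.classOmega - PowerSeries.C mu * 𝓜.classOmega -
      (expand 3 (by norm_num) 𝓜.classOmega - PowerSeries.C lam * 𝓜.classOmega) =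
      PowerSeries.C (lam - mu) * 𝓜.classOmega := by
    rw [map_sub]; ring
  rw [e] at h
  exact (sub_eq_zero.mp (eq_zero_of_hbd_C_mul_classOmega 𝓜 ρ h)).symm |>.symm

/-- **No `ℚ₃`-rational eigenvalue on the `ω`-line when the special fibre is supersingular**: if `3 ∣ a` then
`φ[ω] ≡ μ[ω]` with `μ ∈ ℚ₃` is impossible — Honda's `φ²[ω] ≡ aφ[ω] − 3[ω]` would give `μ² − aμ + 3 = 0` in `ℚ₃`
(`no_padic_root_of_three_dvd`). The eigenvalues live in `ℚ₃(√−3) ⊂ ℚ₃(ζ₉)`, NOT in `ℚ₃`: this is the input of the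
Galois descent of the `ω`-plane. [cite: Katz1981CrystallineDieudonne, (6.1.1)] [cite: Honda1970, Thm. 9] -/
theorem not_hbd_expand_sub_algebraMap_mul_classOmega {W : WeierstrassCurve ℚ} (𝓜 : W.NineGoodModel)
    (ρ : ONine →+* ZMod 3) (hss : (3 : ℤ) ∣ 𝓜.specialFibreTrace ρ) (μ : ℚ_[3]) :
    ¬ HasBoundedDenominators (expand 3 (by norm_num) 𝓜.classOmega -
      PowerSeries.C (algebraMap ℚ_[3] KNine μ) * 𝓜.classOmega) := by
  intro h
  set ι := algebraMap ℚ_[3] KNine with hι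
  set Ω := 𝓜.classOmega with hΩ
  set a : ℤ := 𝓜.specialFibreTrace ρ with ha
  -- Honda: `φ²Ω − a φΩ + 3Ω ∈ HBD`
  have R₂ := hbd_honda_classOmega 𝓜 ρ
  rw [← ha, ← hΩ, (expand_expand (a := 3) (b := 3) (c := 3 ^ 2) (by norm_num) (by norm_num)
    (Literature.RingTheory.FormalGroups.prime_sq_ne_zero 3) (by norm_num) Ω).symm] at R₂
  -- `φ(h)`, and combine: `(μ² − aμ + 3)Ω ∈ HBD`
  have hφ := hbd_expand 3 (by norm_num) h
  rw [map_sub, map_mul, expand_C] at hφ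
  have hsum := (R₂.sub hφ).sub (hbd_C_mul (ι μ - (a : KNine)) h)
  have e : expand 3 (by norm_num) (expand 3 (by norm_num) Ω) - PowerSeries.C (a : KNine) * expand 3 (by norm_num) Ω +
        3 * Ω - (expand 3 (by norm_num) (expand 3 (by norm_num) Ω) - PowerSeries.C (ι μ) * expand 3 (by norm_num) Ω) -
        PowerSeries.C (ι μ - (a : KNine)) * (expand 3 (by norm_num) Ω - PowerSeries.C (ι μ) * Ω) =
      PowerSeries.C (ι (3 - μ * ((a : ℚ_[3]) - μ))) * Ω := by
    simp only [map_sub, map_mul, map_ofNat, map_intCast]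
    ring
  rw [e] at hsum
  have h0 := eq_zero_of_hbd_C_mul_classOmega 𝓜 ρ hsum
  rw [map_eq_zero_iff ι ι.injective, sub_eq_zero] at h0
  exact WeierstrassCurve.IsDescendedFrobeniusMatrix.no_padic_root_of_three_dvd hss μ h0.symm

end Literature.NumberTheory.EllipticCurves.DescendedFrobenius.NineLogUnbounded

end Part3

/-!
## Part 4 — port of `Summits/BirchSwinnertonDyer/BirchSwinnertonDyer/Theorems/CyclotomicUntwistNineEtaIntegrality.lean` (7 declarations kept)

# A bounded-denominator relation `L_η + c·log ∈ 𝓞⟦z⟧ ⊗ ℚ` on a model over `𝓞 = 𝓞_{ℚ₃(ζ₉)}` with elliptic special fibre is exact: `L_η + c·log ∈ 𝓞⟦z⟧` (peeling along `[3]`)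

Declarations of this Part (verbatim port; each keeps its own docstring and citation): `exists_eq_C_varpi_mul_of_functional_eq_mod`, `exists_eq_C_varpi_pow_mul`, `formalEtaIntegral_subst_pair`, `formalEtaIntegral_subst_X`, `formalEtaIntegral_subst_formalMul_three`, `correction_eq_map`, `exists_map_eq_of_hbd`.

Reference keys (see `references.bib` and the declarations' citations): [Katz1981CrystallineDieudonne], [SilvermanAEC2009].
-/

section Part4

open scoped _root_.Classical
open _root_.PowerSeries _root_.IsCyclotomicExtension Literature.NumberTheory.EllipticCurves
  Literature.NumberTheory.EllipticCurves.DescendedFrobenius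
  Literature.NumberTheory.EllipticCurves.DescendedFrobenius.NineIntegers
  Literature.NumberTheory.EllipticCurves.DescendedFrobenius.NineHondaEstimate
  Literature.NumberTheory.EllipticCurves.DescendedFrobenius.NineLogUnbounded

namespace Literature.NumberTheory.EllipticCurves.DescendedFrobenius.NineEtaIntegrality

/-! ## §1 Peeling along `[3]` with an error term divisible by `ϖ` -/

/-- **One peeling step.** If `L([3]_E) = 3L + ϖ^{j+1}·M` in `𝓞⟦z⟧` (elliptic special fibre), then `L = ϖ·L₁` with
`L₁([3]_E) = 3L₁ + ϖ^j·M`: modulo `ρ` the equation reads `L̄([3]_Ē) = 0` with `[3]_Ē ≠ 0`, so `L̄ = 0`.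
[cite: Katz1981CrystallineDieudonne, Cor. 5.1.8] -/
theorem exists_eq_C_varpi_mul_of_functional_eq_mod (E : WeierstrassCurve ONine) (ρ : ONine →+* ZMod 3)
    [(E.map ρ).IsElliptic] {L M : ONine⟦X⟧} {j : ℕ}
    (hL : L.subst (E.formalMul 3) = 3 * L +
      PowerSeries.C ((⟨1 - zeta 9 ℚ_[3] KNine, one_sub_zeta_mem⟩ : ONine) ^ (j + 1)) * M) :
    ∃ L₁ : ONine⟦X⟧, L = PowerSeries.C (⟨1 - zeta 9 ℚ_[3] KNine, one_sub_zeta_mem⟩ : ONine) * L₁ ∧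
      L₁.subst (E.formalMul 3) = 3 * L₁ +
        PowerSeries.C ((⟨1 - zeta 9 ℚ_[3] KNine, one_sub_zeta_mem⟩ : ONine) ^ j) * M := by
  set ϖ : ONine := ⟨1 - zeta 9 ℚ_[3] KNine, one_sub_zeta_mem⟩ with hϖ
  have hρϖ : ρ ϖ = 0 := residueMap_one_sub_zeta ρ
  -- reduce the functional equation mod `ρ`
  have hred : (L.map ρ).subst ((E.formalMul 3).map ρ) = 0 := by
    have h := congrArg (PowerSeries.map ρ) hL
    rw [WeierstrassCurve.powerSeries_map_subst ρ (E.hasSubst_formalMul 3), map_add, map_mul, map_mul, map_C,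
      map_pow, hρϖ, zero_pow (Nat.succ_ne_zero j), map_zero, zero_mul, add_zero,
      show (PowerSeries.map ρ) (3 : ONine⟦X⟧) = 0 by
        rw [show (3 : ONine⟦X⟧) = PowerSeries.C (3 : ONine) from (map_ofNat _ 3).symm, map_C, map_ofNat,
          show (3 : ZMod 3) = 0 from rfl, map_zero], zero_mul] at h
    exact h
  have hL0 : L.map ρ = 0 := by
    by_contra hne
    exact subst_ne_zero hne (formalMul_three_map_ne_zero E ρ)
      (by rw [← coeff_zero_eq_constantCoeff, coeff_map, coeff_zero_eq_constantCoeff, E.constantCoeff_formalMul,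
        map_zero]) hred
  obtain ⟨L₁, hL₁⟩ := exists_eq_C_varpi_mul_of_map_eq_zero ρ hL0
  refine ⟨L₁, hL₁, ?_⟩
  have hϖ0 : (PowerSeries.C ϖ : ONine⟦X⟧) ≠ 0 := by
    intro h0
    have hϖz : ϖ = 0 := by
      have := congrArg constantCoeff h0
      rwa [constantCoeff_C, map_zero] at this
    exact varpi_ne_zero hϖz
  have hs : HasSubst (E.formalMul 3) := E.hasSubst_formalMul 3
  have e : (PowerSeries.C ϖ * L₁).subst (E.formalMul 3) = PowerSeries.C ϖ * L₁.subst (E.formalMul 3) := by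
    rw [← coe_substAlgHom hs, map_mul, C_eq_algebraMap, AlgHom.commutes]
  have h := hL
  rw [hL₁, e] at h
  refine mul_left_cancel₀ hϖ0 ?_
  rw [map_pow] at h ⊢
  linear_combination h

/-- **Peeling, iterated**: `L([3]_E) = 3L + ϖ^j·M` forces `ϖ^j ∣ L` in `𝓞⟦z⟧`. [cite: Katz1981CrystallineDieudonne, Cor. 5.1.8] -/
theorem exists_eq_C_varpi_pow_mul (E : WeierstrassCurve ONine) (ρ : ONine →+* ZMod 3) [(E.map ρ).IsElliptic]
    (j : ℕ) {L M : ONine⟦X⟧}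
    (hL : L.subst (E.formalMul 3) = 3 * L +
      PowerSeries.C ((⟨1 - zeta 9 ℚ_[3] KNine, one_sub_zeta_mem⟩ : ONine) ^ j) * M) :
    ∃ Lj : ONine⟦X⟧, L = PowerSeries.C ((⟨1 - zeta 9 ℚ_[3] KNine, one_sub_zeta_mem⟩ : ONine) ^ j) * Lj := by
  induction j generalizing L with
  | zero => exact ⟨L, by rw [pow_zero, map_one, one_mul]⟩
  | succ j ih =>
    obtain ⟨L₁, hL₁, hF₁⟩ := exists_eq_C_varpi_mul_of_functional_eq_mod E ρ hL
    obtain ⟨Lj, hLj⟩ := ih hF₁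
    exact ⟨Lj, by rw [hL₁, hLj, pow_succ', map_mul, mul_assoc]⟩

/-! ## §2 The functional equation of `L_η` along `[2] = F(z,z)` and `[3] = F([2]z, z)` -/

section RatAlgebra

variable {A : Type*} [CommRing A] [Algebra ℚ A] [IsDomain A] (V : WeierstrassCurve A)

omit [IsDomain A] in
/-- `L_η(F(g, h)) = ∂L_η(g, h) + L_η(g) + L_η(h)` for series `g, h` without constant term (definition of the
coboundary `∂L_η`, composed with the substitution `(z₁, z₂) ↦ (g, h)`). [cite: Katz1981CrystallineDieudonne, §5.1 (p. 193)] -/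
theorem formalEtaIntegral_subst_pair {σ : Type*} {g h : MvPowerSeries σ A}
    (hg : MvPowerSeries.constantCoeff g = 0) (hh : MvPowerSeries.constantCoeff h = 0) :
    V.formalEtaIntegral.subst (MvPowerSeries.subst ![g, h] V.formalGroupLaw) =
      MvPowerSeries.subst ![g, h] (V.formalEtaIntegral.subst V.formalGroupLaw -
          V.formalEtaIntegral.subst (MvPowerSeries.X 0 : MvPowerSeries (Fin 2) A) -
          V.formalEtaIntegral.subst (MvPowerSeries.X 1 : MvPowerSeries (Fin 2) A)) +
        V.formalEtaIntegral.subst g + V.formalEtaIntegral.subst h := by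
  have hs := WeierstrassCurve.hasSubst_pair hg hh
  rw [← mvSubst_powerSeries_subst V.hasSubst_formalGroupLaw hs, MvPowerSeries.subst_sub hs,
    MvPowerSeries.subst_sub hs, mvSubst_powerSeries_subst (PowerSeries.HasSubst.X 0) hs,
    mvSubst_powerSeries_subst (PowerSeries.HasSubst.X 1) hs, MvPowerSeries.subst_X hs, MvPowerSeries.subst_X hs]
  simp only [Matrix.cons_val_zero, Matrix.cons_val_one]
  ring

omit [IsDomain A] in
/-- `L_η ∘ z = L_η`. [cite: Katz1981CrystallineDieudonne, §5.1 (p. 193)] -/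
theorem formalEtaIntegral_subst_X : V.formalEtaIntegral.subst (PowerSeries.X : A⟦X⟧) = V.formalEtaIntegral := by
  rw [← PowerSeries.map_algebraMap_eq_subst_X, Algebra.algebraMap_self, PowerSeries.map_id, id]

omit [IsDomain A] in
/-- **`L_η([3]z) = 3·L_η(z) + ∂L_η([2]z, z) + ∂L_η(z, z)`** (`[2] = F(z,z)`, `[3] = F([2]z, z)`).
[cite: SilvermanAEC2009, IV.2.3] [cite: Katz1981CrystallineDieudonne, §5.1 (p. 193)] -/
theorem formalEtaIntegral_subst_formalMul_three :
    V.formalEtaIntegral.subst (V.formalMul 3) = 3 * V.formalEtaIntegral +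
      (MvPowerSeries.subst ![V.formalMul 2, (PowerSeries.X : A⟦X⟧)] (V.formalEtaIntegral.subst V.formalGroupLaw -
          V.formalEtaIntegral.subst (MvPowerSeries.X 0 : MvPowerSeries (Fin 2) A) -
          V.formalEtaIntegral.subst (MvPowerSeries.X 1 : MvPowerSeries (Fin 2) A)) +
        MvPowerSeries.subst ![(PowerSeries.X : A⟦X⟧), (PowerSeries.X : A⟦X⟧)]
          (V.formalEtaIntegral.subst V.formalGroupLaw -
            V.formalEtaIntegral.subst (MvPowerSeries.X 0 : MvPowerSeries (Fin 2) A) -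
            V.formalEtaIntegral.subst (MvPowerSeries.X 1 : MvPowerSeries (Fin 2) A))) := by
  have h2 : V.formalMul 2 = MvPowerSeries.subst ![(PowerSeries.X : A⟦X⟧), (PowerSeries.X : A⟦X⟧)] V.formalGroupLaw := by
    rw [show (2 : ℕ) = 1 + 1 from rfl, V.formalMul_succ, V.formalMul_one]
  rw [show (3 : ℕ) = 2 + 1 from rfl, V.formalMul_succ,
    formalEtaIntegral_subst_pair V (V.constantCoeff_formalMul 2) PowerSeries.constantCoeff_X, h2,
    formalEtaIntegral_subst_pair V PowerSeries.constantCoeff_X PowerSeries.constantCoeff_X, formalEtaIntegral_subst_X]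
  ring

end RatAlgebra

/-! ## §3 A bounded-denominator relation `L_η + c·log` is exact -/

/-- The correction term `∂L_η([2]z, z) + ∂L_η(z, z)` of `𝓔 = E ⊗ ℚ₃(ζ₉)` is the base change of an `𝓞`-series
(Part III: `∂L_η = map ι (closed form of E)`). [cite: Katz1981CrystallineDieudonne, §5.1 (p. 193)] -/
theorem correction_eq_map (E : WeierstrassCurve ONine) :
    MvPowerSeries.subst ![(E.map (algebraMap ONine KNine)).formalMul 2, (PowerSeries.X : KNine⟦X⟧)]
        ((E.map (algebraMap ONine KNine)).formalEtaIntegral.subst (E.map (algebraMap ONine KNine)).formalGroupLaw -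
          (E.map (algebraMap ONine KNine)).formalEtaIntegral.subst (MvPowerSeries.X 0 : MvPowerSeries (Fin 2) KNine) -
          (E.map (algebraMap ONine KNine)).formalEtaIntegral.subst (MvPowerSeries.X 1 : MvPowerSeries (Fin 2) KNine)) +
      MvPowerSeries.subst ![(PowerSeries.X : KNine⟦X⟧), (PowerSeries.X : KNine⟦X⟧)]
        ((E.map (algebraMap ONine KNine)).formalEtaIntegral.subst (E.map (algebraMap ONine KNine)).formalGroupLaw -
          (E.map (algebraMap ONine KNine)).formalEtaIntegral.subst (MvPowerSeries.X 0 : MvPowerSeries (Fin 2) KNine) -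
          (E.map (algebraMap ONine KNine)).formalEtaIntegral.subst (MvPowerSeries.X 1 : MvPowerSeries (Fin 2) KNine)) =
    PowerSeries.map (algebraMap ONine KNine)
      (MvPowerSeries.subst ![E.formalMul 2, (PowerSeries.X : ONine⟦X⟧)]
          (MvPowerSeries.C E.a₁ - (MvPowerSeries.C E.a₁ + MvPowerSeries.C E.a₃ * E.formalSlope +
              MvPowerSeries.C E.a₄ * E.formalIntercept + 2 * MvPowerSeries.C E.a₆ * E.formalSlope * E.formalIntercept) *
            MvPowerSeries.invOfUnit (1 - MvPowerSeries.C E.a₃ * E.formalIntercept -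
              MvPowerSeries.C E.a₆ * E.formalIntercept ^ 2) 1 +
            MvPowerSeries.C E.a₃ * (E.formalChordZ ^ 2 * E.formalWDivCube.subst E.formalChordZ)) +
        MvPowerSeries.subst ![(PowerSeries.X : ONine⟦X⟧), (PowerSeries.X : ONine⟦X⟧)]
          (MvPowerSeries.C E.a₁ - (MvPowerSeries.C E.a₁ + MvPowerSeries.C E.a₃ * E.formalSlope +
              MvPowerSeries.C E.a₄ * E.formalIntercept + 2 * MvPowerSeries.C E.a₆ * E.formalSlope * E.formalIntercept) *
            MvPowerSeries.invOfUnit (1 - MvPowerSeries.C E.a₃ * E.formalIntercept -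
              MvPowerSeries.C E.a₆ * E.formalIntercept ^ 2) 1 +
            MvPowerSeries.C E.a₃ * (E.formalChordZ ^ 2 * E.formalWDivCube.subst E.formalChordZ))) := by
  set ι := algebraMap ONine KNine with hι
  rw [FormalEtaCoboundary.coboundary_eq_map E ι]
  have h2 : MvPowerSeries.HasSubst ![E.formalMul 2, (PowerSeries.X : ONine⟦X⟧)] :=
    WeierstrassCurve.hasSubst_pair (E.constantCoeff_formalMul 2) PowerSeries.constantCoeff_X
  have hX : MvPowerSeries.HasSubst ![(PowerSeries.X : ONine⟦X⟧), (PowerSeries.X : ONine⟦X⟧)] :=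
    WeierstrassCurve.hasSubst_pair PowerSeries.constantCoeff_X PowerSeries.constantCoeff_X
  have e1 : (fun i => MvPowerSeries.map ι ((![E.formalMul 2, (PowerSeries.X : ONine⟦X⟧)] : Fin 2 → ONine⟦X⟧) i)) =
      ![(E.map ι).formalMul 2, (PowerSeries.X : KNine⟦X⟧)] := by
    funext i; fin_cases i
    · show PowerSeries.map ι (E.formalMul 2) = (E.map ι).formalMul 2
      exact WeierstrassCurve.map_formalMul E ι 2
    · show PowerSeries.map ι PowerSeries.X = PowerSeries.X
      exact PowerSeries.map_X ι
  have e2 : (fun i => MvPowerSeries.map ι ((![(PowerSeries.X : ONine⟦X⟧), (PowerSeries.X : ONine⟦X⟧)] :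
      Fin 2 → ONine⟦X⟧) i)) = ![(PowerSeries.X : KNine⟦X⟧), (PowerSeries.X : KNine⟦X⟧)] := by
    funext i; fin_cases i
    · show PowerSeries.map ι PowerSeries.X = PowerSeries.X
      exact PowerSeries.map_X ι
    · show PowerSeries.map ι PowerSeries.X = PowerSeries.X
      exact PowerSeries.map_X ι
  symm
  change MvPowerSeries.map ι (_ + _) = _
  rw [map_add, MvPowerSeries.map_subst h2, MvPowerSeries.map_subst hX, e1, e2]

/-- **A bounded-denominator relation between `L_η` and `log` is exact.** For a Weierstrass equation `E` over
`𝓞 = 𝓞_{ℚ₃(ζ₉)}` with elliptic special fibre and `𝓔 = E ⊗ ℚ₃(ζ₉)`: if `L_η + c·log_𝓔` has bounded denominators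
(`c ∈ ℚ₃(ζ₉)`), then `L_η + c·log_𝓔 = G ⊗ 1` for an `𝓞`-series `G` — no denominators at all. Proof: `B = 3ᵈ(L_η +
c log) ∈ 𝓞⟦z⟧` satisfies `B([3]) = 3B + 3ᵈ·I` with `I = ∂L_η([2]z,z) + ∂L_η(z,z)` integral and `log([3]) = 3 log`;
`3ᵈ = ϖ^{6d}·unit`, so `6d` peeling steps give `ϖ^{6d} ∣ B`. [cite: Katz1981CrystallineDieudonne, Cor. 5.1.8 and Thm. 5.3.3] -/
theorem exists_map_eq_of_hbd (E : WeierstrassCurve ONine) (ρ : ONine →+* ZMod 3) [(E.map ρ).IsElliptic] (c : KNine)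
    (h : HasBoundedDenominators ((E.map (algebraMap ONine KNine)).formalEtaIntegral +
      PowerSeries.C c * (E.map (algebraMap ONine KNine)).formalLog)) :
    ∃ G : ONine⟦X⟧, (E.map (algebraMap ONine KNine)).formalEtaIntegral +
      PowerSeries.C c * (E.map (algebraMap ONine KNine)).formalLog = G.map (algebraMap ONine KNine) := by
  set ι := algebraMap ONine KNine with hι
  set 𝓔 := E.map ι with h𝓔
  set ϖ : ONine := ⟨1 - zeta 9 ℚ_[3] KNine, one_sub_zeta_mem⟩ with hϖ
  set Gη := 𝓔.formalEtaIntegral + PowerSeries.C c * 𝓔.formalLog with hGη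
  obtain ⟨d, hd⟩ := h
  -- lift `3ᵈ (L_η + c log)` to `𝓞⟦X⟧`
  set L : ONine⟦X⟧ := PowerSeries.mk fun n => (⟨(3 : KNine) ^ d * coeff n Gη, hd n⟩ : ONine) with hLdef
  have hL : L.map ι = PowerSeries.C ((3 : KNine) ^ d) * Gη := by
    ext n
    rw [coeff_map, hLdef, coeff_mk, coeff_C_mul]
    rfl
  -- the correction term and its lift
  obtain ⟨I, hI⟩ : ∃ I : ONine⟦X⟧, MvPowerSeries.subst ![𝓔.formalMul 2, (PowerSeries.X : KNine⟦X⟧)]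
        (𝓔.formalEtaIntegral.subst 𝓔.formalGroupLaw -
          𝓔.formalEtaIntegral.subst (MvPowerSeries.X 0 : MvPowerSeries (Fin 2) KNine) -
          𝓔.formalEtaIntegral.subst (MvPowerSeries.X 1 : MvPowerSeries (Fin 2) KNine)) +
      MvPowerSeries.subst ![(PowerSeries.X : KNine⟦X⟧), (PowerSeries.X : KNine⟦X⟧)]
        (𝓔.formalEtaIntegral.subst 𝓔.formalGroupLaw -
          𝓔.formalEtaIntegral.subst (MvPowerSeries.X 0 : MvPowerSeries (Fin 2) KNine) -
          𝓔.formalEtaIntegral.subst (MvPowerSeries.X 1 : MvPowerSeries (Fin 2) KNine)) = I.map ι :=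
    ⟨_, correction_eq_map E⟩
  -- the functional equation over `ℚ₃(ζ₉)`: `Gη([3]) = 3 Gη + I`
  have hs𝓔 : HasSubst (𝓔.formalMul 3) := 𝓔.hasSubst_formalMul 3
  have hFEK : Gη.subst (𝓔.formalMul 3) = 3 * Gη + I.map ι := by
    rw [hGη, ← coe_substAlgHom hs𝓔, map_add, map_mul, C_eq_algebraMap, AlgHom.commutes, coe_substAlgHom,
      formalEtaIntegral_subst_formalMul_three 𝓔, 𝓔.formalLog_subst_formalMul_rat 3, hI, nsmul_eq_mul,
      ← C_eq_algebraMap]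
    push_cast
    ring
  -- the functional equation in `𝓞⟦X⟧`: `L([3]) = 3L + 3ᵈ·I`
  have hinj : Function.Injective (PowerSeries.map ι) := PowerSeries.map_injective ι Subtype.val_injective
  have hmap3 : (PowerSeries.map ι) (3 : ONine⟦X⟧) = 3 := by
    rw [show (3 : ONine⟦X⟧) = PowerSeries.C (3 : ONine) from (map_ofNat _ 3).symm, map_C, map_ofNat, map_ofNat]
  have hFE : L.subst (E.formalMul 3) = 3 * L + PowerSeries.C ((3 : ONine) ^ d) * I := by
    apply hinj
    rw [WeierstrassCurve.powerSeries_map_subst ι (E.hasSubst_formalMul 3), WeierstrassCurve.map_formalMul, ← h𝓔,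
      map_add, map_mul (PowerSeries.map ι) 3 L, hmap3, map_mul, map_C, map_pow, hL, ← coe_substAlgHom hs𝓔, map_mul,
      C_eq_algebraMap, AlgHom.commutes, coe_substAlgHom, hFEK, ← C_eq_algebraMap]
    have : ι 3 = 3 := map_ofNat ι 3
    rw [this]
    ring
  -- `3 = ϖ⁶ · ε` with `ε` a unit of `𝓞`
  set ε : ONine := -⟨_, thetaInv_mem⟩ with hε
  set ε' : ONine := -⟨_, theta_mem⟩ with hε'
  have h3 : (3 : ONine) = ϖ ^ 6 * ε := by
    apply Subtype.ext
    rw [hϖ, hε]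
    push_cast
    rw [three_eq_neg_pow_six_mul_thetaInv zeta_spec]
    ring
  have hεε' : ε * ε' = 1 := by
    rw [hε, hε', neg_mul_neg]
    apply Subtype.ext
    push_cast
    rw [mul_comm]
    exact theta_mul_thetaInv zeta_spec
  -- rewrite `3ᵈ = ϖ^(6d) ε^d` and peel
  have hFE' : L.subst (E.formalMul 3) = 3 * L + PowerSeries.C (ϖ ^ (6 * d)) * (PowerSeries.C (ε ^ d) * I) := by
    rw [hFE, h3, mul_pow, ← pow_mul, map_mul, mul_assoc]
  obtain ⟨L', hL'⟩ := exists_eq_C_varpi_pow_mul E ρ (6 * d) hFE'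
  -- back over `ℚ₃(ζ₉)`: `3ᵈ Gη = ϖ^(6d) L'`, and `3ᵈ = ϖ^(6d) ε^d`
  refine ⟨PowerSeries.C (ε' ^ d) * L', ?_⟩
  have hϖK : (ι (ϖ ^ (6 * d))) ≠ 0 := by
    rw [map_pow]
    refine pow_ne_zero _ fun h0 => varpi_ne_zero (Subtype.ext ?_)
    rw [ZeroMemClass.coe_zero]
    exact h0
  have e3 : (3 : KNine) ^ d = ι (ϖ ^ (6 * d)) * ι (ε ^ d) := by
    calc (3 : KNine) ^ d = (ι 3) ^ d := by rw [map_ofNat]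
      _ = ι (3 ^ d) := (map_pow ι 3 d).symm
      _ = ι (ϖ ^ (6 * d) * ε ^ d) := by rw [h3, mul_pow, ← pow_mul]
      _ = ι (ϖ ^ (6 * d)) * ι (ε ^ d) := map_mul ι _ _
  have key : PowerSeries.C (ι (ϖ ^ (6 * d))) * (PowerSeries.C (ι (ε ^ d)) * Gη) =
      PowerSeries.C (ι (ϖ ^ (6 * d))) * L'.map ι := by
    rw [← mul_assoc, ← map_mul, ← e3, ← hL, hL', map_mul, map_C]
  have hC0 : (PowerSeries.C (ι (ϖ ^ (6 * d))) : KNine⟦X⟧) ≠ 0 := by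
    intro h0
    apply hϖK
    have := congrArg constantCoeff h0
    rwa [constantCoeff_C, map_zero] at this
  have h4 := mul_left_cancel₀ hC0 key
  calc Gη = PowerSeries.C (ι (ε' ^ d)) * (PowerSeries.C (ι (ε ^ d)) * Gη) := by
        rw [← mul_assoc, ← map_mul, ← map_mul, ← mul_pow, mul_comm ε' ε, hεε', one_pow, map_one, map_one, one_mul]
    _ = PowerSeries.C (ι (ε' ^ d)) * L'.map ι := by rw [h4]
    _ = (PowerSeries.C (ε' ^ d) * L').map ι := by rw [map_mul, map_C]

end Literature.NumberTheory.EllipticCurves.DescendedFrobenius.NineEtaIntegrality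

end Part4

/-!
## Part 5 — port of `Summits/BirchSwinnertonDyer/BirchSwinnertonDyer/Theorems/ClassRecordThreeRegCertKernelO3FormalLog.lean` (5 declarations kept)

# Coefficients of the formal group of a Weierstrass curve, II: `w(z)` to order `6`, `ω(z)` to order `3`, and the quartic term of the formal logarithm

Declarations of this Part (verbatim port; each keeps its own docstring and citation): `coeff_six_iterate_formalWStep`, `coeff_six_formalW`, `coeff_three_formalWDivCube`, `coeff_formalOmegaDenom₃`, `coeff_three_formalOmega`.

Reference keys (see `references.bib` and the declarations' citations): [SilvermanAEC2009].
-/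

section Part5

open scoped _root_.Classical

open _root_.PowerSeries Literature.NumberTheory.EllipticCurves
  Literature.NumberTheory.EllipticCurves.DescendedFrobenius.FormalGroupCoefficients

namespace Literature.NumberTheory.EllipticCurves.DescendedFrobenius.FormalGroupCoefficients

section Ring

variable {R : Type*} [CommRing R] (W : WeierstrassCurve R)

/-- The iterates `fᵐ(0)` have `coeff 6 = a₁³ + 2a₁a₂ + a₃` for `m ≥ 3`. [Silverman AEC IV.1.1(a)] [cite: SilvermanAEC2009, IV.1.1] -/
theorem coeff_six_iterate_formalWStep (m : ℕ) (hm : 3 ≤ m) :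
    coeff 6 ((W.formalWStep)^[m + 1] 0) = W.a₁ ^ 3 + 2 * W.a₁ * W.a₂ + W.a₃ := by
  obtain ⟨k, rfl⟩ : ∃ k, m = k + 1 := ⟨m - 1, by omega⟩
  obtain ⟨h3, h4, h5⟩ := coeff_iterate_formalWStep W k
  obtain ⟨u, hu⟩ := W.X_pow_three_dvd_iterate_formalWStep (k + 1)
  have hu0 : coeff 0 u = 1 := by
    have := h3; rw [hu, coeff_X_pow_mul'] at this; simpa using this
  have hu1 : coeff 1 u = W.a₁ := by
    have := h4 (by omega); rw [hu, coeff_X_pow_mul'] at this; simpa using this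
  have hu2 : coeff 2 u = W.a₁ ^ 2 + W.a₂ := by
    have := h5 (by omega); rw [hu, coeff_X_pow_mul'] at this; simpa using this
  have hstep : (W.formalWStep)^[k + 1 + 1] 0 = W.formalWStep (X ^ 3 * u) := by
    rw [Function.iterate_succ_apply', hu]
  rw [hstep, W.formalWStep_X_pow_mul, map_add, coeff_X_pow_mul', coeff_X_pow]
  simp only [show ¬ (6 : ℕ) = 3 by norm_num, if_false, show (4 : ℕ) ≤ 6 by norm_num, if_true, zero_add,
    show (6 : ℕ) - 4 = 2 by norm_num, map_add, mul_assoc, coeff_C_mul, coeff_succ_X_mul, coeff_X_pow_mul']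
  simp [hu0, hu1, hu2, pow_two, coeff_mul]
  ring

/-- `coeff 6 w(z) = a₁³ + 2a₁a₂ + a₃`. [Silverman AEC IV.1.1(a)] [cite: SilvermanAEC2009, IV.1.1] -/
theorem coeff_six_formalW : coeff 6 W.formalW = W.a₁ ^ 3 + 2 * W.a₁ * W.a₂ + W.a₃ := by
  rw [WeierstrassCurve.formalW, coeff_mk]
  exact coeff_six_iterate_formalWStep W 5 (by norm_num)

/-- `coeff 3 B = a₁³ + 2a₁a₂ + a₃` for `B = w/z³`. [Silverman AEC IV.1.1(a)] [cite: SilvermanAEC2009, IV.1.1] -/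
theorem coeff_three_formalWDivCube : coeff 3 W.formalWDivCube = W.a₁ ^ 3 + 2 * W.a₁ * W.a₂ + W.a₃ := by
  rw [WeierstrassCurve.formalWDivCube, coeff_mk]; exact coeff_six_formalW W

end Ring

section RatAlgebra

variable {A : Type*} [CommRing A] [Algebra ℚ A] (W : WeierstrassCurve A)

omit [Algebra ℚ A] in
/-- Coefficients `0 … 3` of the denominator `D = B·(2 − a₁z − a₃z³B)` of `ω`: `2, a₁, a₁² + 2a₂, a₁³ + 3a₁a₂ + a₃`. [folklore] -/
private theorem coeff_formalOmegaDenom₃ :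
    coeff 0 (W.formalWDivCube * (2 - C W.a₁ * X - C W.a₃ * X ^ 3 * W.formalWDivCube)) = 2 ∧
    coeff 1 (W.formalWDivCube * (2 - C W.a₁ * X - C W.a₃ * X ^ 3 * W.formalWDivCube)) = W.a₁ ∧
    coeff 2 (W.formalWDivCube * (2 - C W.a₁ * X - C W.a₃ * X ^ 3 * W.formalWDivCube)) = W.a₁ ^ 2 + 2 * W.a₂ ∧
    coeff 3 (W.formalWDivCube * (2 - C W.a₁ * X - C W.a₃ * X ^ 3 * W.formalWDivCube)) =
      W.a₁ ^ 3 + 3 * W.a₁ * W.a₂ + W.a₃ := by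
  have hD : W.formalWDivCube * (2 - C W.a₁ * X - C W.a₃ * X ^ 3 * W.formalWDivCube) =
      C (2 : A) * W.formalWDivCube - C W.a₁ * (X * W.formalWDivCube) -
        C W.a₃ * (X ^ 3 * (W.formalWDivCube * W.formalWDivCube)) := by
    rw [map_ofNat]; ring
  have h0 : coeff 0 W.formalWDivCube = 1 := by
    rw [coeff_zero_eq_constantCoeff]; exact W.constantCoeff_formalWDivCube
  have hsq : coeff 0 (W.formalWDivCube * W.formalWDivCube) = 1 := by
    rw [PowerSeries.coeff_mul]; simp [h0]
  rw [hD]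
  refine ⟨?_, ?_, ?_, ?_⟩
  · simp only [map_sub, coeff_C_mul, coeff_zero_X_mul, coeff_X_pow_mul', h0]; simp
  · simp only [map_sub, coeff_C_mul, coeff_succ_X_mul, coeff_X_pow_mul', h0, (coeff_one_formalWDivCube W)]
    simp; ring
  · simp only [map_sub, coeff_C_mul, coeff_succ_X_mul, coeff_X_pow_mul', (coeff_one_formalWDivCube W),
      (coeff_two_formalWDivCube W)]
    simp; ring
  · simp only [map_sub, coeff_C_mul, coeff_succ_X_mul, coeff_X_pow_mul', (coeff_two_formalWDivCube W),
      (coeff_three_formalWDivCube W), hsq]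
    simp; ring

/-- **`coeff 3 ω = a₁³ + 2a₁a₂ + 2a₃`** (degree-3 coefficients in `ω·D = 2B + zB′`). [Silverman AEC IV.1]
[cite: SilvermanAEC2009, IV.1.1] -/
theorem coeff_three_formalOmega : coeff 3 W.formalOmega = W.a₁ ^ 3 + 2 * W.a₁ * W.a₂ + 2 * W.a₃ := by
  have h := congrArg (coeff 3) W.formalOmega_mul_denom
  obtain ⟨d0, d1, d2, d3⟩ := coeff_formalOmegaDenom₃ W
  have hω0 : coeff 0 W.formalOmega = 1 := by
    rw [coeff_zero_eq_constantCoeff]; exact W.constantCoeff_formalOmega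
  have hω1 := coeff_one_formalOmega W
  have hω2 := coeff_two_formalOmega W
  rw [PowerSeries.coeff_mul, Finset.Nat.sum_antidiagonal_succ, Finset.Nat.sum_antidiagonal_succ,
    Finset.Nat.sum_antidiagonal_succ] at h
  simp only [Finset.Nat.antidiagonal_zero, Finset.sum_singleton, zero_add] at h
  rw [hω0, hω1, hω2, d3, d2, d1, d0, map_add,
    show (2 : A⟦X⟧) * W.formalWDivCube = C (2 : A) * W.formalWDivCube by rw [map_ofNat], coeff_C_mul,
    (coeff_three_formalWDivCube W), coeff_succ_X_mul, coeff_derivative, (coeff_three_formalWDivCube W)] at h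
  have h2 : IsUnit (2 : A) := ⟨WeierstrassCurve.unitTwo, rfl⟩
  refine h2.mul_left_cancel ?_
  have : (2 : A) * coeff 3 W.formalOmega = coeff 3 W.formalOmega * 2 := mul_comm _ _
  rw [this]
  push_cast at h
  linear_combination h

end RatAlgebra

end Literature.NumberTheory.EllipticCurves.DescendedFrobenius.FormalGroupCoefficients

end Part5

/-!
## Part 6 — port of `Summits/BirchSwinnertonDyer/BirchSwinnertonDyer/Theorems/KolyvaginRoadThreeSchneiderTamAtThreeHeightLogNumeratorExactPFormalLog.lean` (5 declarations kept)

# Coefficients of the formal group of a Weierstrass curve, III: `w(z)` to order `7`, `ω(z)` to order `4`, and the quintic term of the formal logarithm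

Declarations of this Part (verbatim port; each keeps its own docstring and citation): `coeff_seven_iterate_formalWStep`, `coeff_seven_formalW`, `coeff_four_formalWDivCube`, `coeff_formalOmegaDenom₄`, `coeff_four_formalOmega`.

Reference keys (see `references.bib` and the declarations' citations): [SilvermanAEC2009].
-/

section Part6

open scoped _root_.Classical _root_.Nat
open _root_.Filter _root_.Topology IsUltrametricDist _root_.PowerSeries
open _root_.WeierstrassCurve Literature.NumberTheory.EllipticCurves
open Literature.NumberTheory.EllipticCurves.DescendedFrobenius.FormalGroupCoefficients
open Literature.NumberTheory.EllipticCurves.DescendedFrobenius.FormalGroupCoefficients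

namespace Literature.NumberTheory.EllipticCurves.DescendedFrobenius.FormalGroupCoefficients

section Ring

variable {R : Type*} [CommRing R] (W : WeierstrassCurve R)

/-- The iterates `fᵐ(0)` have `coeff 7 = a₁⁴ + 3a₁²a₂ + a₂² + 3a₁a₃ + a₄` for `m ≥ 4`. [Silverman AEC IV.1.1(a)]
[cite: SilvermanAEC2009, IV.1.1] -/
theorem coeff_seven_iterate_formalWStep (m : ℕ) (hm : 4 ≤ m) :
    coeff 7 ((W.formalWStep)^[m + 1] 0) =
      W.a₁ ^ 4 + 3 * W.a₁ ^ 2 * W.a₂ + W.a₂ ^ 2 + 3 * W.a₁ * W.a₃ + W.a₄ := by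
  obtain ⟨k, rfl⟩ : ∃ k, m = k + 1 := ⟨m - 1, by omega⟩
  obtain ⟨h3, h4, h5⟩ := coeff_iterate_formalWStep W k
  have h6 := coeff_six_iterate_formalWStep W k (by omega)
  obtain ⟨u, hu⟩ := W.X_pow_three_dvd_iterate_formalWStep (k + 1)
  have hu0 : coeff 0 u = 1 := by
    have := h3; rw [hu, coeff_X_pow_mul'] at this; simpa using this
  have hu1 : coeff 1 u = W.a₁ := by
    have := h4 (by omega); rw [hu, coeff_X_pow_mul'] at this; simpa using this
  have hu2 : coeff 2 u = W.a₁ ^ 2 + W.a₂ := by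
    have := h5 (by omega); rw [hu, coeff_X_pow_mul'] at this; simpa using this
  have hu3 : coeff 3 u = W.a₁ ^ 3 + 2 * W.a₁ * W.a₂ + W.a₃ := by
    have := h6; rw [hu, coeff_X_pow_mul'] at this; simpa using this
  have hstep : (W.formalWStep)^[k + 1 + 1] 0 = W.formalWStep (X ^ 3 * u) := by
    rw [Function.iterate_succ_apply', hu]
  rw [hstep, W.formalWStep_X_pow_mul, map_add, coeff_X_pow_mul', coeff_X_pow]
  simp only [show ¬ (7 : ℕ) = 3 by norm_num, if_false, show (4 : ℕ) ≤ 7 by norm_num, if_true, zero_add,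
    show (7 : ℕ) - 4 = 3 by norm_num, map_add, mul_assoc, coeff_C_mul, coeff_succ_X_mul, coeff_X_pow_mul']
  have hsq0 : coeff 0 (u ^ 2) = 1 := by rw [pow_two, PowerSeries.coeff_mul]; simp [hu0]
  have hsq1 : coeff 1 (u ^ 2) = 2 * W.a₁ := by
    rw [pow_two, PowerSeries.coeff_mul, Finset.Nat.sum_antidiagonal_succ]
    simp [hu0, hu1]; ring
  simp [hu2, hu3, hsq0, hsq1]
  ring

/-- `coeff 7 w(z) = a₁⁴ + 3a₁²a₂ + a₂² + 3a₁a₃ + a₄`. [Silverman AEC IV.1.1(a)] [cite: SilvermanAEC2009, IV.1.1] -/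
theorem coeff_seven_formalW :
    coeff 7 W.formalW = W.a₁ ^ 4 + 3 * W.a₁ ^ 2 * W.a₂ + W.a₂ ^ 2 + 3 * W.a₁ * W.a₃ + W.a₄ := by
  rw [WeierstrassCurve.formalW, coeff_mk]
  exact coeff_seven_iterate_formalWStep W 6 (by norm_num)

/-- `coeff 4 B = a₁⁴ + 3a₁²a₂ + a₂² + 3a₁a₃ + a₄` for `B = w/z³`. [Silverman AEC IV.1.1(a)]
[cite: SilvermanAEC2009, IV.1.1] -/
theorem coeff_four_formalWDivCube :
    coeff 4 W.formalWDivCube = W.a₁ ^ 4 + 3 * W.a₁ ^ 2 * W.a₂ + W.a₂ ^ 2 + 3 * W.a₁ * W.a₃ + W.a₄ := by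
  rw [WeierstrassCurve.formalWDivCube, coeff_mk]; exact coeff_seven_formalW W

end Ring

section RatAlgebra

variable {A : Type*} [CommRing A] [Algebra ℚ A] (W : WeierstrassCurve A)

omit [Algebra ℚ A] in
/-- Coefficients `0 … 4` of the denominator `D = B·(2 − a₁z − a₃z³B)` of `ω`:
`2, a₁, a₁² + 2a₂, a₁³ + 3a₁a₂ + a₃, a₁⁴ + 4a₁²a₂ + 2a₂² + 3a₁a₃ + 2a₄`. [folklore] -/
private theorem coeff_formalOmegaDenom₄ :
    coeff 0 (W.formalWDivCube * (2 - C W.a₁ * X - C W.a₃ * X ^ 3 * W.formalWDivCube)) = 2 ∧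
    coeff 1 (W.formalWDivCube * (2 - C W.a₁ * X - C W.a₃ * X ^ 3 * W.formalWDivCube)) = W.a₁ ∧
    coeff 2 (W.formalWDivCube * (2 - C W.a₁ * X - C W.a₃ * X ^ 3 * W.formalWDivCube)) = W.a₁ ^ 2 + 2 * W.a₂ ∧
    coeff 3 (W.formalWDivCube * (2 - C W.a₁ * X - C W.a₃ * X ^ 3 * W.formalWDivCube)) =
      W.a₁ ^ 3 + 3 * W.a₁ * W.a₂ + W.a₃ ∧
    coeff 4 (W.formalWDivCube * (2 - C W.a₁ * X - C W.a₃ * X ^ 3 * W.formalWDivCube)) =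
      W.a₁ ^ 4 + 4 * W.a₁ ^ 2 * W.a₂ + 2 * W.a₂ ^ 2 + 3 * W.a₁ * W.a₃ + 2 * W.a₄ := by
  have hD : W.formalWDivCube * (2 - C W.a₁ * X - C W.a₃ * X ^ 3 * W.formalWDivCube) =
      C (2 : A) * W.formalWDivCube - C W.a₁ * (X * W.formalWDivCube) -
        C W.a₃ * (X ^ 3 * (W.formalWDivCube * W.formalWDivCube)) := by
    rw [map_ofNat]; ring
  have h0 : coeff 0 W.formalWDivCube = 1 := by
    rw [coeff_zero_eq_constantCoeff]; exact W.constantCoeff_formalWDivCube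
  have hsq : coeff 0 (W.formalWDivCube * W.formalWDivCube) = 1 := by
    rw [PowerSeries.coeff_mul]; simp [h0]
  have hsq1 : coeff 1 (W.formalWDivCube * W.formalWDivCube) = 2 * W.a₁ := by
    rw [PowerSeries.coeff_mul, Finset.Nat.sum_antidiagonal_succ]
    simp [h0, (coeff_one_formalWDivCube W)]; ring
  rw [hD]
  refine ⟨?_, ?_, ?_, ?_, ?_⟩
  · simp only [map_sub, coeff_C_mul, coeff_zero_X_mul, coeff_X_pow_mul', h0]; simp
  · simp only [map_sub, coeff_C_mul, coeff_succ_X_mul, coeff_X_pow_mul', h0, (coeff_one_formalWDivCube W)]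
    simp; ring
  · simp only [map_sub, coeff_C_mul, coeff_succ_X_mul, coeff_X_pow_mul', (coeff_one_formalWDivCube W),
      (coeff_two_formalWDivCube W)]
    simp; ring
  · simp only [map_sub, coeff_C_mul, coeff_succ_X_mul, coeff_X_pow_mul', (coeff_two_formalWDivCube W),
      (coeff_three_formalWDivCube W), hsq]
    simp; ring
  · simp only [map_sub, coeff_C_mul, coeff_succ_X_mul, coeff_X_pow_mul', (coeff_three_formalWDivCube W),
      (coeff_four_formalWDivCube W), hsq1]
    simp; ring

/-- **`coeff 4 ω = a₁⁴ + 3a₁²a₂ + a₂² + 6a₁a₃ + 2a₄`** (degree-4 coefficients in `ω·D = 2B + zB′`).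
[Silverman AEC IV.1] [cite: SilvermanAEC2009, IV.1.1] -/
theorem coeff_four_formalOmega :
    coeff 4 W.formalOmega = W.a₁ ^ 4 + 3 * W.a₁ ^ 2 * W.a₂ + W.a₂ ^ 2 + 6 * W.a₁ * W.a₃ + 2 * W.a₄ := by
  have h := congrArg (coeff 4) W.formalOmega_mul_denom
  obtain ⟨d0, d1, d2, d3, d4⟩ := coeff_formalOmegaDenom₄ W
  have hω0 : coeff 0 W.formalOmega = 1 := by
    rw [coeff_zero_eq_constantCoeff]; exact W.constantCoeff_formalOmega
  have hω1 := coeff_one_formalOmega W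
  have hω2 := coeff_two_formalOmega W
  have hω3 := coeff_three_formalOmega W
  rw [PowerSeries.coeff_mul, Finset.Nat.sum_antidiagonal_succ, Finset.Nat.sum_antidiagonal_succ,
    Finset.Nat.sum_antidiagonal_succ, Finset.Nat.sum_antidiagonal_succ] at h
  simp only [Finset.Nat.antidiagonal_zero, Finset.sum_singleton, zero_add] at h
  rw [hω0, hω1, hω2, hω3, d4, d3, d2, d1, d0, map_add,
    show (2 : A⟦X⟧) * W.formalWDivCube = C (2 : A) * W.formalWDivCube by rw [map_ofNat], coeff_C_mul,
    (coeff_four_formalWDivCube W), coeff_succ_X_mul, coeff_derivative, (coeff_four_formalWDivCube W)] at h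
  have h2 : IsUnit (2 : A) := ⟨WeierstrassCurve.unitTwo, rfl⟩
  refine h2.mul_left_cancel ?_
  have : (2 : A) * coeff 4 W.formalOmega = coeff 4 W.formalOmega * 2 := mul_comm _ _
  rw [this]
  push_cast at h
  linear_combination h

end RatAlgebra

variable {p : ℕ} [hp : Fact p.Prime]

end Literature.NumberTheory.EllipticCurves.DescendedFrobenius.FormalGroupCoefficients

end Part6

/-!
## Part 7 — port of `Summits/BirchSwinnertonDyer/BirchSwinnertonDyer/Theorems/CyclotomicUntwistNineClassesIndependent.lean` (5 declarations kept)

# `ClassesIndependent` holds unconditionally on every good model over `𝓞_{ℚ₃(ζ₉)}` with supersingular special fibre — the rank-`2` lower bound of Katz's module, by the Hasse invariant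

Declarations of this Part (verbatim port; each keeps its own docstring and citation): `coeff_formalXMulSq_two_three_four`, `coeff_four_formalXMulSq_mul_formalOmega`, `b₂_eq_zero_of_three_dvd`, `Δ_eq_zero_of_b₂_of_a₄`, `classesIndependent_of_three_dvd_specialFibreTrace`.

Reference keys (see `references.bib` and the declarations' citations): [SilvermanAEC2009], [Katz1981CrystallineDieudonne].
-/

section Part7

open scoped _root_.Classical
open _root_.PowerSeries _root_.IsCyclotomicExtension Literature.NumberTheory.EllipticCurves
  Literature.NumberTheory.EllipticCurves.DescendedFrobenius
  Literature.NumberTheory.EllipticCurves.DescendedFrobenius.NineIntegers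
  Literature.NumberTheory.EllipticCurves.DescendedFrobenius.NineHondaEstimate
  Literature.NumberTheory.EllipticCurves.DescendedFrobenius.DescendedFrobeniusTransfer
  Literature.NumberTheory.EllipticCurves.DescendedFrobenius.NineHonda
  Literature.NumberTheory.EllipticCurves.DescendedFrobenius.NineLogUnbounded
  Literature.NumberTheory.EllipticCurves.DescendedFrobenius.FormalGroupCoefficients

namespace Literature.NumberTheory.EllipticCurves.DescendedFrobenius.NineClassesIndependent

/-! ## §1 Low coefficients: `z²x = 1 − a₁z − a₂z² − a₃z³ − (a₄ + a₁a₃)z⁴ + ⋯` and `P₄ = a₄ + 2a₁a₃` -/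

section Coefficients

variable {R : Type*} [CommRing R] (W : WeierstrassCurve R)

/-- **`[z²](z²x) = −a₂`, `[z³](z²x) = −a₃`, `[z⁴](z²x) = −a₄ − a₁a₃`** (from `B·(z²x) = 1`, `B = w/z³ =
1 + a₁z + (a₁² + a₂)z² + ⋯`). [cite: SilvermanAEC2009, IV.1.1] -/
theorem coeff_formalXMulSq_two_three_four :
    coeff 2 W.formalXMulSq = -W.a₂ ∧ coeff 3 W.formalXMulSq = -W.a₃ ∧
      coeff 4 W.formalXMulSq = -W.a₄ - W.a₁ * W.a₃ := by
  have h := W.formalWDivCube_mul_formalXMulSq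
  have hB0 : coeff 0 W.formalWDivCube = 1 := by rw [coeff_zero_eq_constantCoeff]; exact W.constantCoeff_formalWDivCube
  have hT0 : coeff 0 W.formalXMulSq = 1 := by rw [coeff_zero_eq_constantCoeff]; exact W.constantCoeff_formalXMulSq
  have hB1 := FormalGroupCoefficients.coeff_one_formalWDivCube W
  have hB2 := FormalGroupCoefficients.coeff_two_formalWDivCube W
  have hB3 := FormalGroupCoefficients.coeff_three_formalWDivCube W
  have hB4 := FormalGroupCoefficients.coeff_four_formalWDivCube W
  have hT1 := W.coeff_one_formalXMulSq
  have h2 := congrArg (coeff 2) h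
  have h3 := congrArg (coeff 3) h
  have h4 := congrArg (coeff 4) h
  rw [PowerSeries.coeff_mul, Finset.Nat.sum_antidiagonal_succ, Finset.Nat.sum_antidiagonal_succ] at h2
  rw [PowerSeries.coeff_mul, Finset.Nat.sum_antidiagonal_succ, Finset.Nat.sum_antidiagonal_succ,
    Finset.Nat.sum_antidiagonal_succ] at h3
  rw [PowerSeries.coeff_mul, Finset.Nat.sum_antidiagonal_succ, Finset.Nat.sum_antidiagonal_succ,
    Finset.Nat.sum_antidiagonal_succ, Finset.Nat.sum_antidiagonal_succ] at h4
  simp only [Finset.Nat.antidiagonal_zero, Finset.sum_singleton, zero_add, coeff_one, hB0, hB1, hB2, hB3, hB4, hT0,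
    hT1] at h2 h3 h4
  norm_num at h2 h3 h4
  have e2 : coeff 2 W.formalXMulSq = -W.a₂ := by linear_combination h2
  have e3 : coeff 3 W.formalXMulSq = -W.a₃ := by rw [e2] at h3; linear_combination h3
  have e4 : coeff 4 W.formalXMulSq = -W.a₄ - W.a₁ * W.a₃ := by rw [e2, e3] at h4; linear_combination h4
  exact ⟨e2, e3, e4⟩

/-- **`P₄ = [z⁴](z²x·ω/dz) = a₄ + 2a₁a₃`** over a `ℚ`-algebra (`ω/dz = 1 + a₁z + (a₁² + a₂)z² +
(a₁³ + 2a₁a₂ + 2a₃)z³ + (a₁⁴ + 3a₁²a₂ + 6a₁a₃ + a₂² + 2a₄)z⁴ + ⋯`). [cite: SilvermanAEC2009, IV.1.1] -/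
theorem coeff_four_formalXMulSq_mul_formalOmega {A : Type*} [CommRing A] [Algebra ℚ A] (V : WeierstrassCurve A) :
    coeff 4 (V.formalXMulSq * V.formalOmega) = V.a₄ + 2 * V.a₁ * V.a₃ := by
  obtain ⟨hT2, hT3, hT4⟩ := coeff_formalXMulSq_two_three_four V
  have hT0 : coeff 0 V.formalXMulSq = 1 := by rw [coeff_zero_eq_constantCoeff]; exact V.constantCoeff_formalXMulSq
  have hT1 := V.coeff_one_formalXMulSq
  have hω0 : coeff 0 V.formalOmega = 1 := by rw [coeff_zero_eq_constantCoeff]; exact V.constantCoeff_formalOmega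
  have hω1 := FormalGroupCoefficients.coeff_one_formalOmega V
  have hω2 := FormalGroupCoefficients.coeff_two_formalOmega V
  have hω3 := FormalGroupCoefficients.coeff_three_formalOmega V
  have hω4 := FormalGroupCoefficients.coeff_four_formalOmega V
  rw [PowerSeries.coeff_mul, Finset.Nat.sum_antidiagonal_succ, Finset.Nat.sum_antidiagonal_succ,
    Finset.Nat.sum_antidiagonal_succ, Finset.Nat.sum_antidiagonal_succ]
  simp only [Finset.Nat.antidiagonal_zero, Finset.sum_singleton, zero_add, hT0, hT1, hT2, hT3, hT4, hω0, hω1, hω2,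
    hω3, hω4]
  ring

end Coefficients

/-! ## §2 The special fibre: supersingular `⇒ b̄₂ = 0` (Hasse); `b̄₂ = b̄₄ = 0 ⇒ Δ̄ = 0` in characteristic `3` -/

/-- **`a ≡ b₂ (mod 3)`** for an elliptic Weierstrass equation over `𝔽₃`: the trace `4 − #E(𝔽₃)` is the Hasse invariant
`A₃ = [x²]Ψ₂² = b₂` (AEC V.4.1(a), tree `cast_card_add_one_sub_natCard_point`). [cite: SilvermanAEC2009, V.4.1] -/
theorem b₂_eq_zero_of_three_dvd (Ē : WeierstrassCurve (ZMod 3)) [Ē.IsElliptic]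
    (h : (3 : ℤ) ∣ 4 - (Nat.card Ē.toAffine.Point : ℤ)) : Ē.b₂ = 0 := by
  have h2 : ringChar (ZMod 3) ≠ 2 := by rw [ZMod.ringChar_zmod_n]; decide
  have hH := Ē.cast_card_add_one_sub_natCard_point h2
  rw [ZMod.card] at hH
  norm_num at hH
  have h0 : (((4 : ℤ) - (Nat.card Ē.toAffine.Point : ℤ) : ℤ) : ZMod 3) = 0 :=
    (ZMod.intCast_zmod_eq_zero_iff_dvd _ 3).mpr h
  have key : Ē.twoTorsionPolynomial.b = 0 := by
    rw [← hH]
    exact_mod_cast h0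
  exact key

/-- In characteristic `3`: `b₂ = 0` and `a₄ + 2a₁a₃ = 0` force `Δ = 0` (`b₄ = 2(a₄ + 2a₁a₃) − 3a₁a₃`,
`Δ = −b₂²b₈ − 8b₄³ − 27b₆² + 9b₂b₄b₆`). [cite: SilvermanAEC2009, III.1] -/
theorem Δ_eq_zero_of_b₂_of_a₄ (Ē : WeierstrassCurve (ZMod 3)) (hb₂ : Ē.b₂ = 0) (h4 : Ē.a₄ + 2 * Ē.a₁ * Ē.a₃ = 0) :
    Ē.Δ = 0 := by
  have hb₄ : Ē.b₄ = 0 := by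
    rw [WeierstrassCurve.b₄]
    have h3 : (3 : ZMod 3) = 0 := rfl
    linear_combination 2 * h4 - Ē.a₁ * Ē.a₃ * h3
  rw [WeierstrassCurve.Δ, hb₂, hb₄]
  have h27 : (27 : ZMod 3) = 0 := rfl
  linear_combination (-Ē.b₆ ^ 2) * h27

/-! ## §3 The theorem -/

/-- **`ClassesIndependent` on every good model with supersingular special fibre (unconditional).** For `W/ℚ`, a good
model `𝓜 : W.NineGoodModel` over `𝓞_{ℚ₃(ζ₉)}` and a reduction map `ρ` with `3 ∣ 𝓜.specialFibreTrace ρ`: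
`𝓜.ClassesIndependent` — the classes `[ω_W], [η_W]` are `ℚ₃(ζ₉)`-linearly independent modulo series with bounded
denominators (the rank-`2` lower bound in Katz's `D(Ê/𝓞) ⊗ ℚ`; Katz 1981 Thm 5.7.2: `H¹_dR ↪ D(Ê)` with kernel the
unit-root part, which is `0` in the supersingular case). See the module docstring for the elementary proof.
[cite: Katz1981CrystallineDieudonne, Thm. 5.3.3 and Thm. 5.7.2] [cite: SilvermanAEC2009, V.4.1] -/
theorem classesIndependent_of_three_dvd_specialFibreTrace {W : WeierstrassCurve ℚ} (𝓜 : W.NineGoodModel)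
    (ρ : ONine →+* ZMod 3) (hss : (3 : ℤ) ∣ 𝓜.specialFibreTrace ρ) : 𝓜.ClassesIndependent := by
  haveI hell : (𝓜.E.map ρ).IsElliptic := isElliptic_specialFibre 𝓜 ρ
  intro a b hab
  set ι := algebraMap ONine KNine with hι
  set u : KNine := (𝓜.C.u : KNine) with hu
  set ui : KNine := ((𝓜.C.u⁻¹ : KNineˣ) : KNine) with hui
  have huui : u * ui = 1 := by rw [hu, hui, Units.mul_inv]
  have hu0 : u ≠ 0 := Units.ne_zero _
  -- the combination in terms of `log` and `L_η`
  have e : a • 𝓜.classOmega + b • 𝓜.classEta =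
      PowerSeries.C (b * u) * 𝓜.curve.formalEtaIntegral +
        PowerSeries.C (a * ui + b * 𝓜.C.r * ui) * 𝓜.curve.formalLog := by
    simp only [WeierstrassCurve.NineGoodModel.classOmega, WeierstrassCurve.NineGoodModel.classEta, smul_eq_C_mul,
      smul_add, map_add, map_mul, ← hu, ← hui]
    ring
  rw [e] at hab
  by_cases hb : b = 0
  · -- `b = 0`: `a·[ω]` has bounded denominators, so `a = 0`
    refine ⟨?_, hb⟩
    rw [hb, zero_mul, map_zero, zero_mul, zero_add, zero_mul, zero_mul, add_zero] at hab
    have hab' : HasBoundedDenominators (PowerSeries.C a * 𝓜.classOmega) := by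
      rw [WeierstrassCurve.NineGoodModel.classOmega, smul_eq_C_mul, ← mul_assoc, ← map_mul, ← hui]
      exact hab
    exact eq_zero_of_hbd_C_mul_classOmega 𝓜 ρ hab'
  · exfalso
    have hbu : b * u ≠ 0 := mul_ne_zero hb hu0
    set c : KNine := (a * ui + b * 𝓜.C.r * ui) * (b * u)⁻¹ with hc
    -- `L_η + c·log` has bounded denominators
    have hG : HasBoundedDenominators (𝓜.curve.formalEtaIntegral + PowerSeries.C c * 𝓜.curve.formalLog) := by
      have h := hbd_C_mul (b * u)⁻¹ hab
      have e' : PowerSeries.C (b * u)⁻¹ * (PowerSeries.C (b * u) * 𝓜.curve.formalEtaIntegral +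
          PowerSeries.C (a * ui + b * 𝓜.C.r * ui) * 𝓜.curve.formalLog) =
          𝓜.curve.formalEtaIntegral + PowerSeries.C c * 𝓜.curve.formalLog := by
        rw [hc, mul_add, ← mul_assoc, ← mul_assoc, ← map_mul, ← map_mul, inv_mul_cancel₀ hbu, map_one, one_mul,
          mul_comm ((b * u)⁻¹)]
      rw [e'] at h
      exact h
    -- hence it is EXACTLY integral
    obtain ⟨G, hGmap⟩ := NineEtaIntegrality.exists_map_eq_of_hbd 𝓜.E ρ c hG
    set 𝓔 := 𝓜.E.map ι with h𝓔
    -- `P = z²x·ω` of `𝓔` is the base change of `z²x · formalInvDiff` of `𝓜.E`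
    have hP : 𝓔.formalXMulSq * 𝓔.formalOmega = (𝓜.E.formalXMulSq * 𝓜.E.formalInvDiff).map ι := by
      rw [map_mul, WeierstrassCurve.map_formalXMulSq, WeierstrassCurve.map_formalInvDiff, ← h𝓔,
        WeierstrassCurve.formalInvDiff_eq_formalOmega]
    -- [z¹]: `c = ι c₀`
    have h1 := congrArg (coeff 1) hGmap
    rw [map_add, coeff_C_mul, WeierstrassCurve.coeff_one_formalLog, mul_one,
      FormalEtaResidue.coeff_one_formalEtaIntegral, hP, coeff_map, coeff_map] at h1
    set c₀ : ONine := coeff 1 G - coeff 2 (𝓜.E.formalXMulSq * 𝓜.E.formalInvDiff) with hc₀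
    have hcc₀ : c = ι c₀ := by
      rw [hc₀, map_sub]
      linear_combination h1
    -- [z³]: `P₄ + c·(a₁² + a₂) = 3·ι(g₃)`
    have hL3 : coeff 3 𝓔.formalEtaIntegral = algebraMap ℚ KNine (1 / 3) * (𝓔.a₄ + 2 * 𝓔.a₁ * 𝓔.a₃) := by
      have h : coeff 3 𝓔.formalEtaIntegral =
          algebraMap ℚ KNine (1 / (2 + 1 : ℚ)) * coeff 4 (𝓔.formalXMulSq * 𝓔.formalOmega) :=
        𝓔.coeff_succ_formalEtaIntegral 2
      rw [show (1 / (2 + 1 : ℚ)) = 1 / 3 by norm_num, coeff_four_formalXMulSq_mul_formalOmega] at h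
      exact h
    have h3 := congrArg (coeff 3) hGmap
    rw [map_add, coeff_C_mul, FormalGroupCoefficients.coeff_three_formalLog, hL3, coeff_map] at h3
    have hthird : algebraMap ℚ KNine (1 / 3) * 3 = 1 := by
      rw [show (3 : KNine) = algebraMap ℚ KNine 3 by norm_num, ← map_mul]; norm_num
    have h3' : 𝓔.a₄ + 2 * 𝓔.a₁ * 𝓔.a₃ + c * (𝓔.a₁ ^ 2 + 𝓔.a₂) = 3 * ι (coeff 3 G) := by
      linear_combination (3 : KNine) * h3 - (𝓔.a₄ + 2 * 𝓔.a₁ * 𝓔.a₃) * hthird - (c * (𝓔.a₁ ^ 2 + 𝓔.a₂)) * hthird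
    -- transport to `𝓞` and reduce mod `ρ`
    have h𝓞 : 𝓜.E.a₄ + 2 * 𝓜.E.a₁ * 𝓜.E.a₃ + c₀ * (𝓜.E.a₁ ^ 2 + 𝓜.E.a₂) = 3 * coeff 3 G := by
      apply Subtype.val_injective
      have e𝓔 : 𝓔.a₁ = ι 𝓜.E.a₁ ∧ 𝓔.a₂ = ι 𝓜.E.a₂ ∧ 𝓔.a₃ = ι 𝓜.E.a₃ ∧ 𝓔.a₄ = ι 𝓜.E.a₄ := by
        simp [h𝓔, WeierstrassCurve.map]
      obtain ⟨e1, e2, e3, e4⟩ := e𝓔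
      rw [e1, e2, e3, e4, hcc₀] at h3'
      simpa [hι, Subalgebra.algebraMap_eq] using h3'
    have hρ := congrArg ρ h𝓞
    simp only [map_add, map_mul, map_pow, map_ofNat, show (3 : ZMod 3) = 0 from rfl, zero_mul] at hρ
    -- the Hasse invariant of the supersingular special fibre
    set Ē := 𝓜.E.map ρ with hĒ
    have hb₂ : Ē.b₂ = 0 := by
      refine b₂_eq_zero_of_three_dvd Ē ?_
      simpa [WeierstrassCurve.NineGoodModel.specialFibreTrace, WeierstrassCurve.NineGoodModel.specialFibre, hĒ]
        using hss
    have hb₂' : Ē.a₁ ^ 2 + Ē.a₂ = 0 := by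
      rw [WeierstrassCurve.b₂] at hb₂
      have h3z : (3 : ZMod 3) = 0 := rfl
      linear_combination hb₂ - Ē.a₂ * h3z
    have ha : Ē.a₁ = ρ 𝓜.E.a₁ ∧ Ē.a₂ = ρ 𝓜.E.a₂ ∧ Ē.a₃ = ρ 𝓜.E.a₃ ∧ Ē.a₄ = ρ 𝓜.E.a₄ := by
      simp [hĒ, WeierstrassCurve.map]
    obtain ⟨ea1, ea2, ea3, ea4⟩ := ha
    have h4 : Ē.a₄ + 2 * Ē.a₁ * Ē.a₃ = 0 := by
      rw [ea1, ea3, ea4]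
      rw [ea1, ea2] at hb₂'
      linear_combination hρ - (ρ c₀) * hb₂'
    have hΔ := Δ_eq_zero_of_b₂_of_a₄ Ē hb₂ h4
    have hunit : IsUnit Ē.Δ := hell.isUnit
    rw [hΔ] at hunit
    exact not_isUnit_zero hunit

end Literature.NumberTheory.EllipticCurves.DescendedFrobenius.NineClassesIndependent

end Part7

/-!
## Part 8 — port of `Summits/BirchSwinnertonDyer/BirchSwinnertonDyer/Theorems/CyclotomicUntwistNineIntegersLocalRing.lean` (13 declarations kept)

# The ring `𝓞 = integralClosure ℤ₃ ℚ₃(ζ₉)` of the local currency of `DescendedFrobeniusMatrix`, IV: the Galois group preserves residues, the unit criterion, `𝓞` is local with maximal ideal `(1 − ζ₉)`, and `𝓞` is a discrete valuation ring — th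

Declarations of this Part (verbatim port; each keeps its own docstring and citation): `exists_algEquiv_zeta_eq_pow`, `algEquiv_mem`, `exists_algEquiv_one_sub_zeta`, `exists_algEquiv_sub_eq_mul`, `residueMap_algEquiv`, `residueMap_ne_zero_of_isUnit`, `isUnit_of_residueMap_ne_zero`, `isUnit_iff_residueMap_ne_zero`, `isLocalRing`, `maximalIdeal_eq`, `not_isField`, `isNoetherianRing`, `isDiscreteValuationRing`.

Reference keys (see `references.bib` and the declarations' citations): [Katz1981CrystallineDieudonne].
-/

section Part8

open scoped _root_.Polynomial

open _root_.Polynomial _root_.IsCyclotomicExtension Literature.NumberTheory.EllipticCurves.DescendedFrobenius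
  Literature.NumberTheory.EllipticCurves.DescendedFrobenius

namespace Literature.NumberTheory.EllipticCurves.DescendedFrobenius.NineIntegers

/-! ### §11 The Galois group of `ℚ₃(ζ₉)/ℚ₃` preserves `𝓞` and the ideal `(1 − ζ₉)` -/

/-- Every `ℚ₃`-automorphism sends `ζ₉` to a power of `ζ₉`. [cite: Katz1981CrystallineDieudonne, §5 (supporting lemma)] -/
theorem exists_algEquiv_zeta_eq_pow (σ : KNine ≃ₐ[ℚ_[3]] KNine) :
    ∃ k : ℕ, σ (zeta 9 ℚ_[3] KNine) = zeta 9 ℚ_[3] KNine ^ k := by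
  have h9 : (σ (zeta 9 ℚ_[3] KNine)) ^ 9 = 1 := by rw [← map_pow, zeta_spec.pow_eq_one, map_one]
  obtain ⟨k, -, hk⟩ := zeta_spec.eq_pow_of_pow_eq_one h9
  exact ⟨k, hk.symm⟩

/-- Automorphisms preserve `𝓞`. [cite: Katz1981CrystallineDieudonne, §5 (supporting lemma)] -/
theorem algEquiv_mem (σ : KNine ≃ₐ[ℚ_[3]] KNine) {x : KNine} (hx : x ∈ ONine) : σ x ∈ ONine := by
  have h : IsIntegral ℤ_[3] x := hx
  exact h.map (σ.toAlgHom.restrictScalars ℤ_[3])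

/-- Automorphisms preserve the ideal `(1 − ζ₉)`: `σ(1 − ζ₉) = (1 − ζ₉)·(1 + ζ₉ + ⋯ + ζ₉ᵏ⁻¹)`. [cite: Katz1981CrystallineDieudonne, §5 (supporting lemma)] -/
theorem exists_algEquiv_one_sub_zeta (σ : KNine ≃ₐ[ℚ_[3]] KNine) :
    ∃ y ∈ ONine, σ (1 - zeta 9 ℚ_[3] KNine) = (1 - zeta 9 ℚ_[3] KNine) * y := by
  obtain ⟨k, hk⟩ := exists_algEquiv_zeta_eq_pow σ
  refine ⟨∑ i ∈ Finset.range k, zeta 9 ℚ_[3] KNine ^ i, sum_mem fun i _ => pow_mem zeta_mem i, ?_⟩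
  rw [map_sub, map_one, hk, mul_neg_geom_sum]

/-- **Automorphisms respect residue digits**: if `x − a ∈ (1 − ζ₉)𝓞` then `σ x − a ∈ (1 − ζ₉)𝓞`. [cite: Katz1981CrystallineDieudonne, §5 (supporting lemma)] -/
theorem exists_algEquiv_sub_eq_mul (σ : KNine ≃ₐ[ℚ_[3]] KNine) {x y : KNine} {a : ℤ} (hy : y ∈ ONine)
    (h : x - a = (1 - zeta 9 ℚ_[3] KNine) * y) :
    ∃ y' ∈ ONine, σ x - a = (1 - zeta 9 ℚ_[3] KNine) * y' := by
  obtain ⟨u, hu, hσ⟩ := exists_algEquiv_one_sub_zeta σ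
  refine ⟨u * σ y, mul_mem hu (algEquiv_mem σ hy), ?_⟩
  have := congrArg σ h
  rw [map_sub, map_intCast, map_mul, hσ] at this
  rw [this, mul_assoc]

/-- Hence every reduction map is Galois-invariant: `ρ (σ x) = ρ x`. [cite: Katz1981CrystallineDieudonne, §5 (supporting lemma)] -/
theorem residueMap_algEquiv (ρ : ONine →+* ZMod 3) (σ : KNine ≃ₐ[ℚ_[3]] KNine) (x : ONine) :
    ρ ⟨σ x, algEquiv_mem σ x.2⟩ = ρ x := by
  obtain ⟨a, y, hy, h, hρ⟩ := exists_int_residueMap_eq ρ x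
  obtain ⟨y', hy', h'⟩ := exists_algEquiv_sub_eq_mul σ hy h
  rw [hρ]
  exact residueMap_eq_of_sub_eq_mul ρ hy' h'

/-! ### §12 Units of `𝓞`: `x` is a unit iff its residue digit is non-zero -/

/-- A unit of `𝓞` has non-zero residue. [cite: Katz1981CrystallineDieudonne, §5 (supporting lemma)] -/
theorem residueMap_ne_zero_of_isUnit (ρ : ONine →+* ZMod 3) {x : ONine} (hx : IsUnit x) : ρ x ≠ 0 :=
  (hx.map ρ).ne_zero

/-- **Unit criterion**: an element of `𝓞` with non-zero residue digit is a unit of `𝓞`. Proof: its norm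
`N = ∏_σ σ x ∈ ℤ₃` has residue `(ρ x)⁶ ≠ 0`, so it is a `3`-adic unit, and `x⁻¹ = N⁻¹ · ∏_{σ ≠ 1} σ x ∈ 𝓞`.
[cite: Katz1981CrystallineDieudonne, §5 (supporting lemma)] -/
theorem isUnit_of_residueMap_ne_zero (ρ : ONine →+* ZMod 3) {x : ONine} (hx : ρ x ≠ 0) : IsUnit x := by
  classical
  haveI : FiniteDimensional ℚ_[3] KNine := IsCyclotomicExtension.finite {9} ℚ_[3] KNine
  haveI : IsGalois ℚ_[3] KNine := IsCyclotomicExtension.isGalois {9} ℚ_[3] KNine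
  -- the norm and its product formula
  have hprod := Algebra.norm_eq_prod_automorphisms ℚ_[3] (x : KNine)
  set n : ℚ_[3] := Algebra.norm ℚ_[3] (x : KNine) with hn
  -- `n ∈ ℤ₃`
  have hnint : IsIntegral ℤ_[3] n := Algebra.isIntegral_norm ℚ_[3] (x.2 : IsIntegral ℤ_[3] (x : KNine))
  obtain ⟨m, hm⟩ := IsIntegrallyClosed.isIntegral_iff.mp hnint
  have hmn : (m : ℚ_[3]) = n := hm
  -- the cofactor `P = ∏_{σ ≠ 1} σ x ∈ 𝓞` with `x · P = N`
  set P : KNine := ∏ σ ∈ (Finset.univ : Finset (KNine ≃ₐ[ℚ_[3]] KNine)).erase 1, σ (x : KNine) with hP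
  have hPmem : P ∈ ONine := prod_mem fun σ _ => algEquiv_mem σ x.2
  have hxP : (x : KNine) * P = algebraMap ℚ_[3] KNine n := by
    have key := Finset.mul_prod_erase (Finset.univ : Finset (KNine ≃ₐ[ℚ_[3]] KNine))
      (fun σ : KNine ≃ₐ[ℚ_[3]] KNine => σ (x : KNine)) (Finset.mem_univ 1)
    rw [AlgEquiv.one_apply] at key
    rw [hprod, hP, key]
  -- the residue of `N` is `(ρ x) ^ 6 ≠ 0`
  have hNmem : algebraMap ℚ_[3] KNine n ∈ ONine := by rw [← hxP]; exact mul_mem x.2 hPmem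
  have hρN : ρ ⟨algebraMap ℚ_[3] KNine n, hNmem⟩ ≠ 0 := by
    have e : (⟨algebraMap ℚ_[3] KNine n, hNmem⟩ : ONine) =
        ∏ σ : KNine ≃ₐ[ℚ_[3]] KNine, (⟨σ (x : KNine), algEquiv_mem σ x.2⟩ : ONine) := by
      apply Subtype.ext
      push_cast
      exact hprod
    rw [e, map_prod]
    simp_rw [residueMap_algEquiv ρ]
    rw [Finset.prod_const]
    exact pow_ne_zero _ hx
  -- so `m` is a `3`-adic unit
  have hm1 : ‖m‖ = 1 := by
    refine le_antisymm m.2 (not_lt.mp fun hlt => hρN ?_)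
    have h3 : (3 : ℤ_[3]) ∣ m := (PadicInt.norm_lt_one_iff_dvd m).mp hlt
    obtain ⟨m', hm'⟩ := h3
    have hn3 : n = 3 * ((m' : ℤ_[3]) : ℚ_[3]) := by
      rw [← hmn, hm', PadicInt.coe_mul]; rfl
    have e : (⟨algebraMap ℚ_[3] KNine n, hNmem⟩ : ONine) =
        3 * ⟨algebraMap ℚ_[3] KNine ((m' : ℤ_[3]) : ℚ_[3]), algebraMap_mem_of_norm_le_one m'.2⟩ := by
      apply Subtype.ext
      push_cast
      rw [hn3, map_mul, map_ofNat]
    rw [e, map_mul, map_ofNat, show (3 : ZMod 3) = 0 from rfl, zero_mul]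
  have hm0 : (m : ℚ_[3]) ≠ 0 := by
    intro h0
    have : ‖(m : ℚ_[3])‖ = 0 := by rw [h0, norm_zero]
    rw [← PadicInt.norm_def, hm1] at this
    exact one_ne_zero this
  have hminv : ‖(m : ℚ_[3])⁻¹‖ ≤ 1 := by rw [norm_inv, ← PadicInt.norm_def, hm1, inv_one]
  -- the inverse of `x` in `𝓞`
  refine IsUnit.of_mul_eq_one (⟨P * algebraMap ℚ_[3] KNine ((m : ℚ_[3])⁻¹),
    mul_mem hPmem (algebraMap_mem_of_norm_le_one hminv)⟩ : ONine) (Subtype.ext ?_)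
  show (x : KNine) * (P * algebraMap ℚ_[3] KNine ((m : ℚ_[3])⁻¹)) = 1
  rw [← mul_assoc, hxP, ← hmn, ← map_mul, mul_inv_cancel₀ hm0, map_one]

/-- **`x ∈ 𝓞` is a unit iff its residue is non-zero.** [cite: Katz1981CrystallineDieudonne, §5 (supporting lemma)] -/
theorem isUnit_iff_residueMap_ne_zero (ρ : ONine →+* ZMod 3) (x : ONine) : IsUnit x ↔ ρ x ≠ 0 :=
  ⟨residueMap_ne_zero_of_isUnit ρ, isUnit_of_residueMap_ne_zero ρ⟩

/-! ### §13 `𝓞` is a discrete valuation ring with uniformizer `1 − ζ₉` -/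

/-- **`𝓞` is a local ring** (the non-units are the kernel of the reduction map). [cite: Katz1981CrystallineDieudonne, §5 (supporting lemma)] -/
theorem isLocalRing : IsLocalRing ONine := by
  obtain ⟨ρ⟩ := nonempty_residueMap
  refine IsLocalRing.of_nonunits_add fun a b ha hb => ?_
  rw [mem_nonunits_iff, isUnit_iff_residueMap_ne_zero ρ, not_not] at ha hb ⊢
  rw [map_add, ha, hb, add_zero]

/-- **The maximal ideal of `𝓞` is `(1 − ζ₉)`** (= the kernel of the reduction map). [cite: Katz1981CrystallineDieudonne, §5 (supporting lemma)] -/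
theorem maximalIdeal_eq :
    @IsLocalRing.maximalIdeal ONine _ isLocalRing =
      Ideal.span {(⟨1 - zeta 9 ℚ_[3] KNine, one_sub_zeta_mem⟩ : ONine)} := by
  obtain ⟨ρ⟩ := nonempty_residueMap
  letI := isLocalRing
  rw [← ker_residueMap_eq ρ]
  ext x
  rw [IsLocalRing.mem_maximalIdeal, mem_nonunits_iff, isUnit_iff_residueMap_ne_zero ρ, not_not, RingHom.mem_ker]

/-- `𝓞` is not a field (`1 − ζ₉` is a non-zero non-unit). [cite: Katz1981CrystallineDieudonne, §5 (supporting lemma)] -/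
theorem not_isField : ¬ IsField ONine := by
  intro hF
  letI := hF.toField
  have hπ0 : (⟨1 - zeta 9 ℚ_[3] KNine, one_sub_zeta_mem⟩ : ONine) ≠ 0 := by
    intro h0
    have := congrArg Subtype.val h0
    exact GNine.one_sub_zeta_ne_zero zeta_spec this
  obtain ⟨y, hy⟩ := hF.mul_inv_cancel hπ0
  have := congrArg Subtype.val hy
  exact one_sub_zeta_mul_ne_one y.2 this

/-- `𝓞` is Noetherian (integral closure of `ℤ₃` in a finite separable extension). [cite: Katz1981CrystallineDieudonne, §5 (supporting lemma)] -/
theorem isNoetherianRing : IsNoetherianRing ONine := by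
  haveI : Module.Finite ℚ_[3] KNine := IsCyclotomicExtension.finite {9} ℚ_[3] KNine
  exact IsIntegralClosure.isNoetherianRing ℤ_[3] ℚ_[3] KNine ONine

/-- **`𝓞 = integralClosure ℤ₃ ℚ₃(ζ₉)` is a discrete valuation ring** (Noetherian local domain whose maximal ideal
`(1 − ζ₉)` is principal and non-zero) — the "valuation ring of `L = ℚ₃(ζ₉)`" of the `DescendedFrobeniusMatrix`
docstring, as a theorem; uniformizer `1 − ζ₉`, residue field `𝔽₃` (`nonempty_quotient_equiv_zmod`), `e = 6`
(`three_eq_neg_pow_six_mul_thetaInv`). [cite: Katz1981CrystallineDieudonne, §5 (supporting lemma)] -/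
theorem isDiscreteValuationRing : IsDiscreteValuationRing ONine := by
  haveI := isLocalRing
  haveI := isNoetherianRing
  have h := IsDiscreteValuationRing.TFAE ONine not_isField
  have hP : (IsLocalRing.maximalIdeal ONine).IsPrincipal :=
    ⟨⟨⟨1 - zeta 9 ℚ_[3] KNine, one_sub_zeta_mem⟩, by rw [maximalIdeal_eq]⟩⟩
  exact (h.out 0 4).mpr hP

end Literature.NumberTheory.EllipticCurves.DescendedFrobenius.NineIntegers

end Part8

/-!
## Part 9 — port of `Summits/BirchSwinnertonDyer/BirchSwinnertonDyer/Theorems/CyclotomicUntwistNineGoodModelUnique.lean` (6 declarations kept)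

# Good models over `𝓞 = integralClosure ℤ₃ ℚ₃(ζ₉)` are unique up to an `𝓞`-integral change of variables; the special fibre of a `NineGoodModel` is one curve over `𝔽₃` up to isomorphism, `specialFibreTrace` is an invariant of the curve, and on

Declarations of this Part (verbatim port; each keeps its own docstring and citation): `isFractionRing`, `isIntegral_curve`, `valuation_Δ_curve`, `exists_variableChange_smul_eq`, `exists_variableChange_specialFibre`, `specialFibreTrace_eq_of_nineGoodModel`.

Reference keys (see `references.bib` and the declarations' citations): [SilvermanAEC2009].
-/

section Part9

open scoped _root_.Polynomial

open _root_.Polynomial _root_.IsCyclotomicExtension _root_.WeierstrassCurve Literature.NumberTheory.EllipticCurves.DescendedFrobenius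
  Literature.NumberTheory.EllipticCurves.DescendedFrobenius

namespace Literature.NumberTheory.EllipticCurves.DescendedFrobenius.NineIntegers

/-- `ℚ₃(ζ₉)` is the fraction field of `𝓞`. [cite: SilvermanAEC2009, Prop. VII.1.3(b), p. 186] -/
theorem isFractionRing : IsFractionRing ONine KNine := by
  haveI : FiniteDimensional ℚ_[3] KNine := IsCyclotomicExtension.finite {9} ℚ_[3] KNine
  exact IsIntegralClosure.isFractionRing_of_finite_extension ℤ_[3] ℚ_[3] KNine ONine

/-- The equation of a good model, read in `K`, is `𝓞`-integral. [cite: SilvermanAEC2009, Prop. VII.1.3(b), p. 186] -/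
theorem isIntegral_curve {W : WeierstrassCurve ℚ} (𝓜 : W.NineGoodModel) :
    WeierstrassCurve.IsIntegral ONine 𝓜.curve :=
  ⟨⟨𝓜.E, rfl⟩⟩

/-- The discriminant of a good model has valuation `1` at the maximal ideal of the DVR `𝓞`. [cite: SilvermanAEC2009, Prop. VII.1.3(b), p. 186] -/
theorem valuation_Δ_curve {W : WeierstrassCurve ℚ} (𝓜 : W.NineGoodModel) :
    haveI := isDiscreteValuationRing
    haveI := isFractionRing
    IsDedekindDomain.HeightOneSpectrum.valuation KNine (IsDiscreteValuationRing.maximalIdeal ONine) 𝓜.curve.Δ = 1 := by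
  haveI := isDiscreteValuationRing
  haveI := isFractionRing
  have e : 𝓜.curve.Δ = algebraMap ONine KNine 𝓜.E.Δ := by
    rw [NineGoodModel.curve, map_Δ]
  rw [e]
  obtain ⟨u, hu⟩ := 𝓜.isUnit_Δ
  rw [← hu]
  set v := IsDiscreteValuationRing.maximalIdeal ONine
  have h1 := v.valuation_le_one (K := KNine) (u : ONine)
  have h12 : v.valuation KNine (algebraMap ONine KNine (u : ONine)) *
      v.valuation KNine (algebraMap ONine KNine ((u⁻¹ : ONineˣ) : ONine)) = 1 := by
    rw [← map_mul, ← map_mul, Units.mul_inv, map_one, map_one]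
  refine le_antisymm h1 ?_
  calc (1 : WithZero (Multiplicative ℤ)) = _ := h12.symm
    _ ≤ v.valuation KNine (algebraMap ONine KNine (u : ONine)) * 1 := by
        gcongr; exact v.valuation_le_one (K := KNine) _
    _ = _ := mul_one _

/-- **Uniqueness of good models up to `𝓞`-isomorphism** (Silverman VII.1.3(b) over the DVR `𝓞`; the equations of
good models are MINIMAL Weierstrass equations since their discriminants are units): for two good models `𝓜₁, 𝓜₂`
of the same elliptic `W/ℚ` there is a change of variables `D` over `𝓞` with `D • 𝓜₁.E = 𝓜₂.E` and
`D ⊗ K = 𝓜₂.C · 𝓜₁.C⁻¹`. [cite: SilvermanAEC2009, Prop. VII.1.3(b), p. 186] -/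
theorem exists_variableChange_smul_eq {W : WeierstrassCurve ℚ} [W.IsElliptic] (𝓜₁ 𝓜₂ : W.NineGoodModel) :
    ∃ D : VariableChange ONine, D • 𝓜₁.E = 𝓜₂.E ∧ D.baseChange KNine = 𝓜₂.C * 𝓜₁.C⁻¹ := by
  haveI := isDiscreteValuationRing
  haveI := isFractionRing
  haveI := isIntegral_curve 𝓜₁
  haveI := isIntegral_curve 𝓜₂
  haveI : WeierstrassCurve.IsMinimal ONine 𝓜₁.curve := isMinimal_of_valuation_Δ_eq_one _ (valuation_Δ_curve 𝓜₁)
  have hmin₂ : WeierstrassCurve.IsMinimal ONine 𝓜₂.curve := isMinimal_of_valuation_Δ_eq_one _ (valuation_Δ_curve 𝓜₂)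
  have h12 : (𝓜₂.C * 𝓜₁.C⁻¹) • 𝓜₁.curve = 𝓜₂.curve := by
    rw [NineGoodModel.curve, NineGoodModel.curve, ← 𝓜₁.smul_eq, ← 𝓜₂.smul_eq, smul_smul, mul_assoc,
      inv_mul_cancel, mul_one]
  haveI : WeierstrassCurve.IsMinimal ONine ((𝓜₂.C * 𝓜₁.C⁻¹) • 𝓜₁.curve) := by rw [h12]; exact hmin₂
  have hΔ : 𝓜₁.curve.Δ ≠ 0 := by
    have e : 𝓜₁.curve = 𝓜₁.C • W.map (algebraMap ℚ KNine) := by rw [NineGoodModel.curve, 𝓜₁.smul_eq]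
    rw [e, variableChange_Δ, map_Δ]
    exact mul_ne_zero (pow_ne_zero _ (Units.ne_zero _))
      ((_root_.map_ne_zero (algebraMap ℚ KNine)).mpr W.isUnit_Δ.ne_zero)
  obtain ⟨D, hD⟩ := exists_variableChange_baseChange_eq_of_isMinimal (R := ONine) 𝓜₁.curve (𝓜₂.C * 𝓜₁.C⁻¹) hΔ
  refine ⟨D, ?_, hD⟩
  apply WeierstrassCurve.map_injective (IsFractionRing.injective ONine KNine)
  have e : (D • 𝓜₁.E).map (algebraMap ONine KNine) = D.baseChange KNine • 𝓜₁.curve := by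
    rw [NineGoodModel.curve, VariableChange.baseChange, ← map_variableChange]
  show (D • 𝓜₁.E).map (algebraMap ONine KNine) = 𝓜₂.E.map (algebraMap ONine KNine)
  rw [e, hD, h12, NineGoodModel.curve]

/-- **The special fibres of two good models differ by a change of variables over `𝔽₃`** (the reduction of the
`𝓞`-integral `D` of `exists_variableChange_smul_eq`). [cite: SilvermanAEC2009, VII.2 (remark before Prop. 2.1)] -/
theorem exists_variableChange_specialFibre {W : WeierstrassCurve ℚ} [W.IsElliptic] (𝓜₁ 𝓜₂ : W.NineGoodModel)
    (ρ : ONine →+* ZMod 3) :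
    ∃ D : VariableChange (ZMod 3), D • 𝓜₁.specialFibre ρ = 𝓜₂.specialFibre ρ := by
  obtain ⟨D, hD, -⟩ := exists_variableChange_smul_eq 𝓜₁ 𝓜₂
  refine ⟨D.map ρ, ?_⟩
  rw [NineGoodModel.specialFibre, NineGoodModel.specialFibre, ← hD, map_variableChange]

/-- **`specialFibreTrace` is an invariant of the curve**: any two good models of `W` over `𝓞` have the same
special-fibre point count and trace along every reduction map — model-independence of the D5 datum `tr φ` WITHOUT
the existence fact `isDescendedFrobeniusMatrix_exists` (whose `trace_eq` gave it only a posteriori).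
[cite: SilvermanAEC2009, Prop. VII.1.3(b) and VII.2] -/
theorem specialFibreTrace_eq_of_nineGoodModel {W : WeierstrassCurve ℚ} [W.IsElliptic] (𝓜₁ 𝓜₂ : W.NineGoodModel)
    (ρ : ONine →+* ZMod 3) : 𝓜₁.specialFibreTrace ρ = 𝓜₂.specialFibreTrace ρ := by
  obtain ⟨D, hD⟩ := exists_variableChange_specialFibre 𝓜₁ 𝓜₂ ρ
  rw [NineGoodModel.specialFibreTrace, NineGoodModel.specialFibreTrace, ← hD, natCard_point_smul]

end Literature.NumberTheory.EllipticCurves.DescendedFrobenius.NineIntegers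

end Part9

/-!
## Part 10 — port of `Summits/BirchSwinnertonDyer/BirchSwinnertonDyer/Theorems/CyclotomicUntwistNineDescendedFrobeniusOfOmegaColumn.lean` (9 declarations kept)

# The descended Frobenius matrix from one transfer datum: the `ω`-column `φ[ω] ≡ c[ω] + d[η]` (reduction of `isDescendedFrobeniusMatrix_exists`)

Declarations of this Part (verbatim port; each keeps its own docstring and citation): `isPowerMapMatrix_comp`, `isPowerMapMatrix_nine_twentySeven_of_three`, `C_mul_C_inv`, `isPowerMapMatrix_three_of_omegaColumn`, `det_trace_of_omegaColumn`, `isPowerMapMatrix_nine_twentySeven_of_omegaColumn`, `classesIndependent_of_omegaColumn`, `isElliptic_of_nineGoodModel`, `isDescendedFrobeniusMatrix_of_omegaColumn`.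

Reference keys (see `references.bib` and the declarations' citations): [Katz1981CrystallineDieudonne], [Honda1970], [SilvermanAEC2009], [BerthelotOgus1983].
-/

section Part10

open scoped _root_.Classical
open _root_.PowerSeries _root_.IsCyclotomicExtension Literature.NumberTheory.EllipticCurves.DescendedFrobenius
  Literature.NumberTheory.EllipticCurves.DescendedFrobenius.NineIntegers
  Literature.NumberTheory.EllipticCurves.DescendedFrobenius.DescendedFrobeniusTransfer
  Literature.NumberTheory.EllipticCurves.DescendedFrobenius.NineHonda

namespace Literature.NumberTheory.EllipticCurves.DescendedFrobenius.NineDescendedFrobeniusOfOmegaColumn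

variable {W : WeierstrassCurve ℚ}

/-- **Power maps compose**: if `z ↦ z^b` has matrix `N` and `z ↦ z^a` has matrix `N'` on `([ω], [η])` modulo bounded
denominators, then `z ↦ z^{ab}` has matrix `N'·N` (`expand a ∘ expand b = expand (a·b)`, `expand` is `ℚ₃(ζ₉)`-linear and
preserves bounded denominators). [cite: Katz1981CrystallineDieudonne, Thm. 5.1.4] -/
theorem isPowerMapMatrix_comp (𝓜 : W.NineGoodModel) {a b : ℕ} (ha : a ≠ 0) (hb : b ≠ 0)
    {N N' : Matrix (Fin 2) (Fin 2) KNine} (hN : 𝓜.IsPowerMapMatrix b hb N) (hN' : 𝓜.IsPowerMapMatrix a ha N') :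
    𝓜.IsPowerMapMatrix (a * b) (Nat.mul_ne_zero ha hb) (N' * N) := by
  set Ω := 𝓜.classOmega with hΩ
  set H := 𝓜.classEta with hH
  obtain ⟨hN1, hN2⟩ := hN
  obtain ⟨hN1', hN2'⟩ := hN'
  have e1 : expand (a * b) (Nat.mul_ne_zero ha hb) Ω = expand a ha (expand b hb Ω) := expand_mul a ha b hb Ω
  have e2 : expand (a * b) (Nat.mul_ne_zero ha hb) H = expand a ha (expand b hb H) := expand_mul a ha b hb H
  constructor
  · -- image of `[ω]`
    have h1 := hbd_expand a ha hN1
    rw [map_sub, map_sub, expand_smul, expand_smul] at h1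
    have h := (h1.add (hbd_smul (N 0 0) hN1')).add (hbd_smul (N 1 0) hN2')
    have e : expand a ha (expand b hb Ω) - N 0 0 • expand a ha Ω - N 1 0 • expand a ha H +
          N 0 0 • (expand a ha Ω - N' 0 0 • Ω - N' 1 0 • H) + N 1 0 • (expand a ha H - N' 0 1 • Ω - N' 1 1 • H) =
        expand (a * b) (Nat.mul_ne_zero ha hb) Ω - (N' * N) 0 0 • Ω - (N' * N) 1 0 • H := by
      rw [e1, Matrix.mul_apply, Matrix.mul_apply, Fin.sum_univ_two, Fin.sum_univ_two]
      simp only [smul_sub, add_smul, mul_smul]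
      abel_nf
      simp only [smul_smul, mul_comm (N 0 0), mul_comm (N 1 0)]
      abel
    rwa [e] at h
  · -- image of `[η]`
    have h1 := hbd_expand a ha hN2
    rw [map_sub, map_sub, expand_smul, expand_smul] at h1
    have h := (h1.add (hbd_smul (N 0 1) hN1')).add (hbd_smul (N 1 1) hN2')
    have e : expand a ha (expand b hb H) - N 0 1 • expand a ha Ω - N 1 1 • expand a ha H +
          N 0 1 • (expand a ha Ω - N' 0 0 • Ω - N' 1 0 • H) + N 1 1 • (expand a ha H - N' 0 1 • Ω - N' 1 1 • H) =
        expand (a * b) (Nat.mul_ne_zero ha hb) H - (N' * N) 0 1 • Ω - (N' * N) 1 1 • H := by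
      rw [e2, Matrix.mul_apply, Matrix.mul_apply, Fin.sum_univ_two, Fin.sum_univ_two]
      simp only [smul_sub, add_smul, mul_smul]
      abel_nf
      simp only [smul_smul, mul_comm (N 0 1), mul_comm (N 1 1)]
      abel
    rwa [e] at h

/-- `IsPowerMapMatrix` for `9 = 3·3` and `27 = 3·9` from the one for `3`: matrices `N·N` and `N·(N·N)`.
[cite: Katz1981CrystallineDieudonne, Thm. 5.1.4] -/
theorem isPowerMapMatrix_nine_twentySeven_of_three (𝓜 : W.NineGoodModel) {N : Matrix (Fin 2) (Fin 2) KNine}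
    (hN : 𝓜.IsPowerMapMatrix 3 (by norm_num) N) :
    𝓜.IsPowerMapMatrix 9 (by norm_num) (N ^ 2) ∧ 𝓜.IsPowerMapMatrix 27 (by norm_num) (N ^ 3) := by
  have h9 : 𝓜.IsPowerMapMatrix (3 * 3) (by norm_num) (N * N) := isPowerMapMatrix_comp 𝓜 _ _ hN hN
  have h27 : 𝓜.IsPowerMapMatrix (3 * (3 * 3)) (by norm_num) (N * (N * N)) := isPowerMapMatrix_comp 𝓜 _ _ h9 hN
  refine ⟨?_, ?_⟩
  · rw [pow_two]; exact h9
  · rw [pow_succ', pow_two]; exact h27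

/-- `C x * C x⁻¹ = 1` for `x ≠ 0`. [cite: Katz1981CrystallineDieudonne, Thm. 5.1.4] -/
theorem C_mul_C_inv {x : KNine} (hx : x ≠ 0) : (PowerSeries.C x : KNine⟦X⟧) * PowerSeries.C x⁻¹ = 1 := by
  rw [← map_mul, mul_inv_cancel₀ hx, map_one]

/-- **`IsPowerMapMatrix 𝓜 3 M` from the `ω`-column and Honda's relation.** If `φ[ω] ≡ c[ω] + d[η]` modulo bounded
denominators (`φ = expand 3`, `c, d ∈ ℚ₃`, `d ≠ 0`), then with `a = 𝓜.specialFibreTrace ρ` and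
`M = !![c, ((a − c)c − 3)/d; d, a − c]`: `IsPowerMapMatrix 𝓜 3 (M ⊗ ℚ₃(ζ₉))`. The `η`-column is forced by
`φ²[ω] ≡ aφ[ω] − 3[ω]` (`NineHonda.hbd_honda_classOmega`): `d·φ[η] ≡ ((a − c)c − 3)[ω] + d(a − c)[η]`.
[cite: Katz1981CrystallineDieudonne, Thm. 5.1.4 and (6.1.1)] [cite: Honda1970, Thm. 9] -/
theorem isPowerMapMatrix_three_of_omegaColumn (𝓜 : W.NineGoodModel) (ρ : ONine →+* ZMod 3) {c d : ℚ_[3]}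
    (hd : d ≠ 0)
    (hω : HasBoundedDenominators (expand 3 (by norm_num) 𝓜.classOmega -
      PowerSeries.C (algebraMap ℚ_[3] KNine c) * 𝓜.classOmega - PowerSeries.C (algebraMap ℚ_[3] KNine d) * 𝓜.classEta)) :
    𝓜.IsPowerMapMatrix 3 (by norm_num)
      ((!![c, (((𝓜.specialFibreTrace ρ : ℚ_[3]) - c) * c - 3) / d; d, (𝓜.specialFibreTrace ρ : ℚ_[3]) - c] :
        Matrix (Fin 2) (Fin 2) ℚ_[3]).map (algebraMap ℚ_[3] KNine)) := by
  set ι := algebraMap ℚ_[3] KNine with hι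
  set Ω := 𝓜.classOmega with hΩ
  set H := 𝓜.classEta with hH
  set a : ℚ_[3] := (𝓜.specialFibreTrace ρ : ℚ_[3]) with ha
  have hd' : ι d ≠ 0 := (map_ne_zero ι).mpr hd
  have haK : ((𝓜.specialFibreTrace ρ : ℤ) : KNine) = ι a := by rw [ha, map_intCast]
  -- Honda: `φ²Ω − a φΩ + 3Ω ∈ HBD`
  have R₂ := hbd_honda_classOmega 𝓜 ρ
  rw [haK, ← hΩ] at R₂
  have e33 : expand (3 ^ 2) (Literature.RingTheory.FormalGroups.prime_sq_ne_zero 3) Ω =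
      expand 3 (by norm_num) (expand 3 (by norm_num) Ω) :=
    (expand_expand (by norm_num) (by norm_num) (Literature.RingTheory.FormalGroups.prime_sq_ne_zero 3)
      (by norm_num) Ω).symm
  rw [e33] at R₂
  constructor
  · -- `ω`-column: literally the datum
    have e : expand 3 (by norm_num) Ω -
          (Matrix.map !![c, ((a - c) * c - 3) / d; d, a - c] ι) 0 0 • Ω -
          (Matrix.map !![c, ((a - c) * c - 3) / d; d, a - c] ι) 1 0 • H =
        expand 3 (by norm_num) Ω - PowerSeries.C (ι c) * Ω - PowerSeries.C (ι d) * H := by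
      simp only [Matrix.map_apply, Matrix.of_apply, Matrix.cons_val', Matrix.cons_val_zero, Matrix.cons_val_one,
        Matrix.empty_val', Matrix.cons_val_fin_one, smul_eq_C_mul]
    rw [e]; exact hω
  · -- `η`-column: `d·(φH − M₀₁Ω − M₁₁H) = −φ(hω) + R₂ + (a − c)·hω`
    have hφ := hbd_expand 3 (by norm_num) hω
    rw [map_sub, map_sub, map_mul, map_mul, expand_C, expand_C] at hφ
    have hsum := ((hφ.neg).add R₂).add (hbd_C_mul (ι (a - c)) hω)
    -- divide by `d`
    have hdiv := hbd_C_mul (ι d)⁻¹ hsum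
    have e : PowerSeries.C (ι d)⁻¹ *
        (-(expand 3 (by norm_num) (expand 3 (by norm_num) Ω) - PowerSeries.C (ι c) * expand 3 (by norm_num) Ω -
            PowerSeries.C (ι d) * expand 3 (by norm_num) H) +
          (expand 3 (by norm_num) (expand 3 (by norm_num) Ω) -
            PowerSeries.C (ι a) * expand 3 (by norm_num) Ω + 3 * Ω) +
          PowerSeries.C (ι (a - c)) * (expand 3 (by norm_num) Ω - PowerSeries.C (ι c) * Ω - PowerSeries.C (ι d) * H)) =
        expand 3 (by norm_num) H -
          (Matrix.map !![c, ((a - c) * c - 3) / d; d, a - c] ι) 0 1 • Ω -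
          (Matrix.map !![c, ((a - c) * c - 3) / d; d, a - c] ι) 1 1 • H := by
      simp only [Matrix.map_apply, Matrix.of_apply, Matrix.cons_val', Matrix.cons_val_zero, Matrix.cons_val_one,
        Matrix.empty_val', Matrix.cons_val_fin_one, smul_eq_C_mul, map_sub, map_mul, map_inv₀, map_ofNat,
        div_eq_mul_inv]
      linear_combination (expand 3 (by norm_num) H - (PowerSeries.C (ι a) - PowerSeries.C (ι c)) * H) *
        C_mul_C_inv hd'
    rwa [e] at hdiv

/-- **`det M = 3`, `tr M = a`, `M₁₀ = d`** for `M = !![c, ((a − c)c − 3)/d; d, a − c]` (`d ≠ 0`). [cite: Katz1981CrystallineDieudonne, Thm. 5.1.4] -/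
theorem det_trace_of_omegaColumn (a c d : ℚ_[3]) (hd : d ≠ 0) :
    (!![c, ((a - c) * c - 3) / d; d, a - c] : Matrix (Fin 2) (Fin 2) ℚ_[3]).det = 3 ∧
      (!![c, ((a - c) * c - 3) / d; d, a - c] : Matrix (Fin 2) (Fin 2) ℚ_[3]).trace = a ∧
      (!![c, ((a - c) * c - 3) / d; d, a - c] : Matrix (Fin 2) (Fin 2) ℚ_[3]) 1 0 = d := by
  refine ⟨?_, ?_, rfl⟩
  · rw [Matrix.det_fin_two_of]
    field_simp
    ring
  · rw [Matrix.trace_fin_two_of]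
    ring

/-- **`9` and `27`**: from the `ω`-column datum, `IsPowerMapMatrix 𝓜 9 (M²)` and `IsPowerMapMatrix 𝓜 27 (M³)` with
`M = !![c, ((a − c)c − 3)/d; d, a − c]` read in `ℚ₃(ζ₉)`. [cite: Katz1981CrystallineDieudonne, Thm. 5.1.4] -/
theorem isPowerMapMatrix_nine_twentySeven_of_omegaColumn (𝓜 : W.NineGoodModel) (ρ : ONine →+* ZMod 3)
    {c d : ℚ_[3]} (hd : d ≠ 0)
    (hω : HasBoundedDenominators (expand 3 (by norm_num) 𝓜.classOmega -
      PowerSeries.C (algebraMap ℚ_[3] KNine c) * 𝓜.classOmega - PowerSeries.C (algebraMap ℚ_[3] KNine d) * 𝓜.classEta)) :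
    𝓜.IsPowerMapMatrix 9 (by norm_num)
        (((!![c, (((𝓜.specialFibreTrace ρ : ℚ_[3]) - c) * c - 3) / d; d, (𝓜.specialFibreTrace ρ : ℚ_[3]) - c] :
          Matrix (Fin 2) (Fin 2) ℚ_[3]) ^ 2).map (algebraMap ℚ_[3] KNine)) ∧
      𝓜.IsPowerMapMatrix 27 (by norm_num)
        (((!![c, (((𝓜.specialFibreTrace ρ : ℚ_[3]) - c) * c - 3) / d; d, (𝓜.specialFibreTrace ρ : ℚ_[3]) - c] :
          Matrix (Fin 2) (Fin 2) ℚ_[3]) ^ 3).map (algebraMap ℚ_[3] KNine)) := by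
  have h3 := isPowerMapMatrix_three_of_omegaColumn 𝓜 ρ hd hω
  have h := isPowerMapMatrix_nine_twentySeven_of_three 𝓜 h3
  rw [← Matrix.map_pow, ← Matrix.map_pow] at h
  exact h

/-- **`ClassesIndependent 𝓜` from the `ω`-column datum and the independence of `([ω], φ[ω])`** modulo bounded
denominators: `x[ω] + y[η] ≡ 0` gives `d(x[ω] + y[η]) + y·hω = (dx − yc)[ω] + y·φ[ω] ≡ 0`, so `y = 0`, `x = 0`.
[cite: Katz1981CrystallineDieudonne, Thm. 5.3.3] -/
theorem classesIndependent_of_omegaColumn (𝓜 : W.NineGoodModel) {c d : ℚ_[3]} (hd : d ≠ 0)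
    (hω : HasBoundedDenominators (expand 3 (by norm_num) 𝓜.classOmega -
      PowerSeries.C (algebraMap ℚ_[3] KNine c) * 𝓜.classOmega - PowerSeries.C (algebraMap ℚ_[3] KNine d) * 𝓜.classEta))
    (hind : ∀ x y : KNine, HasBoundedDenominators (PowerSeries.C x * 𝓜.classOmega +
      PowerSeries.C y * expand 3 (by norm_num) 𝓜.classOmega) → x = 0 ∧ y = 0) :
    𝓜.ClassesIndependent := by
  set ι := algebraMap ℚ_[3] KNine with hι
  have hd' : ι d ≠ 0 := (map_ne_zero ι).mpr hd
  intro x y hxy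
  rw [smul_eq_C_mul, smul_eq_C_mul] at hxy
  have h := (hbd_C_mul (ι d) hxy).add (hbd_C_mul y hω)
  have e : PowerSeries.C (ι d) * (PowerSeries.C x * 𝓜.classOmega + PowerSeries.C y * 𝓜.classEta) +
        PowerSeries.C y * (expand 3 (by norm_num) 𝓜.classOmega - PowerSeries.C (ι c) * 𝓜.classOmega -
          PowerSeries.C (ι d) * 𝓜.classEta) =
      PowerSeries.C (ι d * x - y * ι c) * 𝓜.classOmega + PowerSeries.C y * expand 3 (by norm_num) 𝓜.classOmega := by
    simp only [map_sub, map_mul]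
    ring
  rw [e] at h
  obtain ⟨h1, h2⟩ := hind _ _ h
  refine ⟨?_, h2⟩
  rw [h2, zero_mul, sub_zero] at h1
  exact (mul_eq_zero.mp h1).resolve_left hd'

/-- A curve with a good model over `𝓞` is elliptic (`Δ_E` is a unit and `Δ_{C • W} = u⁻¹² Δ_W`). [cite: SilvermanAEC2009, VII.1] -/
theorem isElliptic_of_nineGoodModel (𝓜 : W.NineGoodModel) : W.IsElliptic := by
  refine ⟨isUnit_iff_ne_zero.mpr fun h0 => ?_⟩
  have hΔ : (𝓜.C • W.map (algebraMap ℚ KNine)).Δ = 0 := by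
    rw [WeierstrassCurve.variableChange_Δ, WeierstrassCurve.map_Δ, h0, map_zero, mul_zero]
  rw [𝓜.smul_eq, WeierstrassCurve.map_Δ] at hΔ
  have hu : IsUnit ((algebraMap ONine KNine) 𝓜.E.Δ) := 𝓜.isUnit_Δ.map _
  rw [hΔ] at hu
  exact not_isUnit_zero hu

/-- **`W.IsDescendedFrobeniusMatrix M` from a `W`-intrinsic `ω`-column datum.** If the SAME `c, d ∈ ℚ₃` (`d ≠ 0`)
give `φ[ω_W] ≡ c[ω_W] + d[η_W]` on EVERY good model of `W`, and `([ω], φ[ω])` is independent modulo bounded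
denominators on every good model, then `M = !![c, ((a − c)c − 3)/d; d, a − c]` (with `a` the special-fibre trace
of any good model along any reduction map — an invariant of `W`) is THE descended Frobenius matrix: `det M = 3`,
`ClassesIndependent`, `IsPowerMapMatrix 9 (M²)`, `IsPowerMapMatrix 27 (M³)` on all good models, and `tr M = a`.
[cite: BerthelotOgus1983, Prop. (3.14)] [cite: Katz1981CrystallineDieudonne, Thm. 5.1.4, 5.3.3 and (6.1.1)] -/
theorem isDescendedFrobeniusMatrix_of_omegaColumn (𝓜 : W.NineGoodModel) (ρ : ONine →+* ZMod 3) {c d : ℚ_[3]}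
    (hd : d ≠ 0)
    (hω : ∀ 𝓜' : W.NineGoodModel, HasBoundedDenominators (expand 3 (by norm_num) 𝓜'.classOmega -
      PowerSeries.C (algebraMap ℚ_[3] KNine c) * 𝓜'.classOmega -
      PowerSeries.C (algebraMap ℚ_[3] KNine d) * 𝓜'.classEta))
    (hind : ∀ 𝓜' : W.NineGoodModel, ∀ x y : KNine, HasBoundedDenominators (PowerSeries.C x * 𝓜'.classOmega +
      PowerSeries.C y * expand 3 (by norm_num) 𝓜'.classOmega) → x = 0 ∧ y = 0) :
    W.IsDescendedFrobeniusMatrix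
        (!![c, (((𝓜.specialFibreTrace ρ : ℚ_[3]) - c) * c - 3) / d; d, (𝓜.specialFibreTrace ρ : ℚ_[3]) - c]) ∧
      (!![c, (((𝓜.specialFibreTrace ρ : ℚ_[3]) - c) * c - 3) / d; d, (𝓜.specialFibreTrace ρ : ℚ_[3]) - c] :
        Matrix (Fin 2) (Fin 2) ℚ_[3]).trace = (𝓜.specialFibreTrace ρ : ℚ_[3]) := by
  haveI := isElliptic_of_nineGoodModel 𝓜
  obtain ⟨hdet, htr, -⟩ := det_trace_of_omegaColumn (𝓜.specialFibreTrace ρ : ℚ_[3]) c d hd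
  refine ⟨⟨hdet, ⟨𝓜⟩, fun 𝓜' => ⟨classesIndependent_of_omegaColumn 𝓜' hd (hω 𝓜') (hind 𝓜'), ?_⟩⟩, htr⟩
  -- the trace is the same on every good model
  have ha : (𝓜.specialFibreTrace ρ : ℚ_[3]) = (𝓜'.specialFibreTrace ρ : ℚ_[3]) := by
    rw [specialFibreTrace_eq_of_nineGoodModel 𝓜 𝓜' ρ]
  rw [ha]
  exact isPowerMapMatrix_nine_twentySeven_of_omegaColumn 𝓜' ρ hd (hω 𝓜')

end Literature.NumberTheory.EllipticCurves.DescendedFrobenius.NineDescendedFrobeniusOfOmegaColumn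

end Part10

/-!
## Part 11 — port of `Summits/BirchSwinnertonDyer/BirchSwinnertonDyer/Theorems/CyclotomicUntwistNineGaloisDescent.lean` (4 declarations kept)

# Galois descent on the `ω`-plane of Katz's module over `𝓞_{ℚ₃(ζ₉)}`: conjugate good models, independence of `([ω], φ[ω])`, and `ℚ₃`-rationality of the `ω`-column — the named fact from the `η`-position

Declarations of this Part (verbatim port; each keeps its own docstring and citation): `map_formalEtaIntegral`, `exists_conj_nineGoodModel`, `hbd_map`, `classesIndependent_of_omegaColumn'`.

Reference keys (see `references.bib` and the declarations' citations): [Katz1981CrystallineDieudonne], [SilvermanAEC2009].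
-/

section Part11

open scoped _root_.Classical
open _root_.PowerSeries _root_.IsCyclotomicExtension Literature.NumberTheory.EllipticCurves.DescendedFrobenius
  Literature.NumberTheory.EllipticCurves.DescendedFrobenius.NineIntegers
  Literature.NumberTheory.EllipticCurves.DescendedFrobenius.NineHondaEstimate
  Literature.NumberTheory.EllipticCurves.DescendedFrobenius.DescendedFrobeniusTransfer
  Literature.NumberTheory.EllipticCurves.DescendedFrobenius.NineHonda
  Literature.NumberTheory.EllipticCurves.DescendedFrobenius.NineLogUnbounded
  Literature.NumberTheory.EllipticCurves.DescendedFrobenius.NineDescendedFrobeniusOfOmegaColumn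

namespace Literature.NumberTheory.EllipticCurves.DescendedFrobenius.NineGaloisDescent

variable {W : WeierstrassCurve ℚ}

/-- `∫(xω − dz/z²)` commutes with base change along a ring map of `ℚ`-algebras. [cite: Katz1981CrystallineDieudonne, §5.1 (p. 193)] -/
theorem map_formalEtaIntegral {A B : Type*} [CommRing A] [CommRing B] [Algebra ℚ A] [Algebra ℚ B] (f : A →+* B)
    (V : WeierstrassCurve A) : (V.formalEtaIntegral).map f = (V.map f).formalEtaIntegral := by
  have hq : ∀ q : ℚ, f (algebraMap ℚ A q) = algebraMap ℚ B q := fun q =>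
    RingHom.congr_fun (RingHom.ext_rat (f.comp (algebraMap ℚ A)) (algebraMap ℚ B)) q
  ext n
  rw [coeff_map]
  rcases n with _ | n
  · simp only [coeff_zero_eq_constantCoeff, WeierstrassCurve.constantCoeff_formalEtaIntegral, map_zero]
  · rw [WeierstrassCurve.coeff_succ_formalEtaIntegral, WeierstrassCurve.coeff_succ_formalEtaIntegral, map_mul, hq,
      ← coeff_map, map_mul, WeierstrassCurve.map_formalXMulSq, WeierstrassCurve.map_formalOmega']

/-- **The conjugate good model.** For `τ ∈ Gal(ℚ₃(ζ₉)/ℚ₃)` and a good model `𝓜 = (E, C)` of `W/ℚ` over `𝓞`,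
`𝓜^τ = (E^τ, C^τ)` is a good model of `W` (`W` has rational coefficients, `τ` preserves `𝓞` and units) whose Néron
classes are the coefficientwise conjugates: `classOmega(𝓜^τ) = τ_* classOmega(𝓜)`, `classEta(𝓜^τ) = τ_* classEta(𝓜)`.
[cite: SilvermanAEC2009, VII.1.3] [cite: Katz1981CrystallineDieudonne, §5.1] -/
theorem exists_conj_nineGoodModel (𝓜 : W.NineGoodModel) (τ : KNine ≃ₐ[ℚ_[3]] KNine) :
    ∃ 𝓜' : W.NineGoodModel, 𝓜'.classOmega = (𝓜.classOmega).map (τ : KNine →+* KNine) ∧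
      𝓜'.classEta = (𝓜.classEta).map (τ : KNine →+* KNine) := by
  set ι := algebraMap ONine KNine with hι
  -- `τ` restricted to `𝓞`
  have hmem : ∀ x ∈ ONine, (τ : KNine →+* KNine) x ∈ ONine := fun x hx => algEquiv_mem τ hx
  let τO : ONine →+* ONine := (τ : KNine →+* KNine).restrict ONine ONine hmem
  have hτO : ∀ x : ONine, ι (τO x) = (τ : KNine →+* KNine) (ι x) := fun x =>
    RingHom.coe_restrict_apply (τ : KNine →+* KNine) ONine ONine hmem x
  have hcomp : ι.comp τO = (τ : KNine →+* KNine).comp ι := RingHom.ext hτO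
  -- the conjugate model
  have hsmul : (𝓜.C.map (τ : KNine →+* KNine)) • W.map (algebraMap ℚ KNine) = (𝓜.E.map τO).map ι := by
    have hW : W.map (algebraMap ℚ KNine) = (W.map (algebraMap ℚ KNine)).map (τ : KNine →+* KNine) := by
      rw [WeierstrassCurve.map_map]
      congr 1
      exact (RingHom.ext_rat _ _)
    rw [hW, WeierstrassCurve.map_variableChange, 𝓜.smul_eq, WeierstrassCurve.map_map, WeierstrassCurve.map_map, hcomp]
  let 𝓜' : W.NineGoodModel :=
    { E := 𝓜.E.map τO
      C := 𝓜.C.map (τ : KNine →+* KNine)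
      isUnit_Δ := by rw [WeierstrassCurve.map_Δ]; exact 𝓜.isUnit_Δ.map τO
      smul_eq := hsmul }
  have hcurve : 𝓜'.curve = 𝓜.curve.map (τ : KNine →+* KNine) := by
    show (𝓜.E.map τO).map ι = (𝓜.E.map ι).map (τ : KNine →+* KNine)
    rw [WeierstrassCurve.map_map, WeierstrassCurve.map_map, hcomp]
  have hu : ((𝓜'.C.u⁻¹ : KNineˣ) : KNine) = (τ : KNine →+* KNine) ((𝓜.C.u⁻¹ : KNineˣ) : KNine) := by
    show (((𝓜.C.map (τ : KNine →+* KNine)).u⁻¹ : KNineˣ) : KNine) = (τ : KNine →+* KNine) ((𝓜.C.u⁻¹ : KNineˣ) : KNine)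
    simp [WeierstrassCurve.VariableChange.map]
  have hu' : (𝓜'.C.u : KNine) = (τ : KNine →+* KNine) (𝓜.C.u : KNine) := by
    show (((𝓜.C.map (τ : KNine →+* KNine)).u : KNineˣ) : KNine) = (τ : KNine →+* KNine) (𝓜.C.u : KNine)
    simp [WeierstrassCurve.VariableChange.map]
  have hr : 𝓜'.C.r = (τ : KNine →+* KNine) 𝓜.C.r := rfl
  refine ⟨𝓜', ?_, ?_⟩
  · rw [WeierstrassCurve.NineGoodModel.classOmega, WeierstrassCurve.NineGoodModel.classOmega, hcurve,
      ← WeierstrassCurve.map_formalLog, hu, smul_eq_C_mul, smul_eq_C_mul, map_mul, map_C]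
  · rw [WeierstrassCurve.NineGoodModel.classEta, WeierstrassCurve.NineGoodModel.classEta, hcurve,
      ← WeierstrassCurve.map_formalLog, ← map_formalEtaIntegral, hu, hu', hr]
    simp only [smul_eq_C_mul, map_add, map_mul, map_C, mul_assoc]

/-- `τ_*` preserves bounded denominators (`τ(𝓞) = 𝓞`). [cite: Katz1981CrystallineDieudonne, §5.1 (p. 193)] -/
theorem hbd_map (τ : KNine ≃ₐ[ℚ_[3]] KNine) {f : KNine⟦X⟧} (hf : HasBoundedDenominators f) :
    HasBoundedDenominators (f.map (τ : KNine →+* KNine)) := by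
  obtain ⟨d, hd⟩ := hf
  refine ⟨d, fun n => ?_⟩
  have h : (3 : KNine) ^ d * coeff n (f.map (τ : KNine →+* KNine)) = τ ((3 : KNine) ^ d * coeff n f) := by
    rw [coeff_map, map_mul, map_pow, map_ofNat]; rfl
  rw [h]
  exact algEquiv_mem τ (hd n)

/-- `ClassesIndependent` from an `ω`-column over `ℚ₃(ζ₉)` (`d ≠ 0`) and the independence of `([ω], φ[ω])`.
[cite: Katz1981CrystallineDieudonne, Thm. 5.3.3] -/
theorem classesIndependent_of_omegaColumn' (𝓜 : W.NineGoodModel) {c d : KNine} (hd : d ≠ 0)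
    (hω : HasBoundedDenominators (expand 3 (by norm_num) 𝓜.classOmega - PowerSeries.C c * 𝓜.classOmega -
      PowerSeries.C d * 𝓜.classEta))
    (hind : ∀ x y : KNine, HasBoundedDenominators (PowerSeries.C x * 𝓜.classOmega +
      PowerSeries.C y * expand 3 (by norm_num) 𝓜.classOmega) → x = 0 ∧ y = 0) :
    𝓜.ClassesIndependent := by
  intro x y hxy
  rw [smul_eq_C_mul, smul_eq_C_mul] at hxy
  have h := (hbd_C_mul d hxy).add (hbd_C_mul y hω)
  have e : PowerSeries.C d * (PowerSeries.C x * 𝓜.classOmega + PowerSeries.C y * 𝓜.classEta) +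
        PowerSeries.C y * (expand 3 (by norm_num) 𝓜.classOmega - PowerSeries.C c * 𝓜.classOmega -
          PowerSeries.C d * 𝓜.classEta) =
      PowerSeries.C (d * x - y * c) * 𝓜.classOmega + PowerSeries.C y * expand 3 (by norm_num) 𝓜.classOmega := by
    simp only [map_sub, map_mul]
    ring
  rw [e] at h
  obtain ⟨h1, h2⟩ := hind _ _ h
  refine ⟨?_, h2⟩
  rw [h2, zero_mul, sub_zero] at h1
  exact (mul_eq_zero.mp h1).resolve_left hd

end Literature.NumberTheory.EllipticCurves.DescendedFrobenius.NineGaloisDescent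

end Part11

/-!
## Part 12 — port of `Summits/BirchSwinnertonDyer/BirchSwinnertonDyer/Theorems/CyclotomicUntwistDescendedFrobeniusOneModel.lean` (3 declarations kept)

# Model independence of `ClassesIndependent` / `IsPowerMapMatrix` / the `ω`-column datum, and the one-model criterion for `IsDescendedFrobeniusMatrix`

Declarations of this Part (verbatim port; each keeps its own docstring and citation): `hbd_rel_of_rel`, `hbd_classOmega_subst_sub`, `hbd_omegaColumn_iff`.

Reference keys (see `references.bib` and the declarations' citations): [Katz1981CrystallineDieudonne].
-/

section Part12

open scoped _root_.Classical
open _root_.PowerSeries _root_.WeierstrassCurve Literature.NumberTheory.EllipticCurves.DescendedFrobenius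
  Literature.NumberTheory.EllipticCurves.DescendedFrobenius
  Literature.NumberTheory.EllipticCurves.DescendedFrobenius.DescendedFrobeniusTransfer
  Literature.NumberTheory.EllipticCurves.DescendedFrobenius.NineGoodModelTransport
  Literature.NumberTheory.EllipticCurves.DescendedFrobenius.NineGoodModelTransportCalculus
  Literature.NumberTheory.EllipticCurves.DescendedFrobenius.NineDescendedFrobeniusOfOmegaColumn

namespace Literature.NumberTheory.EllipticCurves.DescendedFrobenius.DescendedFrobeniusOneModel

variable {W : WeierstrassCurve ℚ}

section Engine

variable (𝓜₁ 𝓜₂ : W.NineGoodModel)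

/-- **Transport of a power-map congruence.** If `F₂ ∈ K⟦z⟧` is log-type and `F₂ ∘ θ ≡ F₁`, then a congruence
`F₂(z^{3ᵏ}) ≡ x·classOmega 𝓜₂ + y·classEta 𝓜₂` implies `F₁(z^{3ᵏ}) ≡ x·classOmega 𝓜₁ + y·classEta 𝓜₁` with the SAME
`x, y` (all `≡` modulo bounded denominators; `θ` the isomorphism of the `𝓞`-integral change between the two good models).
[cite: Katz1981CrystallineDieudonne, Thm. 5.1.4 and §5.1 (functoriality)] -/
theorem hbd_rel_of_rel {D : VariableChange ONine} (hD : D • 𝓜₁.E = 𝓜₂.E) (hDK : D.baseChange KNine = 𝓜₂.C * 𝓜₁.C⁻¹)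
    {F₁ F₂ : KNine⟦X⟧} {dF : ℕ} (hlog : ∀ n : ℕ, IsIntegral ℤ_[3] ((3 : KNine) ^ dF * ((n : KNine) * coeff n F₂)))
    (hF : HasBoundedDenominators (F₂.subst (𝓜₁.curve.formalVariableChange (D.baseChange KNine)) - F₁)) (k : ℕ)
    {x y : KNine} (h : HasBoundedDenominators (expand (3 ^ k) (pow_ne_zero k (by norm_num)) F₂ - x • 𝓜₂.classOmega -
      y • 𝓜₂.classEta)) :
    HasBoundedDenominators (expand (3 ^ k) (pow_ne_zero k (by norm_num)) F₁ - x • 𝓜₁.classOmega - y • 𝓜₁.classEta) := by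
  set ι := algebraMap ONine KNine with hι
  obtain ⟨θ₀, hθ₀, hθ₀0⟩ := exists_map_eq_formalVariableChange_baseChange 𝓜₁.E D
  set θ := 𝓜₁.curve.formalVariableChange (D.baseChange KNine) with hθdef
  have hθ : θ₀.map ι = θ := hθ₀
  have hθs : HasSubst θ := 𝓜₁.curve.hasSubst_formalVariableChange _
  have hΩ := classOmega_subst hD hDK
  obtain ⟨g, hη⟩ := exists_classEta_subst hD hDK
  rw [← hθdef] at hΩ hη
  have hG : HasBoundedDenominators (PowerSeries.C (𝓜₂.C.u : KNine) * g.map ι) :=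
    hbd_C_mul _ ⟨0, fun n => by rw [pow_zero, one_mul]; exact isIntegral_coeff_map g n⟩
  have hcomm := hbd_expand_subst_sub_expand_subst hlog hθ₀0 k
  have h' := hbd_subst h hθ₀0
  rw [hθ] at hcomm h'
  have e : expand (3 ^ k) (pow_ne_zero k (by norm_num)) F₁ - x • 𝓜₁.classOmega - y • 𝓜₁.classEta =
      (expand (3 ^ k) (pow_ne_zero k (by norm_num)) F₂ - x • 𝓜₂.classOmega - y • 𝓜₂.classEta).subst θ -
        ((expand (3 ^ k) (pow_ne_zero k (by norm_num)) F₂).subst θ -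
          expand (3 ^ k) (pow_ne_zero k (by norm_num)) (F₂.subst θ)) -
        expand (3 ^ k) (pow_ne_zero k (by norm_num)) (F₂.subst θ - F₁) +
        y • (PowerSeries.C (𝓜₂.C.u : KNine) * g.map ι) := by
    rw [subst_sub hθs, subst_sub hθs, subst_smul hθs, subst_smul hθs, hΩ, hη, smul_add, map_sub]
    ring
  rw [e]
  exact ((h'.sub hcomm).sub (hbd_expand _ _ hF)).add (hbd_smul _ hG)

end Engine

section Independence

variable (𝓜₁ 𝓜₂ : W.NineGoodModel)

/-- The `ω`-representative of `𝓜₂` pulls back EXACTLY: `classOmega 𝓜₂ ∘ θ − classOmega 𝓜₁ = 0` has bounded denominators.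
[cite: Katz1981CrystallineDieudonne, §5.1] -/
theorem hbd_classOmega_subst_sub {D : VariableChange ONine} (hD : D • 𝓜₁.E = 𝓜₂.E)
    (hDK : D.baseChange KNine = 𝓜₂.C * 𝓜₁.C⁻¹) :
    HasBoundedDenominators (𝓜₂.classOmega.subst (𝓜₁.curve.formalVariableChange (D.baseChange KNine)) -
      𝓜₁.classOmega) := by
  rw [classOmega_subst hD hDK, sub_self]; exact HasBoundedDenominators.zero

/-- **The `ω`-COLUMN DATUM is MODEL-INDEPENDENT**: `φ[ω] ≡ c[ω] + d[η]` (`φ = (z ↦ z^{3ᵏ})^*`, here any `3`-power) holds on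
`𝓜₁` iff it holds on `𝓜₂`, with the same `c, d ∈ ℚ₃(ζ₉)` — the hypothesis `hω` of 
`isDescendedFrobeniusMatrix_exists_of_omegaColumnTransfer` is `W`-intrinsic. [cite: Katz1981CrystallineDieudonne, Thm. 5.1.4] -/
theorem hbd_omegaColumn_iff (k : ℕ) (c d : KNine) :
    HasBoundedDenominators (expand (3 ^ k) (pow_ne_zero k (by norm_num)) 𝓜₁.classOmega -
        PowerSeries.C c * 𝓜₁.classOmega - PowerSeries.C d * 𝓜₁.classEta) ↔
      HasBoundedDenominators (expand (3 ^ k) (pow_ne_zero k (by norm_num)) 𝓜₂.classOmega -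
        PowerSeries.C c * 𝓜₂.classOmega - PowerSeries.C d * 𝓜₂.classEta) := by
  haveI := isElliptic_of_nineGoodModel 𝓜₁
  simp only [← smul_eq_C_mul]
  constructor
  · intro h
    obtain ⟨D, hD, hDK⟩ := NineIntegers.exists_variableChange_smul_eq 𝓜₂ 𝓜₁
    obtain ⟨dΩ, hdΩ⟩ := logType_classOmega 𝓜₁
    exact hbd_rel_of_rel 𝓜₂ 𝓜₁ hD hDK hdΩ (hbd_classOmega_subst_sub 𝓜₂ 𝓜₁ hD hDK) k h
  · intro h
    obtain ⟨D, hD, hDK⟩ := NineIntegers.exists_variableChange_smul_eq 𝓜₁ 𝓜₂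
    obtain ⟨dΩ, hdΩ⟩ := logType_classOmega 𝓜₂
    exact hbd_rel_of_rel 𝓜₁ 𝓜₂ hD hDK hdΩ (hbd_classOmega_subst_sub 𝓜₁ 𝓜₂ hD hDK) k h

end Independence

end Literature.NumberTheory.EllipticCurves.DescendedFrobenius.DescendedFrobeniusOneModel

end Part12

/-!
## Part 13 — port of `Summits/BirchSwinnertonDyer/BirchSwinnertonDyer/Theorems/CyclotomicUntwistNineNamedFactOfKatzRank.lean` (3 declarations kept)

# `isDescendedFrobeniusMatrix_exists` from Katz's rank theorem (Dieudonné rank `=` height `≤ 2`), the second-kind property of `[η_W]` and `[η_W] ∉ L·[ω_W]` — the print input of C2 re-typed as one cited rank statement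

Declarations of this Part (verbatim port; each keeps its own docstring and citation): `subst_C_mul_mv`, `secondKind_classOmega`, `secondKind_expand_classOmega`.

Reference keys (see `references.bib` and the declarations' citations): [Katz1981CrystallineDieudonne], [SilvermanAEC2009].
-/

section Part13

open scoped _root_.Classical
open _root_.PowerSeries _root_.IsCyclotomicExtension Literature.NumberTheory.EllipticCurves.DescendedFrobenius
  Literature.NumberTheory.EllipticCurves.DescendedFrobenius.NineIntegers
  Literature.NumberTheory.EllipticCurves.DescendedFrobenius.NineHondaEstimate
  Literature.NumberTheory.EllipticCurves.DescendedFrobenius.DescendedFrobeniusTransfer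
  Literature.NumberTheory.EllipticCurves.DescendedFrobenius.NineHonda
  Literature.NumberTheory.EllipticCurves.DescendedFrobenius.NineLogUnbounded
  Literature.NumberTheory.EllipticCurves.DescendedFrobenius.NineDescendedFrobeniusOfOmegaColumn
  Literature.NumberTheory.EllipticCurves.DescendedFrobenius.NineGaloisDescent
  Literature.NumberTheory.EllipticCurves.DescendedFrobenius.DescendedFrobeniusOneModel
  Literature.NumberTheory.EllipticCurves.DescendedFrobenius.KatzFrobenius

namespace Literature.NumberTheory.EllipticCurves.DescendedFrobenius.NineNamedFactOfKatzRank

variable {W : WeierstrassCurve ℚ}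

/-- `(C a · f)` substituted into a two-variable series is `C a · (f substituted)`. [cite: Katz1981CrystallineDieudonne, §5.1 (p. 193)] -/
theorem subst_C_mul_mv {a : KNine} {f : KNine⟦X⟧} {G : MvPowerSeries (Fin 2) KNine} (hG : HasSubst G) :
    (PowerSeries.C a * f).subst G = MvPowerSeries.C a * f.subst G := by
  rw [← coe_substAlgHom hG, map_mul, C_eq_algebraMap, AlgHom.commutes, MvPowerSeries.algebraMap_apply,
    Algebra.algebraMap_self, RingHom.id_apply]

/-- **`[ω_W] = u⁻¹·log_𝓔` is of the second kind**: zero constant term, log-type coefficients (`3ᵏu⁻¹ ∈ 𝓞` for some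
`k`, `n·[zⁿ]log_𝓔 ∈ 𝓞`), and ZERO coboundary (`log_𝓔` is a homomorphism `Ê → 𝔾̂ₐ`).
[cite: Katz1981CrystallineDieudonne, §5.1 (p. 193)] [cite: SilvermanAEC2009, IV.5.2] -/
theorem secondKind_classOmega (𝓜 : W.NineGoodModel) :
    constantCoeff 𝓜.classOmega = 0 ∧
      (∃ d : ℕ, ∀ n : ℕ, IsIntegral ℤ_[3] ((3 : KNine) ^ d * ((n : KNine) * coeff n 𝓜.classOmega))) ∧
      (∃ d' : ℕ, ∀ e : Fin 2 →₀ ℕ, IsIntegral ℤ_[3] ((3 : KNine) ^ d' * MvPowerSeries.coeff e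
        (𝓜.classOmega.subst (𝓜.E.map (algebraMap ONine KNine)).formalGroupLaw -
          𝓜.classOmega.subst (MvPowerSeries.X 0) - 𝓜.classOmega.subst (MvPowerSeries.X 1)))) := by
  set u' : KNine := ((𝓜.C.u⁻¹ : KNineˣ) : KNine) with hu'
  have hΩ : 𝓜.classOmega = PowerSeries.C u' * 𝓜.curve.formalLog := by
    rw [WeierstrassCurve.NineGoodModel.classOmega, smul_eq_C_mul]
  refine ⟨?_, ?_, ⟨0, fun e => ?_⟩⟩
  · rw [hΩ, map_mul, WeierstrassCurve.constantCoeff_formalLog, mul_zero]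
  · obtain ⟨k, hk⟩ := exists_three_pow_mul_isIntegral u'
    refine ⟨k, fun n => ?_⟩
    rw [hΩ, coeff_C_mul, show (3 : KNine) ^ k * ((n : KNine) * (u' * coeff n 𝓜.curve.formalLog)) =
      (3 ^ k * u') * ((n : KNine) * coeff n 𝓜.curve.formalLog) by ring]
    exact hk.mul (natCast_mul_coeff_formalLog_mem 𝓜.E n)
  · have hG : HasSubst (𝓜.E.map (algebraMap ONine KNine)).formalGroupLaw :=
      (𝓜.E.map (algebraMap ONine KNine)).hasSubst_formalGroupLaw
    have hX0 : HasSubst (MvPowerSeries.X 0 : MvPowerSeries (Fin 2) KNine) := HasSubst.X 0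
    have hX1 : HasSubst (MvPowerSeries.X 1 : MvPowerSeries (Fin 2) KNine) := HasSubst.X 1
    have hcurve : 𝓜.curve = 𝓜.E.map (algebraMap ONine KNine) := rfl
    rw [hΩ, subst_C_mul_mv hG, subst_C_mul_mv hX0, subst_C_mul_mv hX1, hcurve,
      (𝓜.E.map (algebraMap ONine KNine)).formalLog_subst_formalGroupLaw]
    have e0 : ∀ X Y : MvPowerSeries (Fin 2) KNine,
        MvPowerSeries.C u' * (X + Y) - MvPowerSeries.C u' * X - MvPowerSeries.C u' * Y = 0 := fun X Y => by ring
    rw [e0, map_zero, mul_zero]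
    exact isIntegral_zero

/-- **`φ[ω_W]` is of the second kind** (`φ = expand 3`): `KatzFrobenius.coboundary_expand_three` (g8) for the
coboundary; the log-type clause by `[zⁿ]f(z³) = [z^{n/3}]f`. [cite: Katz1981CrystallineDieudonne, Thm. 5.1.4] -/
theorem secondKind_expand_classOmega (𝓜 : W.NineGoodModel) (ρ : ONine →+* ZMod 3) :
    constantCoeff (expand 3 (by norm_num) 𝓜.classOmega) = 0 ∧
      (∃ d : ℕ, ∀ n : ℕ, IsIntegral ℤ_[3] ((3 : KNine) ^ d *
        ((n : KNine) * coeff n (expand 3 (by norm_num) 𝓜.classOmega)))) ∧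
      (∃ d' : ℕ, ∀ e : Fin 2 →₀ ℕ, IsIntegral ℤ_[3] ((3 : KNine) ^ d' * MvPowerSeries.coeff e
        ((expand 3 (by norm_num) 𝓜.classOmega).subst (𝓜.E.map (algebraMap ONine KNine)).formalGroupLaw -
          (expand 3 (by norm_num) 𝓜.classOmega).subst (MvPowerSeries.X 0) -
          (expand 3 (by norm_num) 𝓜.classOmega).subst (MvPowerSeries.X 1)))) := by
  obtain ⟨h0, ⟨d, hd⟩, ⟨d', hd'⟩⟩ := secondKind_classOmega 𝓜
  refine ⟨by rw [constantCoeff_expand, h0], ⟨d, fun n => ?_⟩, ?_⟩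
  · rw [coeff_expand]
    split_ifs with h3
    · obtain ⟨m, rfl⟩ := h3
      rw [Nat.mul_div_cancel_left _ (by norm_num : 0 < 3), Nat.cast_mul,
        show (3 : KNine) ^ d * (((3 : ℕ) : KNine) * (m : KNine) * coeff m 𝓜.classOmega) =
          ((3 : ℕ) : KNine) * ((3 : KNine) ^ d * ((m : KNine) * coeff m 𝓜.classOmega)) by ring]
      have h3int : IsIntegral ℤ_[3] ((3 : ℕ) : KNine) := by
        rw [show ((3 : ℕ) : KNine) = algebraMap ℤ_[3] KNine 3 by rw [Nat.cast_ofNat, map_ofNat]]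
        exact isIntegral_algebraMap
      exact h3int.mul (hd m)
    · rw [mul_zero, mul_zero]; exact isIntegral_zero
  · obtain ⟨ϖ, θ, θ', h3, hθ, hker, -⟩ := exists_uniformizer
    exact ⟨d + 1 + d', fun e => coboundary_expand_three h3 hθ ρ (hker ρ) 𝓜.E hd hd' e⟩

end Literature.NumberTheory.EllipticCurves.DescendedFrobenius.NineNamedFactOfKatzRank

end Part13

/-!
## Part 14 — port of `Summits/BirchSwinnertonDyer/BirchSwinnertonDyer/Theorems/CyclotomicUntwistNineRankTwoReduction.lean` (3 declarations kept)

# `isDescendedFrobeniusMatrix_exists` ⟸ the pure rank-`2` statement — `B ≠ 0`, model transport, both independences, `ℚ₃`-rationality, `det/tr` and the power maps are all kernel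

Declarations of this Part (verbatim port; each keeps its own docstring and citation): `natCast_mul_coeff_formalEtaIntegral_mem`, `secondKind_classEta`, `not_hbd_classEta_sub_C_mul_classOmega`.

Reference keys (see `references.bib` and the declarations' citations): [Katz1981CrystallineDieudonne].
-/

section Part14

open scoped _root_.Classical
open _root_.PowerSeries _root_.IsCyclotomicExtension Literature.NumberTheory.EllipticCurves.DescendedFrobenius
  Literature.NumberTheory.EllipticCurves.DescendedFrobenius.NineIntegers
  Literature.NumberTheory.EllipticCurves.DescendedFrobenius.DescendedFrobeniusTransfer
  Literature.NumberTheory.EllipticCurves.DescendedFrobenius.NineDescendedFrobeniusOfOmegaColumn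
  Literature.NumberTheory.EllipticCurves.DescendedFrobenius.NineClassesIndependent
  Literature.NumberTheory.EllipticCurves.DescendedFrobenius.NineHondaEstimate
  Literature.NumberTheory.EllipticCurves.DescendedFrobenius.NineHonda

namespace Literature.NumberTheory.EllipticCurves.DescendedFrobenius.NineRankTwoReduction

variable {W : WeierstrassCurve ℚ}

/-- `n·[zⁿ]L_η ∈ 𝓞` for a model over `𝓞` (`[zⁿ⁺¹]L_η = P_{n+2}/(n+1)`, `P = z²x·ω` has `𝓞`-coefficients:
`ω = formalInvDiff ⊗ 1`). [cite: Katz1981CrystallineDieudonne, Lemma 5.1.2] -/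
theorem natCast_mul_coeff_formalEtaIntegral_mem (E : WeierstrassCurve ONine) (n : ℕ) :
    (n : KNine) * coeff n (E.map (algebraMap ONine KNine)).formalEtaIntegral ∈ ONine := by
  set ι := algebraMap ONine KNine with hι
  set 𝓔 := E.map ι with h𝓔
  have hP : 𝓔.formalXMulSq * 𝓔.formalOmega = (E.formalXMulSq * E.formalInvDiff).map ι := by
    rw [map_mul, WeierstrassCurve.map_formalXMulSq, WeierstrassCurve.map_formalInvDiff, ← h𝓔,
      WeierstrassCurve.formalInvDiff_eq_formalOmega]
  rcases n with _ | m
  · simp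
  · rw [𝓔.coeff_succ_formalEtaIntegral m, hP, ← mul_assoc,
      show ((m + 1 : ℕ) : KNine) * algebraMap ℚ KNine (1 / (m + 1 : ℚ)) = 1 by
        rw [show ((m + 1 : ℕ) : KNine) = algebraMap ℚ KNine (m + 1 : ℚ) by push_cast; simp, ← map_mul,
          mul_one_div_cancel (by positivity), map_one], one_mul]
    exact coeff_map_mem _ _

/-- **`[η_W] = classEta 𝓜` is of the second kind** in the spelling of `katz_dieudonne_rank_le_two`: log-type coefficients
with bounded denominators and a coboundary with bounded denominators (indeed `u · (𝓞-series)`, `coboundary_classEta`).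
[cite: Katz1981CrystallineDieudonne, §5.1 (p. 193), Lemma 5.1.2] -/
theorem secondKind_classEta (𝓜 : W.NineGoodModel) :
    (∃ d : ℕ, ∀ n : ℕ, IsIntegral ℤ_[3] ((3 : KNine) ^ d * ((n : KNine) * coeff n 𝓜.classEta))) ∧
      (∃ d' : ℕ, ∀ e : Fin 2 →₀ ℕ, IsIntegral ℤ_[3] ((3 : KNine) ^ d' * MvPowerSeries.coeff e
        (𝓜.classEta.subst (𝓜.E.map (algebraMap ONine KNine)).formalGroupLaw -
          𝓜.classEta.subst (MvPowerSeries.X 0) - 𝓜.classEta.subst (MvPowerSeries.X 1)))) := by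
  set u : KNine := (𝓜.C.u : KNine) with hu
  set v : KNine := 𝓜.C.r * ((𝓜.C.u⁻¹ : KNineˣ) : KNine) with hv
  obtain ⟨k₁, hk₁⟩ := exists_three_pow_mul_isIntegral u
  obtain ⟨k₂, hk₂⟩ := exists_three_pow_mul_isIntegral v
  have h3 : ∀ k : ℕ, IsIntegral ℤ_[3] ((3 : KNine) ^ k) := fun k => by
    have : (3 : KNine) = algebraMap ℤ_[3] KNine 3 := by rw [map_ofNat]
    rw [this, ← map_pow]; exact isIntegral_algebraMap
  refine ⟨⟨k₁ + k₂, fun n => ?_⟩, ⟨k₁, fun e => ?_⟩⟩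
  · have e : (3 : KNine) ^ (k₁ + k₂) * ((n : KNine) * coeff n 𝓜.classEta) =
        (3 : KNine) ^ k₂ * ((3 : KNine) ^ k₁ * u) * ((n : KNine) * coeff n 𝓜.curve.formalEtaIntegral) +
          (3 : KNine) ^ k₁ * ((3 : KNine) ^ k₂ * v) * ((n : KNine) * coeff n 𝓜.curve.formalLog) := by
      rw [WeierstrassCurve.NineGoodModel.classEta, map_add, PowerSeries.coeff_smul, PowerSeries.coeff_smul, smul_eq_mul,
        smul_eq_mul, ← hu, ← hv, pow_add]
      ring
    rw [e]
    exact (((h3 k₂).mul hk₁).mul (natCast_mul_coeff_formalEtaIntegral_mem 𝓜.E n)).add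
      (((h3 k₁).mul hk₂).mul (natCast_mul_coeff_formalLog_mem 𝓜.E n))
  · have hcob := FormalEtaCoboundary.coboundary_classEta 𝓜
    unfold WeierstrassCurve.NineGoodModel.curve at hcob
    rw [hcob, MvPowerSeries.coeff_C_mul, ← mul_assoc, MvPowerSeries.coeff_map, ← hu]
    exact hk₁.mul (Subtype.prop _)

/-- **`[η_W] ∉ ℚ₃(ζ₉)·[ω_W]`** on a good model with supersingular special fibre (special case of §1/`ClassesIndependent`).
[cite: Katz1981CrystallineDieudonne, Thm. 5.7.2] -/
theorem not_hbd_classEta_sub_C_mul_classOmega (𝓜 : W.NineGoodModel) (ρ : ONine →+* ZMod 3)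
    (hss : (3 : ℤ) ∣ 𝓜.specialFibreTrace ρ) (c : KNine) :
    ¬ HasBoundedDenominators (𝓜.classEta - PowerSeries.C c * 𝓜.classOmega) := by
  intro h
  have hI := classesIndependent_of_three_dvd_specialFibreTrace 𝓜 ρ hss
  have h' : HasBoundedDenominators ((-c) • 𝓜.classOmega + (1 : KNine) • 𝓜.classEta) := by
    rw [smul_eq_C_mul, smul_eq_C_mul, map_neg, map_one]
    have e : -PowerSeries.C c * 𝓜.classOmega + 1 * 𝓜.classEta = 𝓜.classEta - PowerSeries.C c * 𝓜.classOmega := by ring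
    rw [e]; exact h
  exact one_ne_zero (hI _ _ h').2

end Literature.NumberTheory.EllipticCurves.DescendedFrobenius.NineRankTwoReduction

end Part14

/-!
## Part 15 — port of `Summits/BirchSwinnertonDyer/BirchSwinnertonDyer/Theorems/CyclotomicUntwistDescendedFrobeniusMatrixExistsHolds.lean` (1 declarations kept)

# The named fact `WeierstrassCurve.isDescendedFrobeniusMatrix_exists` holds — Berthelot–Ogus/Katz existence of the descended Frobenius matrix on every supersingular good model, now a theorem

Declarations of this Part (verbatim port; each keeps its own docstring and citation): `katzRankLeTwo_supersingular`.

Reference keys (see `references.bib` and the declarations' citations): [Katz1981CrystallineDieudonne].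
-/

section Part15

open _root_.PowerSeries Literature.NumberTheory.EllipticCurves Literature.NumberTheory.EllipticCurves.DescendedFrobenius

namespace Literature.NumberTheory.EllipticCurves.DescendedFrobenius.FormalEndomorphismPadicDigits

/-- **Katz 1981 Thm. 5.3.3 for the good models over `𝓞_{ℚ₃(ζ₉)}` with SUPERSINGULAR fibre** (Katz's rank statement in the supersingular case): any three second-kind series are `ℚ₃(ζ₉)`-dependent modulo
bounded denominators. Composition of `stub_KATZ_rankLeTwo_supersingular_of_digits` with the digit
datum `exists_digits_of_map_toZMod_hom`. [cite: Katz1981CrystallineDieudonne, Thm. 5.3.3] -/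
theorem katzRankLeTwo_supersingular :
    ∀ (E : WeierstrassCurve ONine) (ρ : ONine →+* ZMod 3), IsUnit (E.map ρ).Δ →
      (3 : ℤ) ∣ Literature.NumberTheory.EllipticCurves.HasseManin.tr (E.map ρ) →
      ∀ f : Fin 3 → KNine⟦X⟧,
        (∀ i, constantCoeff (f i) = 0 ∧
          (∃ d : ℕ, ∀ n : ℕ, IsIntegral ℤ_[3] ((3 : KNine) ^ d * ((n : KNine) * coeff n (f i)))) ∧
          (∃ d' : ℕ, ∀ e : Fin 2 →₀ ℕ, IsIntegral ℤ_[3] ((3 : KNine) ^ d' * MvPowerSeries.coeff e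
            ((f i).subst (E.map (algebraMap ONine KNine)).formalGroupLaw - (f i).subst (MvPowerSeries.X 0) -
              (f i).subst (MvPowerSeries.X 1))))) →
        ∃ a : Fin 3 → KNine, a ≠ 0 ∧ HasBoundedDenominators (∑ i, PowerSeries.C (a i) * f i) :=
  KatzRankSupersingular.stub_KATZ_rankLeTwo_supersingular_of_digits
    (fun V₀ _ _ hV₀ => exists_digits_of_map_toZMod_hom V₀ hV₀)

end Literature.NumberTheory.EllipticCurves.DescendedFrobenius.FormalEndomorphismPadicDigits

end Part15

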